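import Mathlib.Analysis.Complex.Schwarz
import Mathlib.Analysis.Normed.Group.FunctionSeries
import Literature.MathematicalPhysics.QuantumFieldTheory.Balaban1983to89.T4BetaStationary
import Summits.QuantumFields.YangMills.Theorems.BalabanUVNodesK2V6Defs
import Summits.QuantumFields.YangMills.Theorems.BalabanUVNodesK2EndOfChain190OwnDrift
import Summits.QuantumFields.YangMills.Theorems.BalabanUVNodesN17RunRemAtOfShiftAnchorLevel
import Summits.QuantumFields.YangMills.Theorems.BalabanUVNodesK2RunRowsContOfCorner
import Summits.QuantumFields.YangMills.Theorems.BalabanUVNodesK1R8RowsDefs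
import Summits.QuantumFields.YangMills.Theorems.BalabanUVNodesK2CornerRoadRowsMassBand

/-!
# Idea-5 g13 sketch 6 — EDITION 6 of `two-bound-activity-interpolation` (carrier crux K2⁷ `EndpointGivenBR13SepCoPH`, stmt-QuantumFields-20543, `aside` since rev 27; deciding crux K1⁸
# `StabilityBRunRowsAtRecordR13SepCoPH`, stmt-QuantumFields-26907): §1–§11 = `Idea5g12RunCurrencySketch5.lean` (1de193fa596c, sha16 e4f849bb82ddb7cc) VERBATIM in code (namespace renamed `…Idea5g13`; the edition-4 header PROSE elided for the 200 kB cap, see the marker below;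
# ONE import added: PORT-1's landed R-BM road `Theorems.BalabanUVNodesK2CornerRoadRowsMassBand`, p622247) + §12 NEW: BN-O «the deciding crux reads β only along its own runs» ⇒ D-REPR RUN-TYPED (`RunRecordRepr13`), the history payment ALONG RUNS (`ContAlongRuns`,
# ★ `survCont_of_contAlongRuns`), ★¹⁰ `k1R8_of_k1R7_runOnly` (K1⁸ BY NAME from a run object; ★⁸ = ★¹⁰ ∘ `ofBox`); h5′ PASS (memo `DESK-H5P-two-bound-idea5g13.md`); S-1 PAID
# (`firstEntryLip_le_inv_sqrt`, `firstEntryLip_not_geom`); R-BM's kernel shadow (`histLipschitz_firstEntry_of_firstEntryOnly`, `mass_firstEntry`, `MassLipOnBox` ⟹ U3ᴷ-lite).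
# §13 NEW (rev 28 landed mid-session, 09:54Z): the deciding crux is now K1⁹ `StabilityBRunRowsAtRecordR13SepCoPHV` (stmt-QuantumFields-27364; K1⁸ aside) — RE-KEY ★¹¹
# `k1R9_of_k1R7_runOnly` (K1⁹ BY NAME at the trivial revision, door `rfl`), slot-keyed `RunRecordRepr13V` + ★¹¹ⱽ `k1R9_of_witnessV_runOnlyV`, Thm-1-keyed `RunRecordRepr13T` (`toV`, `toR`) + ★¹¹ᵀ `k1R9_of_witnessV_runOnlyT`.

Cell `ym-nodeO-ideate`, IDEATOR seat `ym-nodeO-idea-5` gen 13 (planner-ym-nodeO-idea-5-g13-0), lens «obstruction-first».  Crux workfile (count-neutral; nothing registered, nothing filed under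
Theorems; no item claimed).  Companion of EDITION 6 of the crux idea card `Ideas/two-bound-activity-interpolation.md` (same slug, refined in place); answers CRIT-2 g3 ROUND 5
(`CRIT-2-ROUND5-two-bound-activity-interpolation.md`, HOME STATUS S.2003: «SURVIVES priced NEW-COMBINATION; P-FE PAID; S-1 optional; h5′ endorsed next; (P1) D-REPR definer-first = THE debt»).
§12's module docstring carries the whole edition-6 delta; §1–§11 and the edition-5 header below are UNCHANGED TEXT (read «g12 ∕ sketch 5» there as history).

HONEST FRAMING (edition 6, governs everything below).  Nothing here proves the Yang–Mills mass gap (Clay) or any rung of it.  Route R4 `BalabanUVNodes` (rev 27) closes only the CONDITIONAL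
finite-𝕋⁴ rung `BalabanLadder.UV`; NODE O = [Balaban1987RG1] Thm 2 ∕ (0.31) p. 259 is UNPROVED in print; K0⁷ stmt-QuantumFields-20541 ∕ K1⁸ 26907 ∕ K3⁷ 20544 OPEN, K1⁷ 20542 ∕ K2⁷ 20543
`aside` and OPEN; `𝓡 : RunRecordRepr13` and `𝓑 : BoxRecordRepr13` are inhabited NOWHERE; every ★ is CONDITIONAL bookkeeping or elementary real analysis about generic objects; counts unmoved.

---- EDITION-5 HEADER (retained verbatim) ----
# Idea-5 g12 sketch 5 — EDITION 5 of `two-bound-activity-interpolation` (crux K2⁷ `EndpointGivenBR13SepCoPH`, stmt-QuantumFields-20543, `aside` since rev 27; deciding crux K1⁸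
# `StabilityBRunRowsAtRecordR13SepCoPH`, stmt-QuantumFields-26907): §1–§10 = `Idea5g11TermLevelPriceSketch4.lean` ed.4.1 (64eb7676ca1b, sha16 f01b248465594cad) VERBATIM (namespace renamed
# `…Idea5g12`, ONE import added: DEF-1's `Theorems.BalabanUVNodesK1R8RowsDefs`, p616926) + §11 NEW: CRIT-2 g3 ROUND-4's one new price P-FE PAID (supplier obligation RE-TYPED from the LAST-ENTRY
# currency `LinOnBox13` to the RUN currency `LinOnRuns13`; anchor side in BOX-SIZE ∕ FADED currency `SizeLinOnBox13`), DEF-1's landed names met (`RunRows13 ↔ RunRowsCont13` by `Iff.rfl`, K1⁸ ∕ K2⁷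
# BY NAME through `RowsContAll`), and the obstruction-first record BN-N «MARGINAL TRANSPORT ≠ GEOMETRIC FADING» with its two kernel lemmas (what follows if the fading letter is ASSUMED at
# the tree's current record) + the CF-REN reading of [I] pp. 257–259 (age factors geometric but STATIC; one-step feedback unprinted).

Cell `ym-nodeO-ideate`, IDEATOR seat `ym-nodeO-idea-5` gen 12 (planner-ym-nodeO-idea-5-g12-0), lens «obstruction-first».  Crux workfile (count-neutral; nothing registered, nothing filed under
Theorems; no item claimed).  Companion of EDITION 5 of the crux idea card `Ideas/two-bound-activity-interpolation.md` (same slug, refined in place); answers CRIT-2 g3 ROUND 4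
(`CRIT-2-ROUND4-two-bound-activity-interpolation.md`, HOME STATUS S.1965: «SURVIVES priced, NEW-COMBINATION; prices (P1) D-REPR inhabit `𝓑` (definer-first, XL) · (P-FE) currency re-type
(≤ 30 l., idea-5) · (P3) CF-REN reading (≤ 1 h, endorsed next falsifier) · (P4) h5′») and ADDENDUM-2 (`CRIT-2-ADDENDUM2-FE-last-entry-currency.md`, kernels `Crit2LastEntryBlind.lean` a618bff64760,
`Crit2FadedCurrency.lean` 581521d93e33).  §11's module docstring carries the whole edition-5 delta; §1–§10 and the edition-4 header below are UNCHANGED TEXT (read «g11 ∕ sketch 4» there as history).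

HONEST FRAMING (edition 5, governs everything below).  Nothing here proves the Yang–Mills mass gap (Clay) or any rung of it.  Route R4 `BalabanUVNodes` closes only the CONDITIONAL finite-𝕋⁴
rung `BalabanLadder.UV`; NODE O = [Balaban1987RG1] Thm 2 ∕ (0.31) p. 259 is UNPROVED in print; K0⁷ stmt-QuantumFields-20541 ∕ K1⁸ 26907 ∕ K3⁷ 20544 OPEN, K1⁷ 20542 ∕ K2⁷ 20543 `aside`
and OPEN; `𝓑 : BoxRecordRepr13` is inhabited NOWHERE; every ★ is CONDITIONAL bookkeeping or elementary real analysis about generic objects; counts unmoved (typed 28∕28 · discharged 5∕27).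

---- EDITION-4 HEADER (the five `#` summary lines and the CONTENTS list retained; the edition-4 prose paragraphs «Cell … seat gen 11 …», «HONEST FRAMING …» and the
Sources list are ELIDED here for the 200 000-byte crux-write cap — they stand verbatim in the first publish 4ca185107151 :54–:78 ∕ :106–:114 and in Sketch5 1de193fa596c) ----
# Idea-5 g11 sketch 4 — EDITION 4(.1) of `two-bound-activity-interpolation` for crux K2⁷ `EndpointGivenBR13SepCoPH` (stmt-QuantumFields-20543; since rev 27 an `aside` decl — §10 re-keys the road to the deciding K1⁸ `StabilityBRunRowsAtRecordR13SepCoPH` BY NAME): Sketch3's corner∕box modulus road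
# UNCHANGED (§1–§5 = `Idea5g10CornerModulusRoadSketch3.lean` 3309c1c8983d :60–:529 verbatim, namespace renamed, three `open` lines added) + CRIT-2 g3 ROUND-3's ONE remaining Lean-side
# PRICE PAID (§6–§9): the interface now carries term-level fields the single-polymer collapse CANNOT meet from `BoxRemainder`, each USED in a theorem — (a) history side (ADOPTED): (C),
# U2's `HistLipschitz`, U3's `FadingMemory` as THEOREMS of the representation (+ the renewal lemma = the fading mechanism, the fermionic «short memory property» in abstract form);
# (b) S-LIN side (EXECUTED, PLACED INSIDE barrier B-III, NOT adopted): last-slot disc-holomorphy ⟹ S-LIN-BOX by Schwarz; §9 the kernel SEPARATION from the collapse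

CONTENTS (0 `sorry`; no `instance`, `notation`, `axiom`):
* §1–§5 = Sketch3 VERBATIM (namespace renamed `…Idea5g11`): `RunModulus` road, the v7c corner texts `CornerDriftPos13` ∕ `RunChain190AtCornerDriftSlope13`, sockets 1ᶜᴹ ∕ 1ᶜᴹ′ ∕ 1ᶜᶜ and
  roads to the crux decl BY NAME (★★ `EndpointGivenBR13SepCoPH_of_cornerDrift_runModulus` = plan g84 (5d)), reserve dials, engine `omegaMin` ∕ `tendsto_omegaMin` ∕ `abs_tsum_le_omegaMin`,
  interface `ActivityRepr` ∕ `BoxActivityRepr` ∕ `LinOnBox`, `scaleAnchor_of_linOnBox`, record type `BoxRecordRepr13` (`N` a field), ★★★★ `EndpointGivenBR13SepCoPH_of_linOnBox_drift_survCont`.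
* §6 (price (a), history side, generic over `R : BoxActivityRepr β b γ₀`): (a0) `ContOnBox R` ⟹ ★ `betaContH_of_contOnBox` (M-test) ⟹ ★ `survCont_of_contOnBox`; (a1) `LipOnBox R L`
  (termwise history moduli, X-summable) ⟹ ★ `histLipschitz_of_lipOnBox : HistLipschitz (sumModuli L) γ₀ β` (T4CouplingMatching :235), `contOnBox_of_lipOnBox`; (a2) `FadingOnBox L C θ` ⟹
  ★ `fadingMemory_of_lipOnBox` (:244), `histLetters_of_lipOnBox_fading` (U2 ∧ U3 history letters from ONE object); (a1⁻) `CrudeLipOnBox R L` (NON-summable per-polymer constants) ⟹ ★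
  `abs_sub_le_omegaMin_of_crudeLip` + `tendsto_crudeModulus` (the two-bound engine's SECOND use: a k-uniform history modulus of continuity), `contOnBox_of_crudeLip`; §6·R (a3) ★
  `fading_of_renewal` (one-step irrelevance `C₀θ^a` + own-coupling bound `d` ⟹ influence `≤ d(θ+C₀)^{age}`; `geomConv_le`), `fadingOnBox_of_renewal`.
* §7 (option (b), EXECUTED AND PLACED inside B-III — not adopted): `HoloLastOnBox R R₀ M′` ⟹ ★ `linOnBox_of_holoLast` (Schwarz: `A X := M′ X ∕ R₀`; disc majorant `M′` INDEPENDENT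
  of the frozen `M`, non-summable, by the card's own CF1.a), `scaleAnchor_of_holoLast`; the docstring records WHY a k-free disc at `g_k = 0` is not available (sector; radius ∝ g_k;
  χ-tails).
* §8 (at the record, about ONE delivered `𝓑 : BoxRecordRepr13`): obligations `ContOnBox13` ∕ `LipOnBox13` ∕ `FadingLip13` ∕ `HoloLast13`; ★ `survContSome13_of_contOnBox13` ((C) DERIVED),
  `linOnBox13_of_holoLast13`; ★⁵ `EndpointGivenBR13SepCoPH_of_linOnBox_drift_cont (𝓑) : LinOnBox13 𝓑 → DriftAtN13 𝓑 → ContOnBox13 𝓑 → …EndpointGivenBR13SepCoPH`; ★⁶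
  `EndpointGivenBR13SepCoPH_of_holo_drift_cont` (executed option (b), recorded not recommended); ★⁵′ `…_of_linOnBox_drift_lip`; ★ `histLipschitzAt13_of_lipOnBox13` (U2's letter shape on the window `𝓑.γ₀ ≤ θ.γ` —
  window caveat stated), ★ `histHalfU3At13_of_fadingLip13` (U3ᴷ's two history conjuncts on the window).
* §9 (kernel separation): `betaJump` (`β_k(p) = p_k·𝟙[p_0 < ½]`): `boxRemainder_betaJump`, `not_betaContH_betaJump`, ★ `collapse_misses_contOnBox`, `collapse_misses_lipOnBox` — the linear
  box remainder does NOT give any representation with the edition-4 fields (the ed.3 sandwich is broken on the left).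
* §10 (EDITION 4.1, REV-27 RE-KEY, added after the route edit of 08:06–08:10Z made K2⁷ an `aside` and K1⁸ `StabilityBRunRowsAtRecordR13SepCoPH` (stmt-QuantumFields-26907) the deciding
  crux): `RunwiseFloor` (row (iv) named), ★ `runwiseFloor_of_drift_runConstRemainder` (drift + slope-capped remainder ⟹ floor `M := 2A` — where NODE O's smallness now lives), ★
  `runRows_of_linOnBox_drift_cont` (rows (i)+(iv)+(C) on a shrunk level), `RunRows13` (K1⁸'s rows conjunct at a tuple), ★ `runRows13_of_linOnBox_drift_cont`, ★⁷
  `k1R8_of_k1R7_linOnBox_drift_cont (𝓑) : LinOnBox13 𝓑 → DriftAtN13 𝓑 → ContOnBox13 𝓑 → StabilityBAtRecordR13SepCoPH → StabilityBRunRowsAtRecordR13SepCoPH` (K1⁸ BY NAME from K1⁷ as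
  hypothesis + the same three obligations as ★⁵), ★⁷′ `…_drift_lip`; DEDUP WITH THE TREE: `weakCurrencyK_of_linOnBox_drift_cont` (the box edition supplies an4's
  weak currency «prefix → ∃ b s A γ₀ r, drift ∧ 0 < γ₀ ∧ r ≤ s ∧ RunConstRemainder ∧ SurvCont» at every tuple) and ★⁷ᵀ `k1R8_of_k1R7_viaTreeBridge` = the same landing THROUGH the landed
  `Theorems.BalabanUVNodesK2RunRowsContOfCorner.rowsContAllK_of_ownDrift_runConstRemainderK` (an4 g153, 08:25Z).  §1–§9 are unchanged by the re-key (their concluders now reach an aside decl; their content feeds §10).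

-/

noncomputable section

namespace Summit.QuantumFields.YangMills.Cruxes.EndpointGivenBR13SepCoPH.Idea5g13

open Filter Topology
open Literature.MathematicalPhysics.QuantumFieldTheory.Balaban1983to89
open Literature.MathematicalPhysics.QuantumFieldTheory.Balaban1983to89.FlowStep
open Literature.MathematicalPhysics.QuantumFieldTheory.Balaban1983to89.B13ScaleTransfer (Pt)
open Literature.MathematicalPhysics.QuantumFieldTheory.Balaban1983to89.DagBinding (EndpointExistence ForwardGenerated)
open Literature.MathematicalPhysics.QuantumFieldTheory.Balaban1983to89.T4Continuum (T4Family)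
open Literature.MathematicalPhysics.QuantumFieldTheory.Balaban1983to89.Beta.Drift (OneLoopDrift)
open Literature.MathematicalPhysics.QuantumFieldTheory.Balaban1983to89.B12Beta (HistBox)
open Literature.MathematicalPhysics.QuantumFieldTheory.Balaban1983to89.Beta.RemainderChainLattice
open Literature.MathematicalPhysics.QuantumFieldTheory.Balaban1983to89.Beta.RemainderLimitTorus (LDom limKernel)
open Literature.MathematicalPhysics.QuantumFieldTheory.Balaban1983to89.Beta.RemainderLocalityHolo
open Literature.MathematicalPhysics.QuantumFieldTheory.Balaban1983to89.Beta.RemainderDecay190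
open Literature.MathematicalPhysics.QuantumFieldTheory.Balaban1983to89.Beta.RemainderDecay190HoloChain
open Summit.QuantumFields.YangMills.Theorems.BalabanUVNodesK2NamedJetsRemAt (ScaleAnchor)
open Summit.QuantumFields.YangMills.Theorems.BalabanUVNodesK2NamedJetsRunRemAt (RunConstRemainder SurvCont
  endpointExistence_of_drift_runConstRemainder_survCont)
open Summit.QuantumFields.YangMills.Theorems.BalabanUVNodesK2RunRemAtOfChain190 (runConstRemainder_of_runLeaves190H)
open Summit.QuantumFields.YangMills.Theorems.BalabanUVNodesK2V6Defs (Window13)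
open Summit.QuantumFields.YangMills.BalabanUVNodes.N17RunRemAtOfShiftAnchorLevel (survCont_anti)
open Literature.MathematicalPhysics.QuantumFieldTheory.Balaban1983to89.T4CouplingMatching (HistLipschitz FadingMemory)
open Summit.QuantumFields.YangMills.Theorems.BalabanUVNodesK2JsOfRecord (BoxRemainder)
open Summit.QuantumFields.YangMills.Theorems.BalabanUVNodesK2NamedJetsRunRemAt (SurvCont.of_betaContH)

/-! ## §1 Letters (generic): the modulus letter VERBATIM; ★ drift + modulus + (C) at ONE level ⟹ `EndpointExistence` -/

/-- **`RunModulus β b γ₀` — the plain run-wise MODULUS letter**, VERBATIM `Idea5g9TwoBoundSketch2.lean` :114 = `Crit2Idea5g8Probe.lean` :32 (slot convention `k ≤ n` = the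
tree's `RunConstRemainder`): ONE function `ω → 0` at `0⁺` bounds `|β_{k+1}(g_0,…,g_k) − b_k|` by `ω(g_k)` at every prefix of every in-window run of (0.20).  Hypothesis
SHAPE; print's (2.13) «vanishes at g_k = 0» is its source, the uniformity in k is NOT printed. [cite: Balaban1987RG1, Thm 3 p.264 and (2.13) p.268] -/
def RunModulus (β : HBeta) (b : ℕ → ℝ) (γ₀ : ℝ) : Prop :=
  ∃ ω : ℝ → ℝ, Tendsto ω (𝓝[>] 0) (𝓝 0) ∧
    ∀ n gs, RGEqH n β gs → Step.InInterval γ₀ n gs → ∀ k, k ≤ n → |β k (prefixOf gs k) - b k| ≤ ω (gs k)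

/-- The modulus letter restricts to lower levels. [folklore] -/
theorem runModulus_mono {β : HBeta} {b : ℕ → ℝ} {γ₀ γ₁ : ℝ} (h : RunModulus β b γ₀) (hle : γ₁ ≤ γ₀) : RunModulus β b γ₁ := by
  obtain ⟨ω, hω, hrun⟩ := h
  exact ⟨ω, hω, fun n gs hrg hI k hk => hrun n gs hrg (fun j hj => ⟨(hI j hj).1, (hI j hj).2.trans hle⟩) k hk⟩

/-- **MODULUS ⟹ CONSTANT REMAINDER WITH ANY CAP** (verbatim Sketch2 :125): for EVERY `s > 0` there is a level `0 < γ₁ ≤ γ₀` with `RunConstRemainder β b s γ₁` — the cap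
is paid by the WINDOW, not by a smallness letter. [folklore] -/
theorem runConstRemainder_of_runModulus {β : HBeta} {b : ℕ → ℝ} {γ₀ : ℝ} (h : RunModulus β b γ₀) (hγ₀ : 0 < γ₀) {s : ℝ}
    (hs : 0 < s) : ∃ γ₁ : ℝ, 0 < γ₁ ∧ γ₁ ≤ γ₀ ∧ RunConstRemainder β b s γ₁ := by
  obtain ⟨ω, hω, hrun⟩ := h
  have hev : ∀ᶠ g in 𝓝[>] (0 : ℝ), ω g < s := (tendsto_order.1 hω).2 s hs
  obtain ⟨u, hu, hsub⟩ := mem_nhdsGT_iff_exists_Ioo_subset.1 hev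
  have hu0 : (0 : ℝ) < u := hu
  refine ⟨min γ₀ (u / 2), lt_min hγ₀ (half_pos hu0), min_le_left _ _, ?_⟩
  intro n gs hrg hI k hk
  have hI₀ : Step.InInterval γ₀ n gs := fun j hj => ⟨(hI j hj).1, (hI j hj).2.trans (min_le_left _ _)⟩
  have hmem : gs k ∈ Set.Ioo 0 u :=
    ⟨(hI k hk).1, lt_of_le_of_lt ((hI k hk).2.trans (min_le_right _ _)) (half_lt_self hu0)⟩
  have hlt : ω (gs k) < s := hsub hmem
  exact (hrun n gs hrg hI₀ k hk).trans hlt.le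

/-- **MODULUS + (C) AT ONE LEVEL ⟹ THE CAP-KEYED LETTER PAIR at a smaller level** (the window pays the cap; (C) moves down by node N17's `survCont_anti`). [folklore] -/
theorem capRem_of_runModulus_survContAt {β : HBeta} {b : ℕ → ℝ} {γ₀ s : ℝ} (h : RunModulus β b γ₀) (hγ₀ : 0 < γ₀) (hs : 0 < s) (hsc : SurvCont β γ₀) :
    ∃ γ₁ r : ℝ, 0 < γ₁ ∧ r ≤ s ∧ RunConstRemainder β b r γ₁ ∧ SurvCont β γ₁ := by
  obtain ⟨γ₁, hγ₁, hle, hrem⟩ := runConstRemainder_of_runModulus h hγ₀ hs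
  exact ⟨γ₁, s, hγ₁, le_rfl, hrem, survCont_anti hγ₁ hle hsc⟩

/-- **★ DRIFT + MODULUS + (C) AT ONE LEVEL ⟹ `EndpointExistence`** (forward-generated constructions): a drift of `b` with slope `s > 0`, the modulus of `β` relative to the SAME `b` on
`]0, γ₀]` and survivor continuity at the level `γ₀` give [I] Thm 2's endpoint-existence half — cap `r := s` at some `0 < γ₁ ≤ γ₀` (`capRem_of_runModulus_survContAt`), then the
tree's END `endpointExistence_of_drift_runConstRemainder_survCont` (p596574 :156).  No anchor used, no κ, no `θ.cβ`, no smallness letter.  CONDITIONAL bookkeeping; nothing of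
Bałaban asserted. [cite: Balaban1987RG1, Thm 2 p.259 (first sentence), Thm 3 p.264, (2.13) p.268 and (5.10) p.293] -/
theorem endpointExistence_of_drift_runModulus_survContAt {β : HBeta} {C : B12.Construction} (hgen : ForwardGenerated C β) {b : ℕ → ℝ}
    {γ₀ s A : ℝ} (hγ₀ : 0 < γ₀) (hs : 0 < s) (hdrift : OneLoopDrift s A b) (hmod : RunModulus β b γ₀) (hsc : SurvCont β γ₀) :
    EndpointExistence C := by
  obtain ⟨γ₁, r, hγ₁, hr, hrem, hsc₁⟩ := capRem_of_runModulus_survContAt hmod hγ₀ hs hsc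
  exact endpointExistence_of_drift_runConstRemainder_survCont hgen hγ₁ hdrift hrem hr hsc₁

/-! ## §2 The v7 CORNER keying: the two draft texts VERBATIM, the modulus socket in plan (5d)'s shape, the consumed text 1ᶜᶜ, and the roads BY NAME -/

/-- **2ᶜᴰ `CornerDriftPos13` = v7c draft :535 `CornerDriftPos` VERBATIM (hypothesis shape; registered-to-be stub `stub_cornerDriftPos13`)**: under the crux prefix the record's β HAS
in-box corner limits `b` (`ScaleAnchor`) drifting with SOME positive slope.  Re-declared only because the desk draft is not importable; never a fact. [cite: Balaban1987RG1, (1.3) p.260, (1.22) p.264 and (2.12)–(2.13) p.268] -/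
def CornerDriftPos13 : Prop :=
  ∀ (F : T4Family) (θ : Node00.Stage13HParams F 2) (hP : θ.Provisos₁₃SepCoPH F 2), (θ.ZhUnity F 2 ∧ θ.SlotsNondegenerate₁₃ F 2) → θ.Admissible F 2 →
    B16.EndStatementBPrinted (Node00.datumOfRecord₁₃SepCoPH F 2 θ hP).C → Window13 F θ hP →
    ∃ (b : ℕ → ℝ) (s A : ℝ), ScaleAnchor (Node00.datumOfRecord₁₃SepCoPH F 2 θ hP).βfun b ∧ 0 < s ∧ OneLoopDrift s A b

/-- **1ᶜᴿ `RunChain190AtCornerDriftSlope13` = v7c draft :549 `RunChain190AtCornerDriftSlope` VERBATIM (hypothesis shape; registered-to-be stub `stub_runChainCornerSlope13`)**: NODE O's wall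
relative to the anchored corner numbers with the cap against the given slope.  Re-declared only because the desk draft is not importable; never a fact; size XL; instance 0∕1.
[cite: Balaban1987RG1, Thm 2 p.259 (first sentence), Thm 3 p.264, (2.12)–(2.14) p.268 and (5.10) p.293; Balaban1988RG2Cluster, Lemma 3 (2.38) p.20] -/
def RunChain190AtCornerDriftSlope13 : Prop :=
  ∀ (F : T4Family) (θ : Node00.Stage13HParams F 2) (hP : θ.Provisos₁₃SepCoPH F 2), (θ.ZhUnity F 2 ∧ θ.SlotsNondegenerate₁₃ F 2) → θ.Admissible F 2 →
    B16.EndStatementBPrinted (Node00.datumOfRecord₁₃SepCoPH F 2 θ hP).C → Window13 F θ hP →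
    ∀ (b : ℕ → ℝ) (s A : ℝ), ScaleAnchor (Node00.datumOfRecord₁₃SepCoPH F 2 θ hP).βfun b → 0 < s → OneLoopDrift s A b →
    ∃ (M : ℕ) (_ : NeZero M) (μ ν : Fin 4) (c : B13.Consts) (ℓ α₂ : ℝ) (q : Consts190) (γ₀ : ℝ),
      (∀ (n : ℕ) (gs : ℕ → ℝ), RGEqH n (Node00.datumOfRecord₁₃SepCoPH F 2 θ hP).βfun gs → Step.InInterval γ₀ n gs → ∀ k, k ≤ n →
        ∃ a : LDom 4 → Pt 4 → ℝ, (Node00.datumOfRecord₁₃SepCoPH F 2 θ hP).βfun k (prefixOf gs k) - b k =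
          B12Beta.secondMoment (fun _ _ => limKernel a) μ ν ∧ Nonempty (PolLeavesTFac190H 4 M a c ℓ α₂ q)) ∧
      CondsL 4 c ℓ ∧ c.R22gen ℓ ∧ q.Valid c.δ₀ ∧ SignsL c α₂ q.B₃ ∧ 0 < γ₀ ∧
      c.ε₁ * remCoeffL 4 M c α₂ q.B₃ ≤ s ∧ SurvCont (Node00.datumOfRecord₁₃SepCoPH F 2 θ hP).βfun γ₀

/-- **1ᶜᴹ `RunModulusAtCornerDriftSlope13` — THE RE-KEYED MODULUS SOCKET, plan g84 (5d)'s displayed shape VERBATIM (hypothesis shape)**: «given ANY anchored, positively drifting corner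
sequence `b`, the record's β has a run-wise MODULUS relative to `b` on some window `]0, γ₀]`, `γ₀ ≤ θ.γ`, with (C) at `γ₀`».  NO anchor hypothesis of its own (the anchor is the
text's antecedent), NO κ, NO `θ.cβ`.  THE one socket text the three modulus cards key to after v7 registers (CRIT-2 ROUND-2 rider; plan (5d)).  Never a fact. [cite: Balaban1987RG1, Thm 2 p.259 (first sentence) and (2.13) p.268] -/
def RunModulusAtCornerDriftSlope13 : Prop :=
  ∀ (F : T4Family) (θ : Node00.Stage13HParams F 2) (hP : θ.Provisos₁₃SepCoPH F 2), (θ.ZhUnity F 2 ∧ θ.SlotsNondegenerate₁₃ F 2) → θ.Admissible F 2 →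
    B16.EndStatementBPrinted (Node00.datumOfRecord₁₃SepCoPH F 2 θ hP).C → Window13 F θ hP →
    ∀ (b : ℕ → ℝ) (s A : ℝ), ScaleAnchor (Node00.datumOfRecord₁₃SepCoPH F 2 θ hP).βfun b → 0 < s → OneLoopDrift s A b →
    ∃ γ₀ : ℝ, 0 < γ₀ ∧ γ₀ ≤ θ.γ ∧ RunModulus (Node00.datumOfRecord₁₃SepCoPH F 2 θ hP).βfun b γ₀ ∧
      SurvCont (Node00.datumOfRecord₁₃SepCoPH F 2 θ hP).βfun γ₀

/-- **1ᶜᴹ′ `RunModulusAtCorner13` — THE DRIFT-FREE CUT of the socket (hypothesis shape)**: a modulus supplier reads NEITHER the slope NOR the drift — «for any anchored corner sequence `b`,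
a window with the modulus and (C)».  Implies 1ᶜᴹ (`runModulusAtCornerDriftSlope13_of_atCorner`); offered as the card-side statement (what S-LIN + Tannery actually produce).  Never a fact. [cite: Balaban1987RG1, (2.13) p.268] -/
def RunModulusAtCorner13 : Prop :=
  ∀ (F : T4Family) (θ : Node00.Stage13HParams F 2) (hP : θ.Provisos₁₃SepCoPH F 2), (θ.ZhUnity F 2 ∧ θ.SlotsNondegenerate₁₃ F 2) → θ.Admissible F 2 →
    B16.EndStatementBPrinted (Node00.datumOfRecord₁₃SepCoPH F 2 θ hP).C → Window13 F θ hP →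
    ∀ b : ℕ → ℝ, ScaleAnchor (Node00.datumOfRecord₁₃SepCoPH F 2 θ hP).βfun b →
    ∃ γ₀ : ℝ, 0 < γ₀ ∧ γ₀ ≤ θ.γ ∧ RunModulus (Node00.datumOfRecord₁₃SepCoPH F 2 θ hP).βfun b γ₀ ∧
      SurvCont (Node00.datumOfRecord₁₃SepCoPH F 2 θ hP).βfun γ₀

theorem runModulusAtCornerDriftSlope13_of_atCorner (h : RunModulusAtCorner13) : RunModulusAtCornerDriftSlope13 :=
  fun F θ hP hU hθ hB hwin b _s _A hanch _hs _hd => h F θ hP hU hθ hB hwin b hanch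

/-- **1ᶜᶜ `CapRemAtCornerDriftSlope13` — THE CONSUMED TEXT (hypothesis shape; WHAT THE END READS of either 1ᴿ-side supplier)**: «given any anchored, positively drifting corner sequence `b`
with slope `s`: SOME window `γ₀ > 0` and SOME radius `r ≤ s` with `RunConstRemainder β b r γ₀` and (C) at `γ₀`».  1ᶜᴿ ⟹ 1ᶜᶜ (`capRem13_of_runChain190`, `r := c.ε₁·K_rem,L`) and 1ᶜᴹ ⟹ 1ᶜᶜ
(`capRem13_of_runModulus`, `r := s`).  Never a fact. [cite: Balaban1987RG1, Thm 2 p.259 (first sentence), (2.12)–(2.14) p.268 and (5.10) p.293] -/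
def CapRemAtCornerDriftSlope13 : Prop :=
  ∀ (F : T4Family) (θ : Node00.Stage13HParams F 2) (hP : θ.Provisos₁₃SepCoPH F 2), (θ.ZhUnity F 2 ∧ θ.SlotsNondegenerate₁₃ F 2) → θ.Admissible F 2 →
    B16.EndStatementBPrinted (Node00.datumOfRecord₁₃SepCoPH F 2 θ hP).C → Window13 F θ hP →
    ∀ (b : ℕ → ℝ) (s A : ℝ), ScaleAnchor (Node00.datumOfRecord₁₃SepCoPH F 2 θ hP).βfun b → 0 < s → OneLoopDrift s A b →
    ∃ γ₀ r : ℝ, 0 < γ₀ ∧ r ≤ s ∧ RunConstRemainder (Node00.datumOfRecord₁₃SepCoPH F 2 θ hP).βfun b r γ₀ ∧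
      SurvCont (Node00.datumOfRecord₁₃SepCoPH F 2 θ hP).βfun γ₀

/-- **1ᶜᴿ ⟹ 1ᶜᶜ (proved): the draft's registered-to-be NODE-O text implies the consumed text** — the (190)-leaves give `RunConstRemainder` with radius `c.ε₁·K_rem,L` (an4's
`runConstRemainder_of_runLeaves190H`), the cap conjunct gives `r ≤ s`; `0 < γ₀` and (C) are conjuncts.  The display rows `(M, μ, ν, c, ℓ, α₂, q, a)` enter through the value bound only
(an4 g153 (W2) ∕ plan (5c) «consumer side = kernel fact», here on the v7c text). [cite: Balaban1987RG1, (1.22) p.264 and (5.10) p.293; Balaban1988RG2Cluster, Lemma 3 (2.38) p.20] -/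
theorem capRem13_of_runChain190 (h : RunChain190AtCornerDriftSlope13) : CapRemAtCornerDriftSlope13 := by
  intro F θ hP hU hθ hB hwin b s A hanch hs hd
  obtain ⟨M, iM, μ, ν, c, ℓ, α₂, q, γ₀, hrun, hC, h22, hq, hsg, hγ₀, hcap, hcont⟩ := h F θ hP hU hθ hB hwin b s A hanch hs hd
  exact ⟨γ₀, c.ε₁ * remCoeffL 4 M c α₂ q.B₃, hγ₀, hcap, runConstRemainder_of_runLeaves190H hrun hC h22 hq hsg (by norm_num), hcont⟩

/-- **1ᶜᴹ ⟹ 1ᶜᶜ (proved): the modulus socket pays ANY cap by the window** (`capRem_of_runModulus_survContAt`, radius `s`, (C) moved down by `survCont_anti`).  The anchor and the drift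
antecedents are passed through, not used. [folklore] -/
theorem capRem13_of_runModulus (h : RunModulusAtCornerDriftSlope13) : CapRemAtCornerDriftSlope13 := by
  intro F θ hP hU hθ hB hwin b s A hanch hs hd
  obtain ⟨γ₀, hγ₀, _hγθ, hmod, hsc⟩ := h F θ hP hU hθ hB hwin b s A hanch hs hd
  exact capRem_of_runModulus_survContAt hmod hγ₀ hs hsc

/-- **★★ 2ᶜᴰ ∧ 1ᶜᶜ ⟹ THE CRUX DECL BY NAME** (`Summit.QuantumFields.YangMills.Theses.BalabanUVNodes.EndpointGivenBR13SepCoPH`): per tuple, the anchored drifting corner sequence from 2ᶜᴰ, the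
window ∕ radius ∕ constant remainder ∕ (C) from 1ᶜᶜ at it, and the tree's END with the datum's forward generation `fwd`.  CONDITIONAL on the two displayed texts; K2⁷ NOT closed;
nothing of Bałaban asserted. [cite: Balaban1987RG1, Thm 2 p.259 (first sentence), Thm 3 p.264 and (5.10) p.293] -/
theorem EndpointGivenBR13SepCoPH_of_cornerDriftPos_capRem (h₁ : CornerDriftPos13) (h₂ : CapRemAtCornerDriftSlope13) :
    Summit.QuantumFields.YangMills.Theses.BalabanUVNodes.EndpointGivenBR13SepCoPH := by
  intro F θ hP hU hθ hB hwin
  obtain ⟨b, s, A, hanch, hs, hd⟩ := h₁ F θ hP hU hθ hB hwin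
  obtain ⟨γ₀, r, hγ₀, hr, hrem, hsc⟩ := h₂ F θ hP hU hθ hB hwin b s A hanch hs hd
  exact endpointExistence_of_drift_runConstRemainder_survCont (Node00.datumOfRecord₁₃SepCoPH F 2 θ hP).fwd hγ₀ hd hrem hr hsc

/-- **★★ THE κ-FREE MODULUS HELPER ROAD, plan g84 (5d)'s asked theorem (its name, its shape): 2ᶜᴰ ∧ 1ᶜᴹ ⟹ THE CRUX DECL BY NAME.**  So the three modulus cards (this card's ed.3, idea-2's
`peel-two-threshold-modulus` ed.2, `convex-fibre-witten-modulus-kappa3` ed.2.3) re-key from `θ.cβ·beta0OfJs F κ` to the anchored corner `b` by DELETING their anchor hypothesis and stay wired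
to the registered 2ᶜᴰ.  CONDITIONAL on the two displayed texts; K2⁷ NOT closed; nothing of Bałaban asserted. [cite: Balaban1987RG1, Thm 2 p.259 (first sentence), Thm 3 p.264, (2.13) p.268 and (5.10) p.293] -/
theorem EndpointGivenBR13SepCoPH_of_cornerDrift_runModulus (h₁ : CornerDriftPos13) (h₂ : RunModulusAtCornerDriftSlope13) :
    Summit.QuantumFields.YangMills.Theses.BalabanUVNodes.EndpointGivenBR13SepCoPH :=
  EndpointGivenBR13SepCoPH_of_cornerDriftPos_capRem h₁ (capRem13_of_runModulus h₂)

/-- **★★ … and from the drift-free cut: 2ᶜᴰ ∧ 1ᶜᴹ′ ⟹ THE CRUX DECL BY NAME.**  CONDITIONAL; K2⁷ NOT closed. [cite: Balaban1987RG1, Thm 2 p.259 (first sentence) and (2.13) p.268] -/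
theorem EndpointGivenBR13SepCoPH_of_cornerDrift_runModulusAtCorner (h₁ : CornerDriftPos13) (h₂ : RunModulusAtCorner13) :
    Summit.QuantumFields.YangMills.Theses.BalabanUVNodes.EndpointGivenBR13SepCoPH :=
  EndpointGivenBR13SepCoPH_of_cornerDrift_runModulus h₁ (runModulusAtCornerDriftSlope13_of_atCorner h₂)

/-- **The draft's own composition, by the other factorisation (bookkeeping check)**: 2ᶜᴰ ∧ 1ᶜᴿ ⟹ the crux decl through 1ᶜᶜ — same statement as v7c :564
`EndpointGivenBR13SepCoPH_of_cornerDriftKeyed` (which goes through p606097 §2's one text); here END reads the chain only via `RunConstRemainder`. [cite: Balaban1987RG1, Thm 2 p.259 (first sentence), (1.22) p.264 and (5.10) p.293] -/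
theorem EndpointGivenBR13SepCoPH_of_cornerDriftKeyed13 (h₁ : CornerDriftPos13) (h₂ : RunChain190AtCornerDriftSlope13) :
    Summit.QuantumFields.YangMills.Theses.BalabanUVNodes.EndpointGivenBR13SepCoPH :=
  EndpointGivenBR13SepCoPH_of_cornerDriftPos_capRem h₁ (capRem13_of_runChain190 h₂)

/-- **THE SEAM IS RIGID (word (H1) in kernel form at the corner keying)**: at a tuple, two witnesses `(b, s)` and `(b′, s′)` of 2ᶜᴰ's body agree — the anchor pins `b` (`ScaleAnchor.eq`) and
the drift pins the slope (gaps cell's `oneLoopDrift_slope_unique`); so 1ᶜᴿ ∕ 1ᶜᴹ ∕ 1ᶜᶜ's `∀ b s` range over at most one pair per tuple. [folklore] -/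
theorem corner_and_slope_unique {β : HBeta} {b b' : ℕ → ℝ} {s s' A A' : ℝ} (hb : ScaleAnchor β b) (hb' : ScaleAnchor β b')
    (h : OneLoopDrift s A b) (h' : OneLoopDrift s' A' b') : b = b' ∧ s = s' := by
  obtain rfl : b = b' := hb.eq hb'
  exact ⟨rfl, Summit.QuantumFields.BalabanUV.Gaps.D1Residue.oneLoopDrift_slope_unique h h'⟩

/-! ## §3 Reserve dials (plan (5e) (b)∕(c)): the same road with the base family a PARAMETER -/

/-- The type of a BASE FAMILY (a reference sequence of one-loop numbers at every tuple; DEF-1's fill `bOwn F θ`, CRIT-2's R3 γ-base-line `limUnder` are instances). [folklore] -/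
abbrev BaseFamily : Type _ :=
  (F : T4Family) → (θ : Node00.Stage13HParams F 2) → θ.Provisos₁₃SepCoPH F 2 → ℕ → ℝ

/-- 2ᴰ[b] (hypothesis shape): the base numbers `b` drift with SOME positive slope, under the crux prefix (at DEF-1's fill `fun F θ _ => bOwn F θ` this is p610236's `OwnNumbersDriftPos` up to
`bOwn_eq_βfun_apply_zero`).  Never a fact. [cite: Balaban1987RG1, (1.3) p.260 and (2.12)–(2.14) p.268] -/
def DriftPosAt13 (b : BaseFamily) : Prop :=
  ∀ (F : T4Family) (θ : Node00.Stage13HParams F 2) (hP : θ.Provisos₁₃SepCoPH F 2), (θ.ZhUnity F 2 ∧ θ.SlotsNondegenerate₁₃ F 2) → θ.Admissible F 2 →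
    B16.EndStatementBPrinted (Node00.datumOfRecord₁₃SepCoPH F 2 θ hP).C → Window13 F θ hP →
    ∃ s A : ℝ, 0 < s ∧ OneLoopDrift s A (b F θ hP)

/-- 1ᴹ[b] (hypothesis shape): the modulus socket relative to the base `b` with (C) at its level, under the crux prefix.  Never a fact. [cite: Balaban1987RG1, Thm 2 p.259 (first sentence) and (2.13) p.268] -/
def ModulusAt13 (b : BaseFamily) : Prop :=
  ∀ (F : T4Family) (θ : Node00.Stage13HParams F 2) (hP : θ.Provisos₁₃SepCoPH F 2), (θ.ZhUnity F 2 ∧ θ.SlotsNondegenerate₁₃ F 2) → θ.Admissible F 2 →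
    B16.EndStatementBPrinted (Node00.datumOfRecord₁₃SepCoPH F 2 θ hP).C → Window13 F θ hP →
    ∃ γ₀ : ℝ, 0 < γ₀ ∧ γ₀ ≤ θ.γ ∧ RunModulus (Node00.datumOfRecord₁₃SepCoPH F 2 θ hP).βfun (b F θ hP) γ₀ ∧
      SurvCont (Node00.datumOfRecord₁₃SepCoPH F 2 θ hP).βfun γ₀

/-- **★★ base-parametric road: 2ᴰ[b] ∧ 1ᴹ[b] ⟹ THE CRUX DECL BY NAME** — serves the fill-keyed reserve pair (DEF-1 §3b ∕ p609486) and CRIT-2's R3 base line by instantiation, if ever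
registered.  CONDITIONAL; K2⁷ NOT closed. [cite: Balaban1987RG1, Thm 2 p.259 (first sentence) and (2.13) p.268] -/
theorem EndpointGivenBR13SepCoPH_of_driftPos_modulusAt (b : BaseFamily) (h₁ : DriftPosAt13 b) (h₂ : ModulusAt13 b) :
    Summit.QuantumFields.YangMills.Theses.BalabanUVNodes.EndpointGivenBR13SepCoPH := by
  intro F θ hP hU hθ hB hwin
  obtain ⟨s, A, hs, hd⟩ := h₁ F θ hP hU hθ hB hwin
  obtain ⟨γ₀, hγ₀, _hγθ, hmod, hsc⟩ := h₂ F θ hP hU hθ hB hwin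
  exact endpointExistence_of_drift_runModulus_survContAt (Node00.datumOfRecord₁₃SepCoPH F 2 θ hP).fwd hγ₀ hs hd hmod hsc

/-! ## §4 The card's OWN content re-keyed (edition 3): the Tannery engine and the pinned interface (VERBATIM Sketch2 §0∕§2), the corner-keyed record type with NO anchor
hypothesis of its own, S-LIN at the corner, and ★★★ 2ᶜᴰ ∧ S-LIN(𝓡) ∧ (C) ⟹ the crux decl BY NAME -/

section Engine

variable {ι : Type*}

/-- The two-bound interpolation modulus `ω(g) := Σ'_i min(A_i·g, M_i)` (verbatim Sketch2 :68). [folklore] -/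
def omegaMin (A M : ι → ℝ) (g : ℝ) : ℝ := ∑' i, min (A i * g) (M i)

theorem min_nonneg_of {A M : ι → ℝ} (hA : ∀ i, 0 ≤ A i) (hM : ∀ i, 0 ≤ M i) {g : ℝ} (hg : 0 ≤ g) (i : ι) :
    0 ≤ min (A i * g) (M i) :=
  le_min (mul_nonneg (hA i) hg) (hM i)

/-- **THE ENGINE (Tannery): `ω(g) → 0` as `g → 0⁺`** — summable frozen majorants + termwise vanishing, NO rate and NO summability asked of the vanishing constants `A_i`
(verbatim Sketch2 :76; Mathlib `tendsto_tsum_of_dominated_convergence`). [folklore] -/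
theorem tendsto_omegaMin {A M : ι → ℝ} (hA : ∀ i, 0 ≤ A i) (hM : ∀ i, 0 ≤ M i) (hsum : Summable M) :
    Tendsto (omegaMin A M) (𝓝[>] 0) (𝓝 0) := by
  have hlim : ∀ i, Tendsto (fun g : ℝ => min (A i * g) (M i)) (𝓝[>] 0) (𝓝 (min (A i * 0) (M i))) := by
    intro i
    have hc : Continuous fun g : ℝ => min (A i * g) (M i) :=
      (continuous_const.mul continuous_id).min continuous_const
    exact (hc.tendsto 0).mono_left nhdsWithin_le_nhds
  have hbd : ∀ᶠ g in 𝓝[>] (0 : ℝ), ∀ i, ‖min (A i * g) (M i)‖ ≤ M i := by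
    filter_upwards [self_mem_nhdsWithin] with g hg
    intro i
    rw [Real.norm_eq_abs, abs_of_nonneg (min_nonneg_of hA hM (le_of_lt hg) i)]
    exact min_le_right _ _
  have h := tendsto_tsum_of_dominated_convergence hsum hlim hbd
  have h0 : (fun i => min (A i * 0) (M i)) = fun _ => (0 : ℝ) := by
    funext i
    rw [mul_zero]
    exact min_eq_left (hM i)
  rw [h0, tsum_zero] at h
  exact h

/-- **THE TERMWISE-TO-SUM STEP** (verbatim Sketch2 :97): a convergent sum whose terms obey BOTH bounds is bounded by `ω`. [folklore] -/
theorem abs_tsum_le_omegaMin {A M : ι → ℝ} {I : ι → ℝ} {g : ℝ} (hsum : Summable M)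
    (hIM : ∀ i, |I i| ≤ M i) (hIA : ∀ i, |I i| ≤ A i * g) : |∑' i, I i| ≤ omegaMin A M g := by
  have hIs : Summable (fun i => |I i|) := hsum.of_nonneg_of_le (fun i => abs_nonneg _) hIM
  have hIn : Summable (fun i => ‖I i‖) := by simpa [Real.norm_eq_abs] using hIs
  have hmin : Summable (fun i => min (A i * g) (M i)) :=
    hsum.of_nonneg_of_le (fun i => (abs_nonneg _).trans (le_min (hIA i) (hIM i))) (fun i => min_le_right _ _)
  calc |∑' i, I i| = ‖∑' i, I i‖ := (Real.norm_eq_abs _).symm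
    _ ≤ ∑' i, ‖I i‖ := norm_tsum_le_tsum_norm hIn
    _ = ∑' i, |I i| := by simp [Real.norm_eq_abs]
    _ ≤ omegaMin A M g := hIs.tsum_le_tsum (fun i => le_min (hIA i) (hIM i)) hmin

end Engine

/-- **The index (CF4, unchanged): unit-lattice localization domains of ℤ⁴** after the limit T ↗ ℤ⁴ ([I] (5.1) p. 292), k- and volume-FREE, countable: Tannery-ready. [cite: Balaban1987RG1, (1.7) p.261 and (5.1) p.292] -/
abbrev LocDomainZ4 : Type := Finset (Fin 4 → ℤ)

/-- **`ActivityRepr β b γ₀` — a PINNED activity representation of the remainder (interface; VERBATIM Sketch2 :230; D-REPR's fibre).**  Along every in-window run, at every prefix,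
`β_{k+1}(g_0,…,g_k) − b_k = Σ_X I X k (g_0,…,g_k)` (`HasSum` over `LocDomainZ4`) with FROZEN, k-, history- and coupling-free SUMMABLE majorants `|I X| ≤ M X` ([II] Lemma 3 (2.38) p. 20 +
tree sum + cube sum, tree `RemainderChain` (L1)–(L3)).  EDITION 3 READING OF `b` (CRIT-2 ROUND 2 «make `N_k` explicit; is it history-free?»): the history-FREE part `N_k` of the structural
split `β_k(hist) = N_k + Σ_X I_X(k, hist)` IS the parameter `b` — a bare sequence `ℕ → ℝ`, history-free BY TYPE; at the record it is INSTANTIATED by the anchored corner sequence the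
registered 2ᶜᴰ hands over (unique, `ScaleAnchor.eq`), so no identification letter is left on the card's side (V2 dissolved: the seam's anchor is the identification). [cite: Balaban1988RG2Cluster, Lemma 3 (2.38) p.20; Balaban1987RG1, (2.13) p.268] -/
structure ActivityRepr (β : HBeta) (b : ℕ → ℝ) (γ₀ : ℝ) where
  /-- the X-localized term of the remainder at scale k as a function of the history `(g_0,…,g_k)` -/
  I : LocDomainZ4 → (k : ℕ) → (Fin (k + 1) → ℝ) → ℝ
  /-- the frozen majorant of the X-term -/
  M : LocDomainZ4 → ℝ
  M_nonneg : ∀ X, 0 ≤ M X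
  M_summable : Summable M
  hasSum_run : ∀ (n : ℕ) (gs : ℕ → ℝ), RGEqH n β gs → Step.InInterval γ₀ n gs → ∀ k, k ≤ n →
    HasSum (fun X => I X k (prefixOf gs k)) (β k (prefixOf gs k) - b k)
  frozen_run : ∀ (n : ℕ) (gs : ℕ → ℝ), RGEqH n β gs → Step.InInterval γ₀ n gs → ∀ k, k ≤ n →
    ∀ X, |I X k (prefixOf gs k)| ≤ M X

/-- **S-LIN `LinOnRuns R` (hypothesis shape ABOUT A GIVEN representation; VERBATIM Sketch2 :246)** — every term vanishes LINEARLY in the running coupling, `|I X k (g_0,…,g_k)| ≤ A X · g_k`,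
with per-domain constants `A X` that are k- and history-free but carry NO decay and NO summability in `X`. [cite: Balaban1987RG1, (2.13) p.268; Balaban1988RG2Cluster, p.8] -/
def LinOnRuns {β : HBeta} {b : ℕ → ℝ} {γ₀ : ℝ} (R : ActivityRepr β b γ₀) : Prop :=
  ∃ A : LocDomainZ4 → ℝ, (∀ X, 0 ≤ A X) ∧
    ∀ (n : ℕ) (gs : ℕ → ℝ), RGEqH n β gs → Step.InInterval γ₀ n gs → ∀ k, k ≤ n →
      ∀ X, |R.I X k (prefixOf gs k)| ≤ A X * gs k

/-- **S-LIN ⟹ the modulus letter (proved, Tannery; VERBATIM Sketch2 :260)** — on ANY pinned representation, `ω(g) = Σ'_X min(A X · g, M X)`; no rate, no `Σ A X`. [folklore] -/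
theorem runModulus_of_linOnRuns {β : HBeta} {b : ℕ → ℝ} {γ₀ : ℝ} (R : ActivityRepr β b γ₀) (h : LinOnRuns R) :
    RunModulus β b γ₀ := by
  obtain ⟨A, hA, hlin⟩ := h
  refine ⟨omegaMin A R.M, tendsto_omegaMin hA R.M_nonneg R.M_summable, ?_⟩
  intro n gs hrg hI k hk
  rw [← (R.hasSum_run n gs hrg hI k hk).tsum_eq]
  exact abs_tsum_le_omegaMin R.M_summable (fun X => R.frozen_run n gs hrg hI k hk X) (fun X => hlin n gs hrg hI k hk X)

/-- **`RecordReprCorner13` — THE TYPE of the definer-first deliverable D-REPR at the CORNER keying (edition 3; NOT constructed here).**  For every tuple under the crux prefix and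
EVERY anchored corner sequence `b` (`ScaleAnchor D.βfun b` — the registered texts' own antecedent, not a card hypothesis), a window `γ₀ b ≤ θ.γ` and an `ActivityRepr` of the record's
β against THAT `b`.  Replaces Sketch2's `RecordRepr13` (κ, `θ.cβ·beta0OfJs F κ`, `ScaleAnchor` at κ: all DELETED).  INTENDED INHABITANT unchanged: `I X k hist :=` the X-term of print's
localized β¹ through `secondMoment ∘ polLimit`, `M X :=` the `RemainderChain` constants ([I] (1.20)–(1.22), (2.12)–(2.15); [II] (2.13)). [cite: Balaban1987RG1, (1.22) p.264 and (2.13) p.268; Balaban1988RG2Cluster, (2.13) p.15] -/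
structure RecordReprCorner13 where
  /-- the window of the representation at a tuple and an anchored corner sequence -/
  γ₀ : (F : T4Family) → (θ : Node00.Stage13HParams F 2) → θ.Provisos₁₃SepCoPH F 2 → (ℕ → ℝ) → ℝ
  γ₀_pos : ∀ F θ hP b, 0 < γ₀ F θ hP b
  γ₀_le : ∀ F θ hP b, γ₀ F θ hP b ≤ θ.γ
  /-- the representation itself, available under the crux prefix, against any anchored corner sequence -/
  repr : ∀ (F : T4Family) (θ : Node00.Stage13HParams F 2) (hP : θ.Provisos₁₃SepCoPH F 2),
    (θ.ZhUnity F 2 ∧ θ.SlotsNondegenerate₁₃ F 2) → θ.Admissible F 2 →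
    B16.EndStatementBPrinted (Node00.datumOfRecord₁₃SepCoPH F 2 θ hP).C → Window13 F θ hP →
    ∀ b : ℕ → ℝ, ScaleAnchor (Node00.datumOfRecord₁₃SepCoPH F 2 θ hP).βfun b →
    ActivityRepr (Node00.datumOfRecord₁₃SepCoPH F 2 θ hP).βfun b (γ₀ F θ hP b)

/-- **S-LIN AT THE CORNER (hypothesis shape ABOUT a delivered `𝓡 : RecordReprCorner13`)** — every representation `𝓡` delivers obeys `LinOnRuns`.  The stub a line would register AFTER D-REPR
lands: `LinAtCorner13 activityReprOfRecord₁₃`; size L (the per-polymer cubic∕moment insertion with ONE marked factor; memo `DESK-CF1-two-bound-idea5g9.md` = its informal proof at |X| = 1). [cite: Balaban1987RG1, (2.13) p.268; Balaban1988RG2Cluster, p.8 and (1.38)–(1.40) p.10] -/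
def LinAtCorner13 (𝓡 : RecordReprCorner13) : Prop :=
  ∀ (F : T4Family) (θ : Node00.Stage13HParams F 2) (hP : θ.Provisos₁₃SepCoPH F 2)
    (hU : θ.ZhUnity F 2 ∧ θ.SlotsNondegenerate₁₃ F 2) (hθ : θ.Admissible F 2)
    (hB : B16.EndStatementBPrinted (Node00.datumOfRecord₁₃SepCoPH F 2 θ hP).C) (hwin : Window13 F θ hP)
    (b : ℕ → ℝ) (hanch : ScaleAnchor (Node00.datumOfRecord₁₃SepCoPH F 2 θ hP).βfun b),
    LinOnRuns (𝓡.repr F θ hP hU hθ hB hwin b hanch)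

/-- **(C) at SOME level (hypothesis shape; the survivor-continuity letter [I] §1 pp. 263–264, shared with every road, not this card's object)** — one level suffices by `survCont_anti`. [cite: Balaban1987RG1, Thm 3 p.264] -/
def SurvContSome13 : Prop :=
  ∀ (F : T4Family) (θ : Node00.Stage13HParams F 2) (hP : θ.Provisos₁₃SepCoPH F 2), (θ.ZhUnity F 2 ∧ θ.SlotsNondegenerate₁₃ F 2) → θ.Admissible F 2 →
    B16.EndStatementBPrinted (Node00.datumOfRecord₁₃SepCoPH F 2 θ hP).C → Window13 F θ hP →
    ∃ γ₁ : ℝ, 0 < γ₁ ∧ SurvCont (Node00.datumOfRecord₁₃SepCoPH F 2 θ hP).βfun γ₁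

/-- **S-LIN(𝓡) ∧ (C) ⟹ 1ᶜᴹ′ (proved)**: Tannery at the delivered representation on `]0, 𝓡.γ₀]`, both letters moved down to `min (𝓡.γ₀ b) γ₁` (`runModulus_mono`, `survCont_anti`). [folklore] -/
theorem runModulusAtCorner13_of_lin_survCont (𝓡 : RecordReprCorner13) (hL : LinAtCorner13 𝓡) (hC : SurvContSome13) : RunModulusAtCorner13 := by
  intro F θ hP hU hθ hB hwin b hanch
  obtain ⟨γ₁, hγ₁, hsc⟩ := hC F θ hP hU hθ hB hwin
  have hmod := runModulus_of_linOnRuns (𝓡.repr F θ hP hU hθ hB hwin b hanch) (hL F θ hP hU hθ hB hwin b hanch)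
  refine ⟨min (𝓡.γ₀ F θ hP b) γ₁, lt_min (𝓡.γ₀_pos F θ hP b) hγ₁, (min_le_left _ _).trans (𝓡.γ₀_le F θ hP b),
    runModulus_mono hmod (min_le_left _ _), survCont_anti (lt_min (𝓡.γ₀_pos F θ hP b) hγ₁) (min_le_right _ _) hsc⟩

/-- **★★★ THE CARD's WHOLE CHAIN AT THE v7 CORNER KEYING (proved, no sorry): 2ᶜᴰ ∧ S-LIN(𝓡) ∧ (C) ⟹ THE CRUX DECL BY NAME** — S-LIN ⟹ 1ᶜᴹ′ (Tannery) ⟹ 1ᶜᴹ ⟹ 1ᶜᶜ (window pays the cap) ⟹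
with 2ᶜᴰ the crux (tree END).  CONDITIONAL on the displayed hypothesis texts and on a delivered `𝓡` (D-REPR, definer-first, the dominant debt); nothing of Bałaban asserted; K2⁷ NOT
closed. [cite: Balaban1987RG1, Thm 2 p.259 (first sentence) and (2.13) p.268; Balaban1988RG2Cluster, Lemma 3 (2.38) p.20] -/
theorem EndpointGivenBR13SepCoPH_of_cornerDrift_lin_survCont (𝓡 : RecordReprCorner13) (h₁ : CornerDriftPos13) (hL : LinAtCorner13 𝓡) (hC : SurvContSome13) :
    Summit.QuantumFields.YangMills.Theses.BalabanUVNodes.EndpointGivenBR13SepCoPH :=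
  EndpointGivenBR13SepCoPH_of_cornerDrift_runModulusAtCorner h₁ (runModulusAtCorner13_of_lin_survCont 𝓡 hL hC)

/-! ## §5 The BOX edition of the lever (edition 3; answers DEF-1 g6's located point bus l.30702 (i) «`ScaleAnchor` ⟹ base-line face is NOT a kernel fact» and plan g84 (3)):
S-LIN on the whole HISTORY BOX — `|I_X(k, p)| ≤ A_X · p_k` for every `p ∈ ]0, γ₀]^{k+1}`, not only along runs — is print's «the expression under the exponential vanishes at
g_k = 0» FOR ALL EARLIER HISTORIES ([I] (2.13)–(2.14) p. 268), and by Tannery it yields a BOX MODULUS `|β_k(p) − N_k| ≤ ω(p_k)`, hence the corner limit ITSELF: `ScaleAnchor β N`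
for the representation's own history-free part `N`.  So at the corner keying the card's lever, box-wise, pays the EXISTENCE conjunct of 2ᶜᴰ and the modulus 1ᶜᴹ′ at once and for
the SAME `N` (no identification letter anywhere); what stays outside the card is the drift SIGN `0 < s ∧ OneLoopDrift s A N` ((D1) at print's numbers), (C), and D-REPR. -/

/-- **`BoxModulus β b γ₀` — the modulus letter on the whole history box**: `|β_k(p) − b_k| ≤ ω(p_k)` for every `p ∈ HistBox γ₀ k`, `ω → 0` at `0⁺`; history-UNIFORM (the earlier
couplings are free in `]0, γ₀]`). Hypothesis shape, never a fact. [cite: Balaban1987RG1, (2.13)–(2.14) p.268] -/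
def BoxModulus (β : HBeta) (b : ℕ → ℝ) (γ₀ : ℝ) : Prop :=
  ∃ ω : ℝ → ℝ, Tendsto ω (𝓝[>] 0) (𝓝 0) ∧ ∀ (k : ℕ) (p : Fin (k + 1) → ℝ), p ∈ HistBox γ₀ k → |β k p - b k| ≤ ω (p (Fin.last k))

/-- A run's coupling prefix lies in the history box of the run's window. [folklore] -/
theorem prefixOf_mem_histBox {γ₀ : ℝ} {n : ℕ} {gs : ℕ → ℝ} (hI : Step.InInterval γ₀ n gs) {k : ℕ} (hk : k ≤ n) : prefixOf gs k ∈ HistBox γ₀ k :=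
  fun i => hI i ((Nat.le_of_lt_succ i.isLt).trans hk)

/-- **BOX ⟹ RUN**: a box modulus is in particular a run modulus on the same window (run prefixes are box points, `p_k = g_k`). [folklore] -/
theorem runModulus_of_boxModulus {β : HBeta} {b : ℕ → ℝ} {γ₀ : ℝ} (h : BoxModulus β b γ₀) : RunModulus β b γ₀ := by
  obtain ⟨ω, hω, hbox⟩ := h
  exact ⟨ω, hω, fun n gs _ hI k hk => hbox k (prefixOf gs k) (prefixOf_mem_histBox hI hk)⟩

/-- **BOX MODULUS ⟹ THE CORNER LIMIT (proved)**: `BoxModulus β b γ₀` with `0 < γ₀` gives `ScaleAnchor β b` — for `δ > 0` take the box of side `min γ₀ (u∕2)` where `ω < δ` on `]0, u[`.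
This is the kernel form of «β¹ vanishes at g_k = 0 for all earlier histories ⟹ the corner limit exists and equals the one-loop number» ([I] (2.13) p. 268). [cite: Balaban1987RG1, (2.13) p.268] -/
theorem scaleAnchor_of_boxModulus {β : HBeta} {b : ℕ → ℝ} {γ₀ : ℝ} (h : BoxModulus β b γ₀) (hγ₀ : 0 < γ₀) : ScaleAnchor β b := by
  obtain ⟨ω, hω, hbox⟩ := h
  intro k δ hδ
  have hev : ∀ᶠ g in 𝓝[>] (0 : ℝ), ω g < δ := (tendsto_order.1 hω).2 δ hδ
  obtain ⟨u, hu, hsub⟩ := mem_nhdsGT_iff_exists_Ioo_subset.1 hev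
  have hu0 : (0 : ℝ) < u := hu
  refine ⟨min γ₀ (u / 2), lt_min hγ₀ (half_pos hu0), fun p hp => ?_⟩
  have hp₀ : p ∈ HistBox γ₀ k := fun i => ⟨(hp i).1, (hp i).2.trans (min_le_left _ _)⟩
  have hmem : p (Fin.last k) ∈ Set.Ioo 0 u :=
    ⟨(hp _).1, lt_of_le_of_lt ((hp _).2.trans (min_le_right _ _)) (half_lt_self hu0)⟩
  exact (hbox k p hp₀).trans (hsub hmem).le

/-- **`BoxActivityRepr β b γ₀` — the pinned activity representation on the whole history box** (D-REPR's fibre, BOX edition): `β_k(p) − b_k = Σ_X I X k p` with frozen summable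
majorants for EVERY `p ∈ HistBox γ₀ k` — what print's (2.13) + [II] Lemma 3 give (the expansion holds for all small-field histories, not only along RG runs). Interface; NOT constructed
here. [cite: Balaban1988RG2Cluster, Lemma 3 (2.38) p.20; Balaban1987RG1, (2.13) p.268] -/
structure BoxActivityRepr (β : HBeta) (b : ℕ → ℝ) (γ₀ : ℝ) where
  /-- the X-localized term of the remainder at scale k as a function of the history -/
  I : LocDomainZ4 → (k : ℕ) → (Fin (k + 1) → ℝ) → ℝ
  /-- the frozen majorant of the X-term -/
  M : LocDomainZ4 → ℝ
  M_nonneg : ∀ X, 0 ≤ M X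
  M_summable : Summable M
  hasSum_box : ∀ (k : ℕ) (p : Fin (k + 1) → ℝ), p ∈ HistBox γ₀ k → HasSum (fun X => I X k p) (β k p - b k)
  frozen_box : ∀ (k : ℕ) (p : Fin (k + 1) → ℝ), p ∈ HistBox γ₀ k → ∀ X, |I X k p| ≤ M X

/-- **S-LIN-BOX `LinOnBox R`** — every term vanishes linearly in the LAST coupling, uniformly in the earlier ones: `|I X k p| ≤ A X · p_k` on the box; `A X` k- and history-free, NO
decay, NO summability in `X` (print's «use g_k|B| instead of ε₁», [II] p. 8, done once per polymer). Hypothesis shape ABOUT a given representation. [cite: Balaban1988RG2Cluster, p.8 and (1.38)–(1.40) p.10] -/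
def LinOnBox {β : HBeta} {b : ℕ → ℝ} {γ₀ : ℝ} (R : BoxActivityRepr β b γ₀) : Prop :=
  ∃ A : LocDomainZ4 → ℝ, (∀ X, 0 ≤ A X) ∧ ∀ (k : ℕ) (p : Fin (k + 1) → ℝ), p ∈ HistBox γ₀ k → ∀ X, |R.I X k p| ≤ A X * p (Fin.last k)

/-- **S-LIN-BOX ⟹ BOX MODULUS (proved, Tannery)**, `ω(g) = Σ'_X min(A X · g, M X)`. [folklore] -/
theorem boxModulus_of_linOnBox {β : HBeta} {b : ℕ → ℝ} {γ₀ : ℝ} (R : BoxActivityRepr β b γ₀) (h : LinOnBox R) : BoxModulus β b γ₀ := by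
  obtain ⟨A, hA, hlin⟩ := h
  refine ⟨omegaMin A R.M, tendsto_omegaMin hA R.M_nonneg R.M_summable, ?_⟩
  intro k p hp
  rw [← (R.hasSum_box k p hp).tsum_eq]
  exact abs_tsum_le_omegaMin R.M_summable (fun X => R.frozen_box k p hp X) (fun X => hlin k p hp X)

/-- **★ S-LIN-BOX ⟹ THE CORNER LIMIT EXISTS AND IS THE REPRESENTATION's OWN `b` (proved)** — the EXISTENCE conjunct of 2ᶜᴰ for `b`, supplied by the card's lever box-wise; by
`ScaleAnchor.eq` every other anchored sequence equals this `b` (so the `∀ b, ScaleAnchor … →` antecedent of 1ᶜᴿ∕1ᶜᴹ ranges over ONE sequence). [cite: Balaban1987RG1, (2.13) p.268] -/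
theorem scaleAnchor_of_linOnBox {β : HBeta} {b : ℕ → ℝ} {γ₀ : ℝ} (R : BoxActivityRepr β b γ₀) (h : LinOnBox R) (hγ₀ : 0 < γ₀) : ScaleAnchor β b :=
  scaleAnchor_of_boxModulus (boxModulus_of_linOnBox R h) hγ₀

/-- The box representation restricts to runs (forgetting the off-run histories). [folklore] -/
def BoxActivityRepr.toRun {β : HBeta} {b : ℕ → ℝ} {γ₀ : ℝ} (R : BoxActivityRepr β b γ₀) : ActivityRepr β b γ₀ where
  I := R.I
  M := R.M
  M_nonneg := R.M_nonneg
  M_summable := R.M_summable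
  hasSum_run := fun _ gs _ hI k hk => R.hasSum_box k (prefixOf gs k) (prefixOf_mem_histBox hI hk)
  frozen_run := fun _ gs _ hI k hk => R.frozen_box k (prefixOf gs k) (prefixOf_mem_histBox hI hk)

/-- S-LIN-BOX restricts to S-LIN on runs. [folklore] -/
theorem linOnRuns_of_linOnBox {β : HBeta} {b : ℕ → ℝ} {γ₀ : ℝ} (R : BoxActivityRepr β b γ₀) (h : LinOnBox R) : LinOnRuns R.toRun := by
  obtain ⟨A, hA, hlin⟩ := h
  exact ⟨A, hA, fun n gs _ hI k hk X => hlin k (prefixOf gs k) (prefixOf_mem_histBox hI hk) X⟩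

/-- **`BoxRecordRepr13` — D-REPR's type, BOX edition, with the history-free part `N` a FIELD (no `∀ b`, no anchor antecedent, no κ).**  Per tuple under the crux prefix: a sequence
`N F θ hP : ℕ → ℝ` (print's one-loop normalisation second moments `β⁰_{k+1}`, [I] (1.20)–(1.22) p. 264, [II] p. 21 L21–27 — g-INDEPENDENT by construction, hence history-free BY TYPE),
a window, and a `BoxActivityRepr` of the record's β against `N`.  NOT constructed here (definer-first, the dominant debt). [cite: Balaban1987RG1, (1.22) p.264 and (2.13) p.268; Balaban1988RG2Cluster, (2.13) p.15 and Lemma 3 (2.38) p.20] -/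
structure BoxRecordRepr13 where
  /-- the history-free part: print's one-loop numbers transported to the record -/
  N : (F : T4Family) → (θ : Node00.Stage13HParams F 2) → θ.Provisos₁₃SepCoPH F 2 → ℕ → ℝ
  /-- the window of the representation -/
  γ₀ : (F : T4Family) → (θ : Node00.Stage13HParams F 2) → θ.Provisos₁₃SepCoPH F 2 → ℝ
  γ₀_pos : ∀ F θ hP, 0 < γ₀ F θ hP
  γ₀_le : ∀ F θ hP, γ₀ F θ hP ≤ θ.γ
  repr : ∀ (F : T4Family) (θ : Node00.Stage13HParams F 2) (hP : θ.Provisos₁₃SepCoPH F 2),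
    (θ.ZhUnity F 2 ∧ θ.SlotsNondegenerate₁₃ F 2) → θ.Admissible F 2 →
    B16.EndStatementBPrinted (Node00.datumOfRecord₁₃SepCoPH F 2 θ hP).C → Window13 F θ hP →
    BoxActivityRepr (Node00.datumOfRecord₁₃SepCoPH F 2 θ hP).βfun (N F θ hP) (γ₀ F θ hP)

/-- **S-LIN-BOX AT THE RECORD (hypothesis shape about a delivered `𝓑 : BoxRecordRepr13`)** — the stub a line would register after D-REPR lands (size L: the per-polymer marked-factor
bound, history-uniform because print's bounds are uniform on the small-field analyticity space). [cite: Balaban1988RG2Cluster, (1.38)–(1.40) p.10 and p.11 L6–8] -/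
def LinOnBox13 (𝓑 : BoxRecordRepr13) : Prop :=
  ∀ (F : T4Family) (θ : Node00.Stage13HParams F 2) (hP : θ.Provisos₁₃SepCoPH F 2)
    (hU : θ.ZhUnity F 2 ∧ θ.SlotsNondegenerate₁₃ F 2) (hθ : θ.Admissible F 2)
    (hB : B16.EndStatementBPrinted (Node00.datumOfRecord₁₃SepCoPH F 2 θ hP).C) (hwin : Window13 F θ hP),
    LinOnBox (𝓑.repr F θ hP hU hθ hB hwin)

/-- **THE DRIFT SIGN AT THE REPRESENTATION's OWN NUMBERS (hypothesis shape; (D1) content — asymptotic freedom `b₀ > 0` of print's one-loop numbers; NOT this card's object).** [cite: Balaban1987RG1, Thm 2 p.259 and (1.22) p.264] -/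
def DriftAtN13 (𝓑 : BoxRecordRepr13) : Prop :=
  ∀ (F : T4Family) (θ : Node00.Stage13HParams F 2) (hP : θ.Provisos₁₃SepCoPH F 2), (θ.ZhUnity F 2 ∧ θ.SlotsNondegenerate₁₃ F 2) → θ.Admissible F 2 →
    B16.EndStatementBPrinted (Node00.datumOfRecord₁₃SepCoPH F 2 θ hP).C → Window13 F θ hP →
    ∃ s A : ℝ, 0 < s ∧ OneLoopDrift s A (𝓑.N F θ hP)

/-- **★ S-LIN-BOX(𝓑) ∧ drift-at-N ⟹ 2ᶜᴰ (proved)**: the existence conjunct comes from the lever (`scaleAnchor_of_linOnBox`), the sign from (D1). [folklore] -/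
theorem cornerDriftPos13_of_linOnBox_drift (𝓑 : BoxRecordRepr13) (hL : LinOnBox13 𝓑) (hD : DriftAtN13 𝓑) : CornerDriftPos13 := by
  intro F θ hP hU hθ hB hwin
  obtain ⟨s, A, hs, hd⟩ := hD F θ hP hU hθ hB hwin
  exact ⟨𝓑.N F θ hP, s, A, scaleAnchor_of_linOnBox (𝓑.repr F θ hP hU hθ hB hwin) (hL F θ hP hU hθ hB hwin) (𝓑.γ₀_pos F θ hP), hs, hd⟩

/-- **★ S-LIN-BOX(𝓑) ∧ (C) ⟹ 1ᶜᴹ′ (proved)**: for ANY anchored `b`, `b = 𝓑.N` by `ScaleAnchor.eq` against the lever's own anchor, then Tannery on runs. [folklore] -/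
theorem runModulusAtCorner13_of_linOnBox_survCont (𝓑 : BoxRecordRepr13) (hL : LinOnBox13 𝓑) (hC : SurvContSome13) : RunModulusAtCorner13 := by
  intro F θ hP hU hθ hB hwin b hanch
  have hLt := hL F θ hP hU hθ hB hwin
  have hbN : b = 𝓑.N F θ hP := hanch.eq (scaleAnchor_of_linOnBox (𝓑.repr F θ hP hU hθ hB hwin) hLt (𝓑.γ₀_pos F θ hP))
  subst hbN
  obtain ⟨γ₁, hγ₁, hsc⟩ := hC F θ hP hU hθ hB hwin
  have hmod : RunModulus (Node00.datumOfRecord₁₃SepCoPH F 2 θ hP).βfun (𝓑.N F θ hP) (𝓑.γ₀ F θ hP) :=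
    runModulus_of_boxModulus (boxModulus_of_linOnBox (𝓑.repr F θ hP hU hθ hB hwin) hLt)
  refine ⟨min (𝓑.γ₀ F θ hP) γ₁, lt_min (𝓑.γ₀_pos F θ hP) hγ₁, (min_le_left _ _).trans (𝓑.γ₀_le F θ hP),
    runModulus_mono hmod (min_le_left _ _), survCont_anti (lt_min (𝓑.γ₀_pos F θ hP) hγ₁) (min_le_right _ _) hsc⟩

/-- **★★★★ THE BOX EDITION's WHOLE CHAIN (proved, no sorry): S-LIN-BOX(𝓑) ∧ drift-at-N ∧ (C) ⟹ THE CRUX DECL BY NAME** — the lever pays BOTH the existence half of 2ᶜᴰ and the modulus;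
outside the card remain exactly: D-REPR (`𝓑` itself, definer-first), the drift SIGN at print's one-loop numbers ((D1)), and (C).  CONDITIONAL; nothing of Bałaban asserted; K2⁷ NOT closed;
R4 = the conditional finite-𝕋⁴ rung only; Clay NOT proved. [cite: Balaban1987RG1, Thm 2 p.259 (first sentence) and (2.13) p.268; Balaban1988RG2Cluster, Lemma 3 (2.38) p.20] -/
theorem EndpointGivenBR13SepCoPH_of_linOnBox_drift_survCont (𝓑 : BoxRecordRepr13) (hL : LinOnBox13 𝓑) (hD : DriftAtN13 𝓑) (hC : SurvContSome13) :
    Summit.QuantumFields.YangMills.Theses.BalabanUVNodes.EndpointGivenBR13SepCoPH :=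
  EndpointGivenBR13SepCoPH_of_cornerDrift_runModulusAtCorner (cornerDriftPos13_of_linOnBox_drift 𝓑 hL hD)
    (runModulusAtCorner13_of_linOnBox_survCont 𝓑 hL hC)

/-! ## §6 EDITION 4 — THE ROUND-3 PRICE PAID ON THE HISTORY SIDE: term-level regularity the single-polymer collapse CANNOT meet from `BoxRemainder`, each field USED.
CRIT-2 g3's kernel `Crit2Idea5Sketch3Collapse.lean` (66de0d8f0a0940ef) inhabits §5's pair (`BoxActivityRepr`, `LinOnBox`) with ONE term (`I ∅ := β − b`) from the bare linear
box remainder, so AS TYPED the ed.3 interface pinned nothing beyond the bounded box modulus.  Edition 4 types what the TERMS of [II]'s expansion carry and the LUMP does not: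
(a0) `ContOnBox` — every activity `I X k` is continuous on the history box ⟹ (M-test over the frozen summable majorants) `BetaContH γ₀ β` ⟹ run-wise (C) `SurvCont β γ₀`: the letter
`SurvContSome13` of ★★★★ becomes a THEOREM of the representation (§8 ★⁵); (a1) `LipOnBox` — termwise HISTORY MODULI `L X k i` with X-SUMMABLE sums ⟹ U2's letter shape
`HistLipschitz (Σ'_X L X) γ₀ β` (T4CouplingMatching :235) by one tsum∕finite-sum interchange, and with the age-decay `FadingOnBox` of the summed moduli ⟹ U3's `FadingMemory` (:244) —
the typed TERM-LEVEL form of the UNPRINTED gap G-t4-U2-2 ([I] p. 298 says only that the dependence exists), i.e. WHERE print's per-polymer bounds would have to prove it; (a1⁻) the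
card's own two-bound move used a SECOND time: CRUDE per-polymer Lipschitz constants `L X` (k-, history-free, NO decay, NO summability — one derivative per polymer at `C^{|X|}` cost)
interpolated against the frozen majorants give a k-UNIFORM HISTORY MODULUS `|β_k(p) − β_k(q)| ≤ Ω(‖p − q‖_∞)`, `Ω := omegaMin L (2M) → 0` (Tannery again), hence (C); (a3) the
RENEWAL LEMMA — the elementary mechanism by which term-level fading would be PROVED: own-coupling influence `≤ d` and one-step heredity through age-`a` old activities `≤ C₀ θ^a`
force the influence of `g_i` on step `k` to be `≤ d (θ + C₀)^{k−i}` (fading iff `C₀ < 1 − θ`: the quantitative form of T4CouplingMatching's heuristic «terms born at scale i are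
irrelevant and contract», with the threshold explicit).  WHY NOT a `DependsOnly`-on-the-scale-support field (CRIT-2's (a) as worded): in [I]'s INDUCTIVE scheme the X-term at step k
contains the re-expanded OLD actions `E^{(j)}`, which depend on ALL earlier couplings ((1.3)–(1.4) p. 260, p. 298) — p. 261's locality «the term corresponding to X depends on U_j
restricted to X» is SPATIAL, not a statement about couplings; and an age-labelled index with exact coordinate support is obtainable from ANY representation by telescoping in the
history, where it is EQUIVALENT to termwise oscillation moduli — so the honest primitive is the termwise modulus, typed here.  Separation from the collapse: §9. -/

section HistorySide

variable {β : HBeta} {b : ℕ → ℝ} {γ₀ : ℝ}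

/-- On the box the representation reads `β_k(p) = b_k + Σ'_X I X k p`. [folklore] -/
theorem BoxActivityRepr.eq_tsum (R : BoxActivityRepr β b γ₀) {k : ℕ} {p : Fin (k + 1) → ℝ} (hp : p ∈ HistBox γ₀ k) :
    β k p = b k + ∑' X, R.I X k p := by
  rw [(R.hasSum_box k p hp).tsum_eq]; ring

/-- The difference of two box values is the sum of the termwise differences. [folklore] -/
theorem BoxActivityRepr.sub_eq_tsum (R : BoxActivityRepr β b γ₀) {k : ℕ} {p q : Fin (k + 1) → ℝ} (hp : p ∈ HistBox γ₀ k) (hq : q ∈ HistBox γ₀ k) :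
    β k p - β k q = ∑' X, (R.I X k p - R.I X k q) := by
  rw [((R.hasSum_box k p hp).sub (R.hasSum_box k q hq)).tsum_eq]; ring

/-- Termwise differences are dominated by twice the frozen majorant. [folklore] -/
theorem BoxActivityRepr.abs_sub_le_two_mul (R : BoxActivityRepr β b γ₀) {k : ℕ} {p q : Fin (k + 1) → ℝ} (hp : p ∈ HistBox γ₀ k) (hq : q ∈ HistBox γ₀ k)
    (X : LocDomainZ4) : |R.I X k p - R.I X k q| ≤ 2 * R.M X :=
  calc |R.I X k p - R.I X k q| ≤ |R.I X k p| + |R.I X k q| := abs_sub _ _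
    _ ≤ R.M X + R.M X := add_le_add (R.frozen_box k p hp X) (R.frozen_box k q hq X)
    _ = 2 * R.M X := by ring

/-- **(a0) `ContOnBox R` — TERMWISE CONTINUITY (obligation about a given representation):** every activity `I X k` is continuous on the history box `]0, γ₀]^{k+1}` (jointly in all
couplings).  For the intended inhabitant: each localized polymer activity is an explicit finite-dimensional integral depending continuously on the couplings entering it ([I] Thm 3
p. 264 asserts smoothness in the LAST variable; continuity in the earlier ones is the existence statement of p. 298 read per polymer).  NOT met by the one-term collapse unless β_k itself
is continuous on the box (§9). [cite: Balaban1987RG1, Thm 3 p.264 and §5 p.298] -/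
def ContOnBox (R : BoxActivityRepr β b γ₀) : Prop :=
  ∀ (X : LocDomainZ4) (k : ℕ), ContinuousOn (R.I X k) (HistBox γ₀ k)

/-- **★ (a0) ⟹ (C) ON THE BOXES (proved; Weierstrass M-test over the frozen summable majorants, Mathlib `continuousOn_tsum`)**: `ContOnBox R → BetaContH γ₀ β`. [folklore] -/
theorem betaContH_of_contOnBox (R : BoxActivityRepr β b γ₀) (h : ContOnBox R) : BetaContH γ₀ β := by
  intro k
  have hS : ContinuousOn (fun p => ∑' X, R.I X k p) (HistBox γ₀ k) :=
    continuousOn_tsum (fun X => h X k) R.M_summable fun X p hp => by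
      rw [Real.norm_eq_abs]; exact R.frozen_box k p hp X
  have hT : ContinuousOn (fun p => b k + ∑' X, R.I X k p) (HistBox γ₀ k) := continuousOn_const.add hS
  rw [← histBox_eq_box]
  exact hT.congr fun p hp => R.eq_tsum hp

/-- **★ (a0) ⟹ RUN-WISE (C) AT THE WINDOW (proved)**: `SurvCont β γ₀` — the letter the END reads, now a THEOREM of the representation. [folklore] -/
theorem survCont_of_contOnBox (R : BoxActivityRepr β b γ₀) (h : ContOnBox R) (hγ₀ : 0 < γ₀) : SurvCont β γ₀ :=
  SurvCont.of_betaContH hγ₀ (betaContH_of_contOnBox R h)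

/-- **(a1) `LipOnBox R L` — TERMWISE HISTORY MODULI (obligation about a given representation):** per-polymer Lipschitz moduli `L X k i ≥ 0` for the dependence of `I X k` on EACH coupling
`g_i`, `i ≤ k`, on the box, with X-SUMMABLE sums `Σ'_X L X k i < ∞`.  The term-level typing of U2's `HistLipschitz` (GAPS G-t4-U2-2: any quantitative history modulus is UNPRINTED,
[I] p. 298); for the intended inhabitant `L X k i` is the polymer's derivative bound in `g_i` times its decay weight.  NOT met by the collapse unless β has the history moduli already. [cite: Balaban1987RG1, §5 p.298 and Thm 3 p.264] -/
structure LipOnBox (R : BoxActivityRepr β b γ₀) (L : LocDomainZ4 → ℕ → ℕ → ℝ) : Prop where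
  nonneg : ∀ X k i, 0 ≤ L X k i
  summable : ∀ k i, Summable fun X => L X k i
  lip : ∀ (k : ℕ) (p q : Fin (k + 1) → ℝ), p ∈ HistBox γ₀ k → q ∈ HistBox γ₀ k →
    ∀ X, |R.I X k p - R.I X k q| ≤ ∑ i : Fin (k + 1), L X k i * |p i - q i|

/-- The SUMMED MODULI `Λ k i := Σ'_X L X k i` (U2's `Λ`). [folklore] -/
def sumModuli (L : LocDomainZ4 → ℕ → ℕ → ℝ) (k i : ℕ) : ℝ := ∑' X, L X k i

theorem sumModuli_nonneg {L : LocDomainZ4 → ℕ → ℕ → ℝ} (hL : ∀ X k i, 0 ≤ L X k i) (k i : ℕ) : 0 ≤ sumModuli L k i :=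
  tsum_nonneg fun X => hL X k i

/-- **★ (a1) ⟹ U2's LETTER SHAPE ON THE WINDOW (proved): `LipOnBox R L → HistLipschitz (sumModuli L) γ₀ β`** — termwise bounds summed (`norm_tsum_le_tsum_norm`), then the ONE interchange
`Σ'_X Σ_i = Σ_i Σ'_X` (`Summable.tsum_finsetSum`).  The activity expansion MANUFACTURES the history moduli print never quantifies — as a theorem about the typed object; the located
debt is the field, not this step. [cite: Balaban1987RG1, §5 p.298] -/
theorem histLipschitz_of_lipOnBox (R : BoxActivityRepr β b γ₀) {L : LocDomainZ4 → ℕ → ℕ → ℝ} (h : LipOnBox R L) :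
    HistLipschitz (sumModuli L) γ₀ β := by
  intro k p q hp hq
  rw [← histBox_eq_box] at hp hq
  have hbd : Summable fun X => ∑ i : Fin (k + 1), L X k i * |p i - q i| :=
    summable_sum fun i _ => (h.summable k i).mul_right _
  have hle : ∀ X, ‖R.I X k p - R.I X k q‖ ≤ ∑ i : Fin (k + 1), L X k i * |p i - q i| := fun X => by
    rw [Real.norm_eq_abs]; exact h.lip k p q hp hq X
  have hn : Summable fun X => ‖R.I X k p - R.I X k q‖ :=
    Summable.of_nonneg_of_le (fun X => norm_nonneg _) hle hbd
  rw [R.sub_eq_tsum hp hq]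
  calc |∑' X, (R.I X k p - R.I X k q)| = ‖∑' X, (R.I X k p - R.I X k q)‖ := (Real.norm_eq_abs _).symm
    _ ≤ ∑' X, ‖R.I X k p - R.I X k q‖ := norm_tsum_le_tsum_norm hn
    _ ≤ ∑' X, ∑ i : Fin (k + 1), L X k i * |p i - q i| := hn.tsum_le_tsum hle hbd
    _ = ∑ i : Fin (k + 1), ∑' X, L X k i * |p i - q i| := Summable.tsum_finsetSum fun i _ => (h.summable k i).mul_right _
    _ = ∑ i : Fin (k + 1), sumModuli L k i * |p i - q i| := Finset.sum_congr rfl fun i _ => tsum_mul_right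

/-- (a1) ⟹ (a0): termwise moduli make every term continuous on the box (so (a1) also pays (C)). [folklore] -/
theorem contOnBox_of_lipOnBox (R : BoxActivityRepr β b γ₀) {L : LocDomainZ4 → ℕ → ℕ → ℝ} (h : LipOnBox R L) : ContOnBox R := by
  intro X k
  rw [Metric.continuousOn_iff]
  intro p hp ε hε
  set S : ℝ := ∑ i : Fin (k + 1), L X k i with hS
  have hS0 : 0 ≤ S := Finset.sum_nonneg fun i _ => h.nonneg X k i
  refine ⟨ε / (S + 1), div_pos hε (by linarith), fun q hq hqp => ?_⟩
  rw [Real.dist_eq]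
  have h1 : |R.I X k q - R.I X k p| ≤ S * dist q p := by
    calc |R.I X k q - R.I X k p| ≤ ∑ i : Fin (k + 1), L X k i * |q i - p i| := h.lip k q p hq hp X
      _ ≤ ∑ i : Fin (k + 1), L X k i * dist q p :=
          Finset.sum_le_sum fun i _ => mul_le_mul_of_nonneg_left (by rw [← Real.dist_eq]; exact dist_le_pi_dist q p i) (h.nonneg X k i)
      _ = S * dist q p := by rw [hS, Finset.sum_mul]
  calc |R.I X k q - R.I X k p| ≤ S * dist q p := h1
    _ ≤ (S + 1) * dist q p := mul_le_mul_of_nonneg_right (by linarith) dist_nonneg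
    _ < (S + 1) * (ε / (S + 1)) := mul_lt_mul_of_pos_left hqp (by linarith)
    _ = ε := by field_simp

/-- **(a2) `FadingOnBox L C θ` — AGE-DECAY OF THE SUMMED MODULI (obligation; typed TERM-LEVEL G-t4-U2-2):** `Σ'_X L X k i ≤ C θ^{k−i}` for `i ≤ k` — the influence of `g_i` on the step-k
activities fades geometrically in the age.  A genuine structural claim about [I]'s `E^{(j)}`, NOT PRINTED (T4CouplingMatching's `FadingMemory` docstring); §6's renewal lemma is the
mechanism that would prove it from one-step irrelevance. [cite: Balaban1987RG1, §5 p.298] -/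
def FadingOnBox (L : LocDomainZ4 → ℕ → ℕ → ℝ) (C θ : ℝ) : Prop :=
  ∀ k i, i ≤ k → ∑' X, L X k i ≤ C * θ ^ (k - i)

/-- **★ (a1) ∧ (a2) ⟹ U3's `FadingMemory C θ (sumModuli L)` (proved, bookkeeping).** [folklore] -/
theorem fadingMemory_of_lipOnBox (R : BoxActivityRepr β b γ₀) {L : LocDomainZ4 → ℕ → ℕ → ℝ} (h : LipOnBox R L) {C θ : ℝ} (hF : FadingOnBox L C θ) :
    FadingMemory C θ (sumModuli L) :=
  fun k i hik => ⟨sumModuli_nonneg h.nonneg k i, hF k i hik⟩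

/-- **★ so ONE typed object pays U2's AND U3's history letters on its window**: `LipOnBox R L ∧ FadingOnBox L C θ → HistLipschitz Λ γ₀ β ∧ FadingMemory C θ Λ` with `Λ := sumModuli L`. [folklore] -/
theorem histLetters_of_lipOnBox_fading (R : BoxActivityRepr β b γ₀) {L : LocDomainZ4 → ℕ → ℕ → ℝ} (h : LipOnBox R L) {C θ : ℝ} (hF : FadingOnBox L C θ) :
    HistLipschitz (sumModuli L) γ₀ β ∧ FadingMemory C θ (sumModuli L) :=
  ⟨histLipschitz_of_lipOnBox R h, fadingMemory_of_lipOnBox R h hF⟩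

/-- **(a1⁻) `CrudeLipOnBox R L` — CRUDE per-polymer Lipschitz constants in the sup-distance of histories (obligation):** `|I X k p − I X k q| ≤ L X · ‖p − q‖_∞`, `L X ≥ 0` k- and
history-free, NO decay and NO summability in X (one derivative per polymer at `C^{|X|}` cost — the history analogue of S-LIN's `A X`). [cite: Balaban1987RG1, Thm 3 p.264 and §5 p.298] -/
def CrudeLipOnBox (R : BoxActivityRepr β b γ₀) (L : LocDomainZ4 → ℝ) : Prop :=
  (∀ X, 0 ≤ L X) ∧ ∀ (k : ℕ) (p q : Fin (k + 1) → ℝ), p ∈ HistBox γ₀ k → q ∈ HistBox γ₀ k → ∀ X, |R.I X k p - R.I X k q| ≤ L X * dist p q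

/-- **★ THE ENGINE's SECOND USE (proved): crude constants + frozen majorants ⟹ a k-UNIFORM HISTORY MODULUS** `|β_k(p) − β_k(q)| ≤ Ω(‖p − q‖_∞)`, `Ω := omegaMin L (2M)`, on every box
`]0, γ₀]^{k+1}` — Tannery interpolation termwise between `L X · ‖p − q‖` and `2 M X`; NO rate, NO `Σ L X`. [folklore] -/
theorem abs_sub_le_omegaMin_of_crudeLip (R : BoxActivityRepr β b γ₀) {L : LocDomainZ4 → ℝ} (h : CrudeLipOnBox R L) {k : ℕ} {p q : Fin (k + 1) → ℝ}
    (hp : p ∈ HistBox γ₀ k) (hq : q ∈ HistBox γ₀ k) : |β k p - β k q| ≤ omegaMin L (fun X => 2 * R.M X) (dist p q) := by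
  rw [R.sub_eq_tsum hp hq]
  exact abs_tsum_le_omegaMin (R.M_summable.mul_left 2) (fun X => R.abs_sub_le_two_mul hp hq X) (fun X => h.2 k p q hp hq X)

/-- … and `Ω → 0` at `0⁺` (`tendsto_omegaMin`): the modulus is a genuine modulus of continuity, uniform in k and in the position in the box. [folklore] -/
theorem tendsto_crudeModulus (R : BoxActivityRepr β b γ₀) {L : LocDomainZ4 → ℝ} (h : CrudeLipOnBox R L) :
    Tendsto (omegaMin L (fun X => 2 * R.M X)) (𝓝[>] 0) (𝓝 0) :=
  tendsto_omegaMin h.1 (fun X => by linarith [R.M_nonneg X]) (R.M_summable.mul_left 2)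

/-- (a1⁻) ⟹ (a0): crude Lipschitz terms are continuous on the box (so the crude constants already pay (C)). [folklore] -/
theorem contOnBox_of_crudeLip (R : BoxActivityRepr β b γ₀) {L : LocDomainZ4 → ℝ} (h : CrudeLipOnBox R L) : ContOnBox R := by
  intro X k
  rw [Metric.continuousOn_iff]
  intro p hp ε hε
  have hL : 0 ≤ L X := h.1 X
  refine ⟨ε / (L X + 1), div_pos hε (by linarith), fun q hq hqp => ?_⟩
  rw [Real.dist_eq]
  calc |R.I X k q - R.I X k p| ≤ L X * dist q p := h.2 k q p hq hp X
    _ ≤ (L X + 1) * dist q p := mul_le_mul_of_nonneg_right (by linarith) dist_nonneg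
    _ < (L X + 1) * (ε / (L X + 1)) := mul_lt_mul_of_pos_left hqp (by linarith)
    _ = ε := by field_simp

end HistorySide

/-! ### §6·R The RENEWAL LEMMA (a3): one-step irrelevance ⟹ geometric fading (elementary; the mechanism behind (a2)) -/

section Renewal

open Finset

/-- Geometric convolution step: for `0 ≤ θ`, `0 ≤ C₀`, `r := θ + C₀`: `C₀ · Σ_{l ≤ n} θ^{n−l} r^l ≤ r^{n+1}` (induction: `r^{n+2} = θ·r^{n+1} + C₀·r^{n+1}`). [folklore] -/
theorem geomConv_le {C₀ θ : ℝ} (hθ : 0 ≤ θ) (hC : 0 ≤ C₀) :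
    ∀ n : ℕ, C₀ * ∑ l ∈ range (n + 1), θ ^ (n - l) * (θ + C₀) ^ l ≤ (θ + C₀) ^ (n + 1) := by
  intro n
  induction n with
  | zero => simp; nlinarith
  | succ n ih =>
    have hr : 0 ≤ θ + C₀ := add_nonneg hθ hC
    have hsplit : ∑ l ∈ range (n + 2), θ ^ (n + 1 - l) * (θ + C₀) ^ l
        = θ * ∑ l ∈ range (n + 1), θ ^ (n - l) * (θ + C₀) ^ l + (θ + C₀) ^ (n + 1) := by
      rw [sum_range_succ, Nat.sub_self, pow_zero, one_mul, mul_sum]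
      congr 1
      refine sum_congr rfl fun l hl => ?_
      have hl' : l ≤ n := Nat.lt_succ_iff.mp (mem_range.mp hl)
      rw [show n + 1 - l = (n - l) + 1 by omega, pow_succ]
      ring
    rw [hsplit, mul_add]
    have h1 : C₀ * (θ * ∑ l ∈ range (n + 1), θ ^ (n - l) * (θ + C₀) ^ l) ≤ θ * (θ + C₀) ^ (n + 1) := by
      rw [mul_left_comm]
      exact mul_le_mul_of_nonneg_left ih hθ
    calc C₀ * (θ * ∑ l ∈ range (n + 1), θ ^ (n - l) * (θ + C₀) ^ l) + C₀ * (θ + C₀) ^ (n + 1)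
        ≤ θ * (θ + C₀) ^ (n + 1) + C₀ * (θ + C₀) ^ (n + 1) := add_le_add h1 le_rfl
      _ = (θ + C₀) ^ (n + 1 + 1) := by ring

/-- **★ THE RENEWAL LEMMA (proved): ONE-STEP IRRELEVANCE ⟹ GEOMETRIC FADING.**  Influence array `m k i` (`i ≤ k`: the influence of the coupling `g_i` on the step-k output): if the
OWN coupling enters with `m k k ≤ d` and the OLD couplings enter only through the old outputs, with the step-k sensitivity to the age-`(k−1−j)` output born at step `j` at most
`C₀ θ^{k−1−j}` — the heredity inequality `m k i ≤ Σ_{j ∈ [i,k)} C₀ θ^{k−1−j} m j i` — then `m (i+n) i ≤ d (θ + C₀)^n`: memory FADES iff the one-step feedback is small against the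
contraction gap, `C₀ < 1 − θ`.  A discrete renewal (Volterra) inequality with geometric kernel; NOT Mathlib's one-step `discrete_gronwall`, NOT T4CouplingMatching's `backward_gronwall`
(which CONSUMES fading).  Offered as the quantitative form of the sentence «g_i enters only through terms born at scale i, which are irrelevant and contract» (`FadingMemory` docstring)
— the heredity hypothesis is the located structural claim, UNPRINTED for Bałaban's scheme; its printed FERMIONIC counterpart is the «short memory property» of Gallavotti–Nicolò
tree expansions ([Mastropietro2008] §3.8 (3.70) p. 64: a tree with a vertex at scale i carries an extra `γ^{(k−i)∕2}`; (4.84) p. 86 applies it to the history-dependent beta function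
`β^h_λ(λ_h, …, λ_1)`); the lemma itself is elementary. [folklore] -/
theorem fading_of_renewal {m : ℕ → ℕ → ℝ} {d C₀ θ : ℝ} (hθ : 0 ≤ θ) (hC : 0 ≤ C₀) (hd : 0 ≤ d)
    (h0 : ∀ k, m k k ≤ d)
    (hher : ∀ i k, i < k → m k i ≤ ∑ j ∈ Ico i k, C₀ * θ ^ (k - 1 - j) * m j i) :
    ∀ n i, m (i + n) i ≤ d * (θ + C₀) ^ n := by
  intro n
  induction n using Nat.strong_induction_on with
  | _ n ih =>
    intro i
    rcases n with _ | n
    · simpa using h0 i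
    · have hlt : i < i + (n + 1) := by omega
      refine (hher i (i + (n + 1)) hlt).trans ?_
      rw [sum_Ico_eq_sum_range, show i + (n + 1) - i = n + 1 by omega]
      have hterm : ∀ l ∈ range (n + 1),
          C₀ * θ ^ (i + (n + 1) - 1 - (i + l)) * m (i + l) i ≤ C₀ * (θ ^ (n - l) * (d * (θ + C₀) ^ l)) := by
        intro l hl
        have hl' : l < n + 1 := mem_range.mp hl
        rw [show i + (n + 1) - 1 - (i + l) = n - l by omega, mul_assoc]
        exact mul_le_mul_of_nonneg_left (mul_le_mul_of_nonneg_left (ih l hl' i) (pow_nonneg hθ _)) hC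
      calc ∑ l ∈ range (n + 1), C₀ * θ ^ (i + (n + 1) - 1 - (i + l)) * m (i + l) i
          ≤ ∑ l ∈ range (n + 1), C₀ * (θ ^ (n - l) * (d * (θ + C₀) ^ l)) := sum_le_sum hterm
        _ = d * (C₀ * ∑ l ∈ range (n + 1), θ ^ (n - l) * (θ + C₀) ^ l) := by
            rw [mul_sum, mul_sum]
            exact sum_congr rfl fun l _ => by ring
        _ ≤ d * (θ + C₀) ^ (n + 1) := mul_le_mul_of_nonneg_left (geomConv_le hθ hC n) hd

/-- **★ RENEWAL AT THE TERM LEVEL ⟹ (a2)**: if the summed termwise moduli obey the own-coupling bound and the heredity inequality, the representation has `FadingOnBox L d (θ + C₀)`. [folklore] -/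
theorem fadingOnBox_of_renewal {L : LocDomainZ4 → ℕ → ℕ → ℝ} {d C₀ θ : ℝ} (hθ : 0 ≤ θ) (hC : 0 ≤ C₀) (hd : 0 ≤ d)
    (h0 : ∀ k, sumModuli L k k ≤ d)
    (hher : ∀ i k, i < k → sumModuli L k i ≤ ∑ j ∈ Ico i k, C₀ * θ ^ (k - 1 - j) * sumModuli L j i) :
    FadingOnBox L d (θ + C₀) := by
  intro k i hik
  have h := fading_of_renewal (m := sumModuli L) hθ hC hd h0 hher (k - i) i
  rw [Nat.add_sub_cancel' hik] at h
  exact h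

end Renewal

/-! ## §7 EDITION 4 — CRIT-2's option (b) EXECUTED AND PLACED: typed, proved (Schwarz), and found to sit INSIDE the cell barrier B-III «SECTOR ≠ DISC» — recorded with its
reason, NOT adopted as the card's payment (the card pays (a), §6; S-LIN stays the per-polymer hypothesis `LinOnBox13` proved by the MOMENT route of the CF1 memo).
The option: «`I X k` extends in the last coupling to a complex neighbourhood with a majorant and vanishes at 0 ⟹ `LinOnBox` by the Schwarz lemma» (ROUND 3 (C)(b)).  TYPED below as
`HoloLastOnBox R R₀ M′` (ONE holomorphic `f` per `(X, k, earlier history)` on a k-free disc `|z| < R₀`, `R₀ > γ₀`, `f 0 = 0`, disc majorant `M′ X` — finite per polymer, NO decay, NO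
summability; with `M′ = M` summable Schwarz would even give the LINEAR letter `BoxRemainder`, the (P1) road CF1.a says print does not deliver) and PROVED: `linOnBox_of_holoLast`
(`A X := M′ X ∕ R₀`, Mathlib `Complex.dist_le_div_mul_dist_of_mapsTo_ball`).  PLACEMENT (honest, and decisive): a k-free DISC around `g_k = 0` is exactly what barrier B-III
(`FOUND-NOTHING-idea2-g3.md` L5 ∕ B-III; flow-level shadow bflow-p2 `bump_no_uniform_complexBound`) says the Gibbs factor does not tolerate — the complex domain of the last coupling
compatible with large-field damping is the SECTOR `|arg g| < π∕4` (`Re g⁻² > 0`), vertex at 0; PER POLYMER the same integrand appears: after the rescaling `B′ = g_k·(CB)` the small-field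
region is `|B| < C₁ε₁∕g_k` ([II] (1.19)–(1.20) p. 6), so `V(gB)` stays inside its analyticity domain `|gB| < α₁` only for `|g| ≲ (α₁∕C₁ε₁)·g_k` — a radius ∝ g_k (AN4's «radius ≍ c·g∕ε»),
never a k-free disc at 0 — and the χ-tails of family F6 (`e^{−cε₁²∕g_k²}`, the card's h4 list) are unbounded along imaginary directions; sector holomorphy with a vertex value gives NO
rate at the vertex (B-III: `cos log g`).  CONCLUSION: for the intended inhabitant H-HOLO is presumptively FALSE termwise; what survives of (b) is the ALGEBRAIC g_k-prefactor of the
rescaled exponent `g_k⁻²·V(g_kB) = g_k·B³·(c₃ + c₄·g_kB + …)` ([II] (1.38)–(1.40) p. 10) — i.e. the moment route proving S-LIN per polymer (CF1 memo), not Schwarz.  The two theorems are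
kept as the executed check: correct statements about any representation that WOULD be disc-holomorphic (e.g. activities polynomial in `g_k` of bounded degree with bounded coefficients). -/

section HoloSide

variable {β : HBeta} {b : ℕ → ℝ} {γ₀ : ℝ}

/-- **(b) `HoloLastOnBox R R₀ M′` — LAST-SLOT HOLOMORPHY WITH A DISC MAJORANT (obligation about a given representation):** for every polymer `X`, scale `k` and earlier history
`p′ ∈ ]0, γ₀]^k` there is ONE function `f`, holomorphic on the disc `|z| < R₀` (`0 < R₀`, `γ₀ < R₀`, k-free), with `f 0 = 0`, `‖f z‖ ≤ M′ X` on the disc, agreeing with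
`t ↦ I X k (p′, t)` on the whole real segment `]0, γ₀]` (a pointwise-in-`t` choice of `f` would be vacuous — it is one `f` per `(X, k, p′)`).  PLACED INSIDE BARRIER B-III for the
intended inhabitant (§7 docstring: the Gibbs factor tolerates a sector, not a k-free disc at 0; χ-tails `e^{−cε₁²∕g_k²}`) — an EXECUTED option, not a recommended obligation; not met by
the one-term collapse either unless `β − N` itself is disc-holomorphic in `g_k` at 0. [cite: Balaban1988RG2Cluster, (1.19)–(1.20) p.6 and (1.38)–(1.40) p.10; Balaban1987RG1, (2.14) p.268] -/
def HoloLastOnBox (R : BoxActivityRepr β b γ₀) (R₀ : ℝ) (M' : LocDomainZ4 → ℝ) : Prop :=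
  0 < R₀ ∧ γ₀ < R₀ ∧ (∀ X, 0 ≤ M' X) ∧
    ∀ (X : LocDomainZ4) (k : ℕ) (p' : Fin k → ℝ), (∀ i, 0 < p' i ∧ p' i ≤ γ₀) →
      ∃ f : ℂ → ℂ, DifferentiableOn ℂ f (Metric.ball 0 R₀) ∧ f 0 = 0 ∧ (∀ z ∈ Metric.ball (0 : ℂ) R₀, ‖f z‖ ≤ M' X) ∧
        ∀ t : ℝ, 0 < t → t ≤ γ₀ → f t = R.I X k (Fin.snoc p' t)

/-- **★ (b) ⟹ S-LIN-BOX (proved; Mathlib's Schwarz lemma `Complex.dist_le_div_mul_dist_of_mapsTo_ball`)**: `HoloLastOnBox R R₀ M′ → LinOnBox R` with `A X := M′ X ∕ R₀`. [folklore] -/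
theorem linOnBox_of_holoLast (R : BoxActivityRepr β b γ₀) {R₀ : ℝ} {M' : LocDomainZ4 → ℝ} (h : HoloLastOnBox R R₀ M') : LinOnBox R := by
  obtain ⟨hR₀, hγR, hM', hol⟩ := h
  refine ⟨fun X => M' X / R₀, fun X => div_nonneg (hM' X) hR₀.le, fun k p hp X => ?_⟩
  have ht : 0 < p (Fin.last k) ∧ p (Fin.last k) ≤ γ₀ := hp (Fin.last k)
  obtain ⟨f, hf, hf0, hfb, hft⟩ := hol X k (Fin.init p) fun i => hp i.castSucc
  have hval : f (p (Fin.last k) : ℂ) = (R.I X k p : ℂ) := by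
    rw [hft _ ht.1 ht.2, Fin.snoc_init_self]
  have hz : ((p (Fin.last k) : ℝ) : ℂ) ∈ Metric.ball (0 : ℂ) R₀ := by
    rw [Metric.mem_ball, dist_zero_right, Complex.norm_real, Real.norm_eq_abs, abs_of_pos ht.1]
    exact lt_of_le_of_lt ht.2 hγR
  have hmaps : Set.MapsTo f (Metric.ball (0 : ℂ) R₀) (Metric.closedBall (f 0) (M' X)) := by
    intro z hz'
    rw [Metric.mem_closedBall, hf0, dist_zero_right]
    exact hfb z hz'
  have key := Complex.dist_le_div_mul_dist_of_mapsTo_ball hf hmaps hz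
  rw [hf0, dist_zero_right, dist_zero_right, hval, Complex.norm_real, Complex.norm_real, Real.norm_eq_abs, Real.norm_eq_abs,
    abs_of_pos ht.1] at key
  exact key

/-- **★ hence (b) alone pays the BOX MODULUS and the CORNER LIMIT for the representation's own `b`** (`boxModulus_of_linOnBox`, `scaleAnchor_of_linOnBox`). [folklore] -/
theorem scaleAnchor_of_holoLast (R : BoxActivityRepr β b γ₀) {R₀ : ℝ} {M' : LocDomainZ4 → ℝ} (h : HoloLastOnBox R R₀ M') (hγ₀ : 0 < γ₀) : ScaleAnchor β b :=
  scaleAnchor_of_linOnBox R (linOnBox_of_holoLast R h) hγ₀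

end HoloSide

/-! ## §8 EDITION 4 AT THE RECORD: the obligations about the ONE delivered object `𝓑 : BoxRecordRepr13`, and the chains with (C) — and, under (b), S-LIN — DERIVED.
D-REPR's edition-4 deliverable (definer-first, XL, the dominant debt, not constructed here): `𝓑` + `ContOnBox13 𝓑` (or the stronger `LipOnBox13 𝓑` [+ fading, for U2∕U3]) +
`LinOnBox13 𝓑` (S-LIN, by the moment route; the Schwarz option `HoloLast13` is recorded but sits inside B-III, §7).  Outside the card then remain EXACTLY: D-REPR itself (with these
term-level obligations) and the drift SIGN `DriftAtN13` ((D1) at print's one-loop numbers); (C) is no longer outside — it is a consequence of `ContOnBox13`. -/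

section RecordE4

/-- (a0) at the record (obligation about a delivered `𝓑`). [cite: Balaban1987RG1, Thm 3 p.264 and §5 p.298] -/
def ContOnBox13 (𝓑 : BoxRecordRepr13) : Prop :=
  ∀ (F : T4Family) (θ : Node00.Stage13HParams F 2) (hP : θ.Provisos₁₃SepCoPH F 2)
    (hU : θ.ZhUnity F 2 ∧ θ.SlotsNondegenerate₁₃ F 2) (hθ : θ.Admissible F 2)
    (hB : B16.EndStatementBPrinted (Node00.datumOfRecord₁₃SepCoPH F 2 θ hP).C) (hwin : Window13 F θ hP),
    ContOnBox (𝓑.repr F θ hP hU hθ hB hwin)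

/-- (a1) at the record (obligation): termwise history moduli with X-summable sums, per tuple. [cite: Balaban1987RG1, §5 p.298] -/
def LipOnBox13 (𝓑 : BoxRecordRepr13) : Prop :=
  ∀ (F : T4Family) (θ : Node00.Stage13HParams F 2) (hP : θ.Provisos₁₃SepCoPH F 2)
    (hU : θ.ZhUnity F 2 ∧ θ.SlotsNondegenerate₁₃ F 2) (hθ : θ.Admissible F 2)
    (hB : B16.EndStatementBPrinted (Node00.datumOfRecord₁₃SepCoPH F 2 θ hP).C) (hwin : Window13 F θ hP),
    ∃ L : LocDomainZ4 → ℕ → ℕ → ℝ, LipOnBox (𝓑.repr F θ hP hU hθ hB hwin) L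

/-- (a1) ∧ (a2) at the record (obligation): termwise history moduli whose sums fade at a rate `θ′ < 1`, per tuple. [cite: Balaban1987RG1, §5 p.298] -/
def FadingLip13 (𝓑 : BoxRecordRepr13) : Prop :=
  ∀ (F : T4Family) (θ : Node00.Stage13HParams F 2) (hP : θ.Provisos₁₃SepCoPH F 2)
    (hU : θ.ZhUnity F 2 ∧ θ.SlotsNondegenerate₁₃ F 2) (hθ : θ.Admissible F 2)
    (hB : B16.EndStatementBPrinted (Node00.datumOfRecord₁₃SepCoPH F 2 θ hP).C) (hwin : Window13 F θ hP),
    ∃ (L : LocDomainZ4 → ℕ → ℕ → ℝ) (C ρ : ℝ), 0 < ρ ∧ ρ < 1 ∧ LipOnBox (𝓑.repr F θ hP hU hθ hB hwin) L ∧ FadingOnBox L C ρ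

/-- (b) at the record (shape of the executed option; INSIDE barrier B-III for the intended inhabitant, §7 — not recommended): last-slot disc-holomorphy with a disc majorant, per
tuple. [cite: Balaban1988RG2Cluster, (1.19)–(1.20) p.6 and (1.38)–(1.40) p.10] -/
def HoloLast13 (𝓑 : BoxRecordRepr13) : Prop :=
  ∀ (F : T4Family) (θ : Node00.Stage13HParams F 2) (hP : θ.Provisos₁₃SepCoPH F 2)
    (hU : θ.ZhUnity F 2 ∧ θ.SlotsNondegenerate₁₃ F 2) (hθ : θ.Admissible F 2)
    (hB : B16.EndStatementBPrinted (Node00.datumOfRecord₁₃SepCoPH F 2 θ hP).C) (hwin : Window13 F θ hP),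
    ∃ (R₀ : ℝ) (M' : LocDomainZ4 → ℝ), HoloLastOnBox (𝓑.repr F θ hP hU hθ hB hwin) R₀ M'

/-- **★ (a0) at the record ⟹ (C) at some level (proved)**: `ContOnBox13 𝓑 → SurvContSome13` (level `𝓑.γ₀`).  The letter ★★★★ took as a hypothesis is now DERIVED. [folklore] -/
theorem survContSome13_of_contOnBox13 (𝓑 : BoxRecordRepr13) (hC : ContOnBox13 𝓑) : SurvContSome13 := fun F θ hP hU hθ hB hwin =>
  ⟨𝓑.γ₀ F θ hP, 𝓑.γ₀_pos F θ hP, survCont_of_contOnBox (𝓑.repr F θ hP hU hθ hB hwin) (hC F θ hP hU hθ hB hwin) (𝓑.γ₀_pos F θ hP)⟩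

theorem contOnBox13_of_lipOnBox13 (𝓑 : BoxRecordRepr13) (hL : LipOnBox13 𝓑) : ContOnBox13 𝓑 := fun F θ hP hU hθ hB hwin => by
  obtain ⟨L, h⟩ := hL F θ hP hU hθ hB hwin
  exact contOnBox_of_lipOnBox _ h

theorem linOnBox13_of_holoLast13 (𝓑 : BoxRecordRepr13) (hH : HoloLast13 𝓑) : LinOnBox13 𝓑 := fun F θ hP hU hθ hB hwin => by
  obtain ⟨R₀, M', h⟩ := hH F θ hP hU hθ hB hwin
  exact linOnBox_of_holoLast _ h

/-- **★⁵ EDITION 4's CHAIN (proved, no sorry): S-LIN-BOX(𝓑) ∧ drift-at-N ∧ TERMWISE CONTINUITY ⟹ THE CRUX DECL BY NAME** — (C) no longer a hypothesis.  Outside the card: D-REPR (𝓑 with its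
edition-4 obligations) and the drift SIGN ((D1)).  CONDITIONAL; nothing of Bałaban asserted; K2⁷ NOT closed; R4 = the conditional finite-𝕋⁴ rung only; Clay NOT proved. [cite: Balaban1987RG1, Thm 2 p.259 (first sentence), Thm 3 p.264 and (2.13) p.268; Balaban1988RG2Cluster, Lemma 3 (2.38) p.20] -/
theorem EndpointGivenBR13SepCoPH_of_linOnBox_drift_cont (𝓑 : BoxRecordRepr13) (hL : LinOnBox13 𝓑) (hD : DriftAtN13 𝓑) (hC : ContOnBox13 𝓑) :
    Summit.QuantumFields.YangMills.Theses.BalabanUVNodes.EndpointGivenBR13SepCoPH :=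
  EndpointGivenBR13SepCoPH_of_linOnBox_drift_survCont 𝓑 hL hD (survContSome13_of_contOnBox13 𝓑 hC)

/-- **★⁶ (executed option (b), RECORDED NOT RECOMMENDED — its hypothesis `HoloLast13` sits inside barrier B-III, §7): LAST-SLOT DISC-HOLOMORPHY(𝓑) ∧ drift-at-N ∧ TERMWISE
CONTINUITY ⟹ THE CRUX DECL BY NAME.**  CONDITIONAL; K2⁷ NOT closed. [cite: Balaban1987RG1, Thm 2 p.259 (first sentence) and (2.14) p.268; Balaban1988RG2Cluster, (1.38)–(1.40) p.10] -/
theorem EndpointGivenBR13SepCoPH_of_holo_drift_cont (𝓑 : BoxRecordRepr13) (hH : HoloLast13 𝓑) (hD : DriftAtN13 𝓑) (hC : ContOnBox13 𝓑) :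
    Summit.QuantumFields.YangMills.Theses.BalabanUVNodes.EndpointGivenBR13SepCoPH :=
  EndpointGivenBR13SepCoPH_of_linOnBox_drift_cont 𝓑 (linOnBox13_of_holoLast13 𝓑 hH) hD hC

/-- **★⁵′ … or with the history moduli in place of bare continuity: S-LIN-BOX(𝓑) ∧ drift-at-N ∧ (a1) ⟹ THE CRUX DECL BY NAME.**  CONDITIONAL; K2⁷ NOT closed. [cite: Balaban1987RG1, Thm 2 p.259 (first sentence) and §5 p.298] -/
theorem EndpointGivenBR13SepCoPH_of_linOnBox_drift_lip (𝓑 : BoxRecordRepr13) (hL : LinOnBox13 𝓑) (hD : DriftAtN13 𝓑) (hLip : LipOnBox13 𝓑) :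
    Summit.QuantumFields.YangMills.Theses.BalabanUVNodes.EndpointGivenBR13SepCoPH :=
  EndpointGivenBR13SepCoPH_of_linOnBox_drift_cont 𝓑 hL hD (contOnBox13_of_lipOnBox13 𝓑 hLip)

/-- **★ U2's LETTER SHAPE AT THE RECORD ON THE REPRESENTATION's WINDOW (proved): `LipOnBox13 𝓑 → ∀ tuple, ∃ Λ, HistLipschitz Λ (𝓑.γ₀ …) D.βfun`.**  HONEST: the window is `𝓑.γ₀ ≤ θ.γ`;
U3ᴷ's letter (p609637 §3) asks `HistLipschitz Λ θ.γ` on the FULL window — equal only if D-REPR delivers `𝓑.γ₀ = θ.γ`. [cite: Balaban1987RG1, §5 p.298] -/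
theorem histLipschitzAt13_of_lipOnBox13 (𝓑 : BoxRecordRepr13) (hLip : LipOnBox13 𝓑) :
    ∀ (F : T4Family) (θ : Node00.Stage13HParams F 2) (hP : θ.Provisos₁₃SepCoPH F 2)
      (hU : θ.ZhUnity F 2 ∧ θ.SlotsNondegenerate₁₃ F 2) (hθ : θ.Admissible F 2)
      (hB : B16.EndStatementBPrinted (Node00.datumOfRecord₁₃SepCoPH F 2 θ hP).C) (hwin : Window13 F θ hP),
      ∃ Λ : ℕ → ℕ → ℝ, HistLipschitz Λ (𝓑.γ₀ F θ hP) (Node00.datumOfRecord₁₃SepCoPH F 2 θ hP).βfun := fun F θ hP hU hθ hB hwin => by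
  obtain ⟨L, h⟩ := hLip F θ hP hU hθ hB hwin
  exact ⟨sumModuli L, histLipschitz_of_lipOnBox _ h⟩

/-- **★ U3's HISTORY HALF AT THE RECORD ON THE WINDOW (proved): `FadingLip13 𝓑 → ∀ tuple, ∃ Λ C ρ, 0 < ρ < 1 ∧ HistLipschitz Λ (𝓑.γ₀ …) D.βfun ∧ FadingMemory C ρ Λ`** — the two history
conjuncts of U3ᴷ's text (p609637 §3: `… HistLipschitz Λ θ.γ D.βfun ∧ FadingMemory C ρ Λ`), modulo the window caveat; the N17 conjunct `ScaleShiftRate` is K3⁷'s and untouched. [cite: Balaban1987RG1, §5 p.298] -/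
theorem histHalfU3At13_of_fadingLip13 (𝓑 : BoxRecordRepr13) (hF : FadingLip13 𝓑) :
    ∀ (F : T4Family) (θ : Node00.Stage13HParams F 2) (hP : θ.Provisos₁₃SepCoPH F 2)
      (hU : θ.ZhUnity F 2 ∧ θ.SlotsNondegenerate₁₃ F 2) (hθ : θ.Admissible F 2)
      (hB : B16.EndStatementBPrinted (Node00.datumOfRecord₁₃SepCoPH F 2 θ hP).C) (hwin : Window13 F θ hP),
      ∃ (Λ : ℕ → ℕ → ℝ) (C ρ : ℝ), 0 < ρ ∧ ρ < 1 ∧ HistLipschitz Λ (𝓑.γ₀ F θ hP) (Node00.datumOfRecord₁₃SepCoPH F 2 θ hP).βfun ∧ FadingMemory C ρ Λ :=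
  fun F θ hP hU hθ hB hwin => by
  obtain ⟨L, C, ρ, hρ0, hρ1, h, hFd⟩ := hF F θ hP hU hθ hB hwin
  exact ⟨sumModuli L, C, ρ, hρ0, hρ1, histLipschitz_of_lipOnBox _ h, fadingMemory_of_lipOnBox _ h hFd⟩

end RecordE4

/-! ## §9 KERNEL SEPARATION: the single-polymer collapse CANNOT meet edition 4's weakest new field.  A β with the plain LINEAR box remainder (`BoxRemainder β 0 1 1`, tree :210 — so
CRIT-2's `linOnBox_of_boxRemainder` inhabits §5's ed.3 pair for it) but DISCONTINUOUS IN THE EARLIER COUPLING `g_0` at scale 1 (a jump at `g_0 = ½`, the G-t4-U2-2 direction — the last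
coupling enters linearly, as smoothly as print's p. 264 wants): NO `BoxActivityRepr` of it, one-term or not, satisfies `ContOnBox` (a fortiori none satisfies (a1) or (a1⁻)). -/

section Separation

/-- the jump profile in the earliest coupling -/
def jump (x : ℝ) : ℝ := if x < 2⁻¹ then 1 else 0

/-- THE WITNESS β: `β_k(p) := p_k · 𝟙[p_0 < ½]`. [folklore] -/
def betaJump : HBeta := fun k p => p (Fin.last k) * jump (p 0)

/-- two-coordinate vectors without matrix notation -/
def vec2 (a c : ℝ) : Fin (1 + 1) → ℝ := fun i => if i = 0 then a else c

@[simp] theorem vec2_zero (a c : ℝ) : vec2 a c 0 = a := by simp [vec2]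

@[simp] theorem vec2_last (a c : ℝ) : vec2 a c (Fin.last 1) = c := by
  simp [vec2]

theorem vec2_mem_histBox {a c : ℝ} (ha : 0 < a ∧ a ≤ 1) (hc : 0 < c ∧ c ≤ 1) : vec2 a c ∈ HistBox 1 1 := by
  intro i
  by_cases hi : i = 0
  · subst hi; simpa using ha
  · simp [vec2, hi, hc.1, hc.2]

/-- The witness HAS the linear box remainder (reference sequence `0`, constant `1`, window `1`). [folklore] -/
theorem boxRemainder_betaJump : BoxRemainder betaJump (fun _ => 0) 1 1 := by
  intro k p hp
  have h0 : 0 < p (Fin.last k) := (hp (Fin.last k)).1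
  have hj : 0 ≤ jump (p 0) ∧ jump (p 0) ≤ 1 := by
    unfold jump; split_ifs <;> norm_num
  rw [sub_zero, betaJump, abs_of_nonneg (mul_nonneg h0.le hj.1), one_mul]
  calc p (Fin.last k) * jump (p 0) ≤ p (Fin.last k) * 1 := mul_le_mul_of_nonneg_left hj.2 h0.le
    _ = p (Fin.last k) := mul_one _

/-- … but is NOT continuous on the box `]0, 1]²` at scale 1 (jump at `g_0 = ½` along `g_1 = 1`). [folklore] -/
theorem not_betaContH_betaJump : ¬ BetaContH 1 betaJump := by
  intro h
  have hc := h 1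
  rw [← histBox_eq_box, Metric.continuousOn_iff] at hc
  have hp : vec2 2⁻¹ 1 ∈ HistBox 1 1 := vec2_mem_histBox (by norm_num) (by norm_num)
  obtain ⟨δ, hδ, hδ'⟩ := hc (vec2 2⁻¹ 1) hp 2⁻¹ (by norm_num)
  set t : ℝ := min δ 2⁻¹ / 2 with ht
  have ht0 : 0 < t := by positivity
  have htδ : t < δ := by
    have : min δ 2⁻¹ ≤ δ := min_le_left _ _
    rw [ht]; linarith [lt_min hδ (by norm_num : (0:ℝ) < 2⁻¹)]
  have ht4 : t ≤ 4⁻¹ := by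
    have : min δ 2⁻¹ ≤ 2⁻¹ := min_le_right _ _
    rw [ht]; linarith
  have hq : vec2 (2⁻¹ - t) 1 ∈ HistBox 1 1 := vec2_mem_histBox ⟨by linarith, by linarith⟩ (by norm_num)
  have hdist : dist (vec2 (2⁻¹ - t) 1) (vec2 2⁻¹ 1) < δ := by
    rw [dist_pi_lt_iff hδ]
    intro i
    by_cases hi : i = 0
    · subst hi
      rw [vec2_zero, vec2_zero, Real.dist_eq, show (2:ℝ)⁻¹ - t - 2⁻¹ = -t by ring, abs_neg, abs_of_pos ht0]
      exact htδ
    · have e1 : vec2 (2⁻¹ - t) 1 i = 1 := by simp [vec2, hi]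
      have e2 : vec2 2⁻¹ 1 i = 1 := by simp [vec2, hi]
      rw [e1, e2, dist_self]; exact hδ
  have key := hδ' (vec2 (2⁻¹ - t) 1) hq hdist
  have e1 : betaJump 1 (vec2 (2⁻¹ - t) 1) = 1 := by
    simp only [betaJump, vec2_last, vec2_zero, jump, one_mul]
    rw [if_pos (by linarith)]
  have e2 : betaJump 1 (vec2 2⁻¹ 1) = 0 := by
    simp only [betaJump, vec2_last, vec2_zero, jump, one_mul]
    rw [if_neg (lt_irrefl _)]
  rw [e1, e2, Real.dist_eq, sub_zero, abs_one] at key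
  norm_num at key

/-- **★ THE SEPARATION (proved): the linear box remainder holds for `betaJump`, yet NO box activity representation of it (against the same `N = 0`, window `1`) has continuous terms** —
`ContOnBox R → BetaContH` (§6) would contradict `not_betaContH_betaJump`.  So edition 4's weakest field lies OUTSIDE what CRIT-2's single-polymer collapse can meet; the ed.3 sandwich
«linear remainder ⟹ interface ⟹ modulus» is broken on the left for the edition-4 interface. [folklore] -/
theorem collapse_misses_contOnBox : BoxRemainder betaJump (fun _ => 0) 1 1 ∧ ∀ R : BoxActivityRepr betaJump (fun _ => 0) 1, ¬ ContOnBox R :=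
  ⟨boxRemainder_betaJump, fun R hR => not_betaContH_betaJump (betaContH_of_contOnBox R hR)⟩

/-- … and a fortiori none has termwise history moduli (a1) or crude Lipschitz constants (a1⁻). [folklore] -/
theorem collapse_misses_lipOnBox (R : BoxActivityRepr betaJump (fun _ => 0) 1) :
    (∀ L, ¬ LipOnBox R L) ∧ ∀ L, ¬ CrudeLipOnBox R L :=
  ⟨fun _ h => collapse_misses_contOnBox.2 R (contOnBox_of_lipOnBox R h), fun _ h => collapse_misses_contOnBox.2 R (contOnBox_of_crudeLip R h)⟩

end Separation


/-! ## §10 REV-27 RE-KEY (route edit by plan g84, 2026-08-28T08:06–08:10Z, rev 26ᴿ → 27 `12afebc05bbc`, route file sha16 `3bc71da855d0d541`; read by this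
seat at 08:3xZ, AFTER §1–§9 were written).  K2⁷ `EndpointGivenBR13SepCoPH` (stmt-QuantumFields-20543, the decl §2–§8 conclude by name) is now an
`aside` item; the route's deciding theorem reads `closes (h0 : K0⁷) (h1 : K1⁸) (h2 : K2⁸) (h3 : K3⁷)` with K1⁸ =
`StabilityBRunRowsAtRecordR13SepCoPH` (stmt-QuantumFields-26907, crux r3, DECIDING) := K1⁷ ∧, at the SAME witness tuple, the RUN ROWS for
`β_θ := Node00.betaOfRecord₁₃ F 2 θ.toStage13Params` on SOME level `γ₀ > 0`: (i) `RunConstRemainder β_θ b r γ₀` for SOME `b`, ANY `r`; (iv) the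
run-wise partial-sum FLOOR `−M ≤ Σ_{j∈[k,n)} β_θ j (prefix)`; (C) `SurvCont β_θ γ₀` (bodies inlined = DEF-1's, P3 n°93 `k1R8_iff_landed : Iff.rfl`);
and K2⁸ `EndpointGivenRunRowsR13SepCoPH` (rows ⟹ END) is SUPPORT, born closed (dag-n24
`endpointExistence_datumOfRecord₁₃SepCoPH_of_runRows_survCont`).

WHERE THIS CARD'S CONTENT SITS AFTER THE RE-KEY (honest map).  Row (i) no longer carries NODE O: ANY bounded remainder relative to ANY `b`
does (n24-w1 `runConstRemainder_of_boxBounds`).  The load moved to row (iv), the FLOOR — and the floor is exactly where the modulus and the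
drift meet: `OneLoopDrift s A N` + a remainder capped BY THE SLOPE, `RunConstRemainder β N s γ₁`, give the floor with `M := 2A`
(`runwiseFloor_of_drift_runConstRemainder`, five lines), and the cap `s` is met by the rate-free modulus on a SHRUNK window exactly as in §1
(`runConstRemainder_of_runModulus`).  So the seam «remainder < drift slope» of every END road did not disappear with rev 27 — it moved
from the item text into the proof of row (iv), where a window-shrinking modulus pays it without any located ε₁-smallness; row (C) is
`ContOnBox13` through `survCont_of_contOnBox`, cut to the shrunk level by N17's `survCont_anti`.  ★⁷ `k1R8_of_k1R7_linOnBox_drift_cont`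
concludes K1⁸ BY NAME from K1⁷ (`StabilityBAtRecordR13SepCoPH`, stmt-20542, now an aside decl — taken as a HYPOTHESIS, it is K1⁸'s
first half) and the SAME three obligations on `𝓑` as ★⁵.  CONDITIONAL; credits nothing; K1⁷ ∕ K1⁸ OPEN; `𝓑` inhabited nowhere. -/
section Rev27Rows

variable {β : HBeta} {b : ℕ → ℝ} {γ₀ : ℝ}

/-- Row (iv) of K1⁸, named for readability (body VERBATIM the route file's :295 floor conjunct, instantiated at a general `β`): the run-wise
partial-sum floor `−M` along the in-window (0.20)-runs of level `γ₀`. HYPOTHESIS SHAPE. [cite: Balaban1987RG1, Thm 2 p.259 (first sentence) and (1.22) p.264] -/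
def RunwiseFloor (β : HBeta) (M γ₀ : ℝ) : Prop :=
  ∀ (n : ℕ) (gs : ℕ → ℝ), RGEqH n β gs → Step.InInterval γ₀ n gs → ∀ k, k ≤ n → -M ≤ ∑ j ∈ Finset.Ico k n, β j (prefixOf gs j)

/-- **★ THE FLOOR FROM DRIFT + SLOPE-CAPPED REMAINDER (proved; where NODE O's smallness now lives).**  If the partial sums of `b` stay within
`A` of the line `s·k` (`OneLoopDrift s A b`) and `β` stays within `s` of `b` along the in-window runs of level `γ₀` (`RunConstRemainder β b s γ₀`
— the cap IS the slope), then `Σ_{j∈[k,n)} β_j ≥ Σ_{j∈[k,n)} (b_j − s) ≥ (s·n − A) − (s·k + A) − s·(n − k) = −2A`. [folklore] -/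
theorem runwiseFloor_of_drift_runConstRemainder {s A : ℝ} (hd : OneLoopDrift s A b) (hr : RunConstRemainder β b s γ₀) :
    RunwiseFloor β (2 * A) γ₀ := by
  intro n gs hrg hI k hk
  have h1 : ∀ j ∈ Finset.Ico k n, b j - s ≤ β j (prefixOf gs j) := by
    intro j hj
    have hj' := hr n gs hrg hI j (Finset.mem_Ico.1 hj).2.le
    rw [abs_le] at hj'
    linarith [hj'.1]
  have hsum : ∑ j ∈ Finset.Ico k n, (b j - s) ≤ ∑ j ∈ Finset.Ico k n, β j (prefixOf gs j) := Finset.sum_le_sum h1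
  have hsplit : ∑ j ∈ Finset.range k, b j + ∑ j ∈ Finset.Ico k n, b j = ∑ j ∈ Finset.range n, b j := by
    rw [Finset.range_eq_Ico, Finset.range_eq_Ico]
    exact Finset.sum_Ico_consecutive _ (Nat.zero_le k) hk
  have hconst : ∑ j ∈ Finset.Ico k n, (b j - s) = ∑ j ∈ Finset.Ico k n, b j - s * ((n : ℝ) - k) := by
    rw [Finset.sum_sub_distrib, Finset.sum_const, Nat.card_Ico, nsmul_eq_mul, Nat.cast_sub hk]
    ring
  have hk' := hd k
  have hn' := hd n
  rw [abs_le] at hk' hn'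
  have hmul : s * ((n : ℝ) - k) = s * n - s * k := by ring
  rw [hconst, hmul] at hsum
  linarith [hk'.1, hk'.2, hn'.1, hn'.2, hsplit]

/-- **★ ROWS (i)+(iv)+(C) FROM THE BOX EDITION, generic (proved):** S-LIN-BOX (⟹ box modulus ⟹ run modulus), a drift of slope `s > 0` at the
SAME `b`, and termwise continuity give a level `γ₁ ≤ γ₀` carrying row (i) with `r := s`, row (iv) with `M := 2A`, and row (C) — the window is
SHRUNK to meet the cap `s` (`runConstRemainder_of_runModulus`), (C) descends by `survCont_anti`. CONDITIONAL on the displayed hypotheses. [folklore] -/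
theorem runRows_of_linOnBox_drift_cont (R : BoxActivityRepr β b γ₀) (hL : LinOnBox R) (hγ₀ : 0 < γ₀) {s A : ℝ} (hs : 0 < s)
    (hd : OneLoopDrift s A b) (hC : ContOnBox R) :
    ∃ γ₁ : ℝ, 0 < γ₁ ∧ γ₁ ≤ γ₀ ∧ RunConstRemainder β b s γ₁ ∧ RunwiseFloor β (2 * A) γ₁ ∧ SurvCont β γ₁ := by
  obtain ⟨γ₁, hγ₁, hle, hrem⟩ := runConstRemainder_of_runModulus (runModulus_of_boxModulus (boxModulus_of_linOnBox R hL)) hγ₀ hs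
  exact ⟨γ₁, hγ₁, hle, hrem, runwiseFloor_of_drift_runConstRemainder hd hrem, survCont_anti hγ₁ hle (survCont_of_contOnBox R hC hγ₀)⟩

/-- **K1⁸'s ROWS CONJUNCT AT A TUPLE** (the `∃ b r γ₀ M, 0 < γ₀ ∧ (i) ∧ (iv) ∧ (C)` tail of `StabilityBRunRowsAtRecordR13SepCoPH` :295, for
`β_θ := Node00.betaOfRecord₁₃ F 2 θ.toStage13Params`; bodies = DEF-1's `RunConstRemainder` ∕ `SurvCont` (whose unfoldings K1⁸ inlines) and `RunwiseFloor`).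
HYPOTHESIS SHAPE ∕ target text; not a tree item name (DEF-1 INTENT-9 `…K1R8RowsDefs` may supply one). [cite: Balaban1987RG1, Thm 3 p.264, (5.10) p.293, §1 pp.263–264; Balaban1988RG2Cluster, (2.41) p.21] -/
def RunRows13 (F : T4Family) (θ : Node00.Stage13HParams F 2) : Prop :=
  ∃ (b : ℕ → ℝ) (r γ₀ M : ℝ), 0 < γ₀ ∧ RunConstRemainder (Node00.betaOfRecord₁₃ F 2 θ.toStage13Params) b r γ₀ ∧
    RunwiseFloor (Node00.betaOfRecord₁₃ F 2 θ.toStage13Params) M γ₀ ∧ SurvCont (Node00.betaOfRecord₁₃ F 2 θ.toStage13Params) γ₀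

/-- **★ THE BOX EDITION PAYS K1⁸'s ROWS AT EVERY TUPLE (proved, conditional on the three obligations about a delivered `𝓑`):** `LinOnBox13 𝓑`
(S-LIN-BOX, THIS CARD), `DriftAtN13 𝓑` ((D1)'s sign at N), `ContOnBox13 𝓑` (termwise continuity, §8) ⟹ `RunRows13 F θ` at every unity ∕
slots-non-degenerate ∕ admissible tuple with (B) and the window, with `b := 𝓑.N`, `r := s` (the drift's slope), `M := 2A`, on a shrunk level
`γ₁ ≤ 𝓑.γ₀ ≤ θ.γ`.  The datum's β IS `betaOfRecord₁₃ θ` (def-T `Node00.βfun_datumOfRecord₁₃SepCoPH`, `rfl`). [folklore] -/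
theorem runRows13_of_linOnBox_drift_cont (𝓑 : BoxRecordRepr13) (hL : LinOnBox13 𝓑) (hD : DriftAtN13 𝓑) (hC : ContOnBox13 𝓑) :
    ∀ (F : T4Family) (θ : Node00.Stage13HParams F 2) (hP : θ.Provisos₁₃SepCoPH F 2), (θ.ZhUnity F 2 ∧ θ.SlotsNondegenerate₁₃ F 2) → θ.Admissible F 2 →
      B16.EndStatementBPrinted (Node00.datumOfRecord₁₃SepCoPH F 2 θ hP).C → Window13 F θ hP → RunRows13 F θ := by
  intro F θ hP hU hθ hB hwin
  obtain ⟨s, A, hs, hd⟩ := hD F θ hP hU hθ hB hwin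
  obtain ⟨γ₁, hγ₁, -, hrem, hfl, hsc⟩ :=
    runRows_of_linOnBox_drift_cont (𝓑.repr F θ hP hU hθ hB hwin) (hL F θ hP hU hθ hB hwin) (𝓑.γ₀_pos F θ hP) hs hd (hC F θ hP hU hθ hB hwin)
  rw [Node00.βfun_datumOfRecord₁₃SepCoPH] at hrem hfl hsc
  exact ⟨𝓑.N F θ hP, s, γ₁, 2 * A, hγ₁, hrem, hfl, hsc⟩

/-- **★⁷ REV-27 RE-KEY — K1⁷ (hypothesis) + THE BOX EDITION's THREE OBLIGATIONS ⟹ K1⁸ `StabilityBRunRowsAtRecordR13SepCoPH` BY NAME (proved).**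
K1⁷ `StabilityBAtRecordR13SepCoPH` (stmt-QuantumFields-20542, an `aside` decl since rev 27 = K1⁸'s first half) hands the witness tuple with (B) and the
window; `runRows13_of_linOnBox_drift_cont` hands the rows there.  So after rev 27 the card's supplier road lands on the DECIDING crux's rows conjunct
instead of the aside K2⁷ decl; the END itself (K2⁸) is the tree's.  CONDITIONAL: K1⁷ is OPEN content, `𝓑` is inhabited NOWHERE, `LinOnBox13` ∕
`DriftAtN13` ∕ `ContOnBox13` are obligations; nothing of Bałaban's is asserted or proved; K1⁸ NOT closed; Clay NOT proved. [folklore] -/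
theorem k1R8_of_k1R7_linOnBox_drift_cont (𝓑 : BoxRecordRepr13) (hL : LinOnBox13 𝓑) (hD : DriftAtN13 𝓑) (hC : ContOnBox13 𝓑)
    (hK1 : Summit.QuantumFields.YangMills.Theses.BalabanUVNodes.StabilityBAtRecordR13SepCoPH) :
    Summit.QuantumFields.YangMills.Theses.BalabanUVNodes.StabilityBRunRowsAtRecordR13SepCoPH := by
  intro F hex
  obtain ⟨θ, h, hU, hθ, hB, hwin⟩ := hK1 F hex
  obtain ⟨b', r, γ₁, M, hγ₁, hrem, hfl, hsc⟩ := runRows13_of_linOnBox_drift_cont 𝓑 hL hD hC F θ h hU hθ hB hwin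
  exact ⟨θ, h, hU, hθ, hB, hwin, b', r, γ₁, M, hγ₁, hrem, hfl, hsc⟩

/-- ★⁷′ the same with termwise history moduli (a1) in place of bare continuity. [folklore] -/
theorem k1R8_of_k1R7_linOnBox_drift_lip (𝓑 : BoxRecordRepr13) (hL : LinOnBox13 𝓑) (hD : DriftAtN13 𝓑) (hLip : LipOnBox13 𝓑)
    (hK1 : Summit.QuantumFields.YangMills.Theses.BalabanUVNodes.StabilityBAtRecordR13SepCoPH) :
    Summit.QuantumFields.YangMills.Theses.BalabanUVNodes.StabilityBRunRowsAtRecordR13SepCoPH :=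
  k1R8_of_k1R7_linOnBox_drift_cont 𝓑 hL hD (contOnBox13_of_lipOnBox13 𝓑 hLip) hK1

/-- **★ THE WEAK CURRENCY AT EVERY TUPLE from the box edition** — exactly the hypothesis `h` of the TREE's bridge
`Theorems.BalabanUVNodesK2RunRowsContOfCorner.rowsContAllK_of_ownDrift_runConstRemainderK` (an4 g153, landed 08:25Z, `--supports 26907`):
`prefix → ∃ b s A γ₀ r, OneLoopDrift s A b ∧ 0 < γ₀ ∧ r ≤ s ∧ RunConstRemainder D.βfun b r γ₀ ∧ SurvCont D.βfun γ₀`, with `b := 𝓑.N`, `r := s`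
(the slope-capped remainder on a shrunk level, by the rate-free modulus) and (C) derived from `ContOnBox13`.  CONDITIONAL on the three obligations;
`𝓑` inhabited nowhere. [folklore] -/
theorem weakCurrencyK_of_linOnBox_drift_cont (𝓑 : BoxRecordRepr13) (hL : LinOnBox13 𝓑) (hD : DriftAtN13 𝓑) (hC : ContOnBox13 𝓑) :
    ∀ (F : T4Family) (θ : Node00.Stage13HParams F 2) (hP : θ.Provisos₁₃SepCoPH F 2),
      (θ.ZhUnity F 2 ∧ θ.SlotsNondegenerate₁₃ F 2) → θ.Admissible F 2 →
      B16.EndStatementBPrinted (Node00.datumOfRecord₁₃SepCoPH F 2 θ hP).C →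
      (∃ γ₁ : ℝ, 0 < γ₁ ∧ ∀ γ : ℝ, 0 < γ → γ ≤ γ₁ →
        ∃ P : B12.RunParams, 1 ≤ P.K ∧ ((Node00.datumOfRecord₁₃SepCoPH F 2 θ hP).C P).flow.InInterval γ P.K) →
      ∃ (b : ℕ → ℝ) (s A γ₀ r : ℝ), OneLoopDrift s A b ∧ 0 < γ₀ ∧ r ≤ s ∧
        RunConstRemainder (Node00.datumOfRecord₁₃SepCoPH F 2 θ hP).βfun b r γ₀ ∧
        SurvCont (Node00.datumOfRecord₁₃SepCoPH F 2 θ hP).βfun γ₀ := by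
  intro F θ hP hU hθ hB hwin
  obtain ⟨s, A, hs, hd⟩ := hD F θ hP hU hθ hB hwin
  obtain ⟨γ₁, hγ₁, -, hrem, -, hsc⟩ :=
    runRows_of_linOnBox_drift_cont (𝓑.repr F θ hP hU hθ hB hwin) (hL F θ hP hU hθ hB hwin) (𝓑.γ₀_pos F θ hP) hs hd (hC F θ hP hU hθ hB hwin)
  exact ⟨𝓑.N F θ hP, s, A, γ₁, s, hd, hγ₁, le_rfl, hrem, hsc⟩

/-- **★⁷ᵀ REV-27 RE-KEY THROUGH THE TREE's BRIDGE (proved; dedup of ★⁷)**: K1⁷ (hypothesis) hands the witness tuple; the box edition hands the weak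
currency there (`weakCurrencyK_of_linOnBox_drift_cont`); an4's landed `rowsContAllK_of_ownDrift_runConstRemainderK` turns it into K1⁸'s rows conjunct
(floor `2A` by `runwisePS_of_drift_runConstRemainder` of `…K2RunRowsSandwich`) — so the card's road meets the tree BY NAME at the weak currency and
concludes K1⁸ `StabilityBRunRowsAtRecordR13SepCoPH` BY NAME.  Same conditional status as ★⁷; nothing of Bałaban's asserted; K1⁸ NOT closed. [folklore] -/
theorem k1R8_of_k1R7_viaTreeBridge (𝓑 : BoxRecordRepr13) (hL : LinOnBox13 𝓑) (hD : DriftAtN13 𝓑) (hC : ContOnBox13 𝓑)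
    (hK1 : Summit.QuantumFields.YangMills.Theses.BalabanUVNodes.StabilityBAtRecordR13SepCoPH) :
    Summit.QuantumFields.YangMills.Theses.BalabanUVNodes.StabilityBRunRowsAtRecordR13SepCoPH := by
  intro F hex
  obtain ⟨θ, h, hU, hθ, hB, hwin⟩ := hK1 F hex
  exact ⟨θ, h, hU, hθ, hB, hwin,
    Summit.QuantumFields.YangMills.Theorems.BalabanUVNodesK2RunRowsContOfCorner.rowsContAllK_of_ownDrift_runConstRemainderK
      (weakCurrencyK_of_linOnBox_drift_cont 𝓑 hL hD hC) F θ h hU hθ hB hwin⟩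

end Rev27Rows

/-! ## §11 EDITION 5 (g12) — CRIT-2 g3 ROUND-4's ONE NEW PRICE **P-FE PAID**; DEF-1's landed names met; the anchor side in F-E-SAFE currency; the obstruction-first record
BN-N «MARGINAL TRANSPORT ≠ GEOMETRIC FADING» (kernel part generic); the CF-REN reading.

**P-FE** (ROUND-4 sheet §3; ADDENDUM-2 (iii); CRIT-1 `CRIT-1-FINDINGCHECK-F-E-idea1-g12.md`; kernel `Crit2LastEntryBlind.lean` a618bff64760).  ★⁵∕★⁷∕★⁷ᵀ carry `hL : LinOnBox13 𝓑` —
S-LIN in LAST-ENTRY currency `|I X k p| ≤ A X · p (Fin.last k)` at `betaOfRecord₁₃`.  Modulo last-entry blindness (CRIT-1's F-E ∕ H_FE′: in the tree's free-history model the entry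
`p_j`, j ≥ 1, is read only by the gauge-fixing prefactor `exp(−GF∕p_j²)` and `normConst`, so exact FP-independence makes the record β blind to every entry j ≥ 1, ADDENDUM-2 §1) a
last-entry modulus forces BOX-CONSTANCY `β_θ k ≡ 𝓑.N k`, k ≥ 1 (`Crit2LastEntryBlind.boxConst_of_blind_boxModulus`) — an absurd-strength TARGET letter.  THE FIX (as priced, ≤ 30
load-bearing lines): §10 consumed `LinOnBox` ONLY through `RunModulus` (`runModulus_of_boxModulus ∘ boxModulus_of_linOnBox`), so the rows road is RE-TYPED to the RUN currency the plan
consumes anyway — `LinOnRuns13 𝓑 := ∀ tuple, LinOnRuns (𝓑.repr …).toRun`, i.e. `|I X k (g_0,…,g_k)| ≤ A X · g_k` along the in-window (0.20)-runs ONLY (F-E-SAFE: CRIT-1 ✓, CRIT-2 ✓ —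
along a run the last entry IS the running coupling and cannot be slid; modulo H_FE′ it is print's (2.13) along the self-generated run).  ★⁸ `k1R8_of_k1R7_linOnRuns_drift_cont` concludes
K1⁸ BY NAME from `LinOnRuns13 ∧ DriftAtN13 ∧ ContOnBox13` + K1⁷ through `runModulus_of_linOnRuns` (§4 = Sketch2's original run-wise Tannery); ★⁷ is now the COROLLARY
`★⁸ ∘ linOnRuns13_of_linOnBox13` (a correct implication, no longer an offered target); `weakCurrencyK_of_linOnRuns_drift_cont` + ★⁸ᵀ `k1R8_of_k1R7_linOnRuns_viaTreeBridge` (an4's landed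
bridge).  **DEF-1** (INTENT-9 LANDED, p616926 `Theorems.BalabanUVNodesK1R8RowsDefs`): `RunRows13 F θ ↔ RunRowsCont13 F θ` is `Iff.rfl` (`runRows13_iff_runRowsCont13`); the road supplies the
∀θ programme `RowsContAll` (`rowsContAll_of_linOnRuns_drift_cont`) and lands on K1⁸ through DEF-1's `stabilityBRunRowsAtRecordR13SepCoPH_of_k17_rowsContAll` (★⁸ᴰ) and on the aside
K2⁷ decl through `endpointGivenBR13SepCoPH_of_rowsContAll` (★⁸ᴱ, no anchor and no corner pair needed) — three by-name landings of ONE road (direct, an4's bridge, DEF-1's bridge).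
**ANCHOR SIDE** (the v7c corner pair's 2ᶜᴰ — optional after rev 27; ADDENDUM-2 (iii) «re-key the box sockets to box-SIZE currency»): `SizeLinOnBox R` — `|I X k p| ≤ A X · t` for EVERY
common bound `t` of the entries of `p` (box SIZE, not last entry) ⟹ `BoxSizeModulus` (Tannery) ⟹ ★ `scaleAnchor_of_boxSizeModulus`; `sizeLinOnBox_of_linOnBox` (the old letter
implies the new); the FADED shape `FadedLinOnBox R Λ` (`≤ Σ_i Λ X k i · p_i`, = CRIT-2's `Crit2FadedCurrency.FadedBoxRemainder` termwise) with bounded per-polymer mass ⟹ size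
(`sizeLinOnBox_of_fadedLin`); at the record `SizeLinOnBox13` ⟹ ★ `cornerDriftPos13_of_sizeLin_drift` (2ᶜᴰ = registered `stub_cornerDriftPos13`'s text) and ★⁹
`EndpointGivenBR13SepCoPH_of_sizeLin_linOnRuns_drift_cont` (the aside K2⁷ decl by the CORNER road: size currency for the anchor, run currency for the modulus, `ContOnBox13` for (C)).
F-E READING of the size letter (honest): modulo H_FE′ it says `|Ĩ X k (p_0)| ≤ A X · p_0` — linear vanishing in the INITIAL coupling, implied by (2.13) along the self-generated AF run
(`g_k ≤ g_0`): contentful, not absurd, not collapsed (CRIT-2's `faded_blind_witness` is the β-level witness).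

**BN-N «MARGINAL TRANSPORT ≠ GEOMETRIC FADING»** (obstruction-first, this seat g12).  ASSUME the history-side FADING letter at the tree's CURRENT record — U3's pair
`HistLipschitz Λ θ.γ D.βfun ∧ FadingMemory C ρ Λ` (p609637 §3) or this card's own ED.4 offer `FadingLip13 𝓑` ((a1)+(a2), §8).  Modulo H_FE′ the record β is FIRST-ENTRY-ONLY
(`FirstEntryOnly` below: `β k p` depends on `p 0` alone — ADDENDUM-2 §1 «blind to every entry p_j, j ≥ 1»), and then the fading pair forces GEOMETRIC RIGIDITY IN THE INITIAL COUPLING: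
`|β k p − β k q| ≤ C ρ^k |p 0 − q 0| ≤ C ρ^k γ` on the whole box (★ `geomRigid_of_firstEntryOnly_fading`, ★ `oscillation_le_of_firstEntryOnly_fading`, proved, generic β).  But the
first-entry dependence of the tree's object is print's β_{k+1} TRANSPORTED ALONG THE SELF-GENERATED RUN (ADDENDUM-2 §1: over a free history the carried action's main-term coefficient is
`1∕p_0² − Σβ = 1∕g_k²` of the (0.18)-run from `p_0`), and the transport of the MARGINAL coupling has one-step factor `dg_{j+1}∕dg_j = (g_{j+1}∕g_j)³ = (1 + β_{j+1} g_j²)^{−3∕2} → 1`, total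
factor `(g_k∕g_0)³ = (1 + g_0² Σ_{j<k} β_{j+1})^{−3∕2}`: POLYNOMIAL in k at rate g_0², and → 1 in the corner `g_0 → 0` at every fixed k — ★ `marginalTransport_not_geomFading` (proved for the
explicit one-loop factor `1∕(1 + c·k·g_0²)`: NO bound `≤ C ρ^k`, ρ < 1, uniform on `]0, γ₀]`).  So unless print's remainder β¹ is FLAT along runs to geometric order (absurd strength: (2.13)
gives `O(g_k)`; physically `β¹ = 2b₁ g_k² + …`, `b₁ ≠ 0`) the fading pair at the CURRENT record is PRESUMPTIVELY FALSE — ADDENDUM-2 (ii)∕(iv) said «F-E-sensitive in MEANING … still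
contentful, not absurd»; BN-N sharpens: contentful AND presumptively false, because the ONLY history channel that survives F-E, entry 0, is the marginal flow direction, which does not
fade.  CONSEQUENCES drawn on the card (ED.5): (1) `FadingLip13` is WITHDRAWN as an offered obligation at the current record (its theorem `histHalfU3At13_of_fadingLip13` stays a correct
implication); the ADOPTED history-side payment is the RATE-FREE pair `ContOnBox13` ∕ `LipOnBox13` ((a0)∕(a1): continuity ∕ Lipschitz in `p_0` of run-transported activities, [I] Thm 3
p. 264, §5 p. 298 — F-E-contentful and plausible); (2) `FadingOnBox` + the renewal lemma §6·R remain the MECHANISM for print's FREE-history object = the tree's object AFTER an F-E repair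
(def-T ∕ node00-def's call, ADDENDUM-2 §1: re-impose (0.22)'s main term at a free `g_k`), where the entry-j channels, j < k, at FIXED later entries are births out of old-generation terms only
and the marginal F²-part is extracted into β at birth ((0.28)); (3) FYI for U3ᴷ ∕ idea-7 (not my lane): `FadingMemory C ρ Λ` at `D.βfun` BEFORE an F-E repair inherits BN-N.
**CF-REN** (ROUND-4's endorsed next falsifier; READ this session: [I] pp. 257–259 = PDF pp. 9–11 of held `paper:balaban1987-cmp109-rg-i-small-field`).  Print's AGE FACTORS ARE GEOMETRIC
BUT STATIC: (0.29) p. 258 — the generation-j terms obey `|V^{(j)}(X, U_k)| ≤ E₀·O(1)·(L^jη)^{4+α}·e^{−κ d_j(X)}`, α > 0, and (0.30) sums the ages to `O(1)(1 − L^{−α})^{−1}|T^{(k)}_1|`, i.e.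
ratio θ = L^{−α} per unit of age for the SIZE of age-a terms; and print DISCLAIMS the dynamics a renewal heredity would need — p. 259 L4–9: «Terms satisfying the inequality (0.29) are called
irrelevant – a word, borrowed from the renormalization group language – but which should not suggest that these terms are irrelevant operators in that sense. There are no scaling
transformations here, and these terms do not behave in a regular way under the renormalization transformations.»  So (i) the contraction ratio θ = L^{−α} IS printed (static); (ii) the
ONE-STEP FEEDBACK constant C₀ of §6·R's heredity (sensitivity of the step-k births ∕ of β_{k+1}'s Ward extraction (0.28) to an old term, per unit size of that term) is NOT printed and not
claimed; reading (0.19)∕(0.22) pp. 255–256: old terms reach β_{k+1} and the new generation only through the step-k fluctuation integral (covariance ∝ g_k²), so C₀ = O(γ² × field-derivative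
cost of the old terms), and that cost is a Cauchy estimate in the FIELD variables on the small-field analyticity domain ((0.24)–(0.25) p. 257 «analytic and gauge invariant functions of U» —
a polydisc in U, NOT a disc in a coupling, so barrier B-III does not bite); hence `C₀ < 1 − L^{−α}` is PLAUSIBLE in a small window but UNPRINTED (G-t4-U2-2 ∕ E-CRIT2-1 stand).  VERDICT
recorded: (a2) for the free-history object = unprinted-plausible with rate `L^{−α} + O(γ²)`; (a2) at the current record = presumptively false (BN-N).  No verdict of CRIT-2's is touched by
this; it is the idea-side honest placement, offered for ROUND 5. -/

section RunCurrency

variable {β : HBeta} {b : ℕ → ℝ} {γ₀ : ℝ}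

/-- **★ ROWS (i)+(iv)+(C), generic, FROM THE RUN CURRENCY (P-FE paid):** `LinOnRuns R.toRun` (S-LIN along the in-window runs only) + a drift of slope `s > 0` at the SAME `b` + termwise
continuity ⟹ a level `γ₁ ≤ γ₀` with row (i) `RunConstRemainder β b s γ₁`, row (iv) `RunwiseFloor β (2A) γ₁`, row (C) `SurvCont β γ₁`.  Proof = §10's with `runModulus_of_linOnRuns` (§4) in
place of `runModulus_of_boxModulus ∘ boxModulus_of_linOnBox`.  CONDITIONAL on the displayed hypotheses. [folklore] -/
theorem runRows_of_linOnRuns_drift_cont (R : BoxActivityRepr β b γ₀) (hL : LinOnRuns R.toRun) (hγ₀ : 0 < γ₀) {s A : ℝ} (hs : 0 < s)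
    (hd : OneLoopDrift s A b) (hC : ContOnBox R) :
    ∃ γ₁ : ℝ, 0 < γ₁ ∧ γ₁ ≤ γ₀ ∧ RunConstRemainder β b s γ₁ ∧ RunwiseFloor β (2 * A) γ₁ ∧ SurvCont β γ₁ := by
  obtain ⟨γ₁, hγ₁, hle, hrem⟩ := runConstRemainder_of_runModulus (runModulus_of_linOnRuns R.toRun hL) hγ₀ hs
  exact ⟨γ₁, hγ₁, hle, hrem, runwiseFloor_of_drift_runConstRemainder hd hrem, survCont_anti hγ₁ hle (survCont_of_contOnBox R hC hγ₀)⟩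

/-- §10's box-currency rows theorem re-derived as the corollary through `linOnRuns_of_linOnBox` (kept as an implication; no longer a target letter at the record, P-FE). [folklore] -/
theorem runRows_of_linOnBox_drift_cont' (R : BoxActivityRepr β b γ₀) (hL : LinOnBox R) (hγ₀ : 0 < γ₀) {s A : ℝ} (hs : 0 < s)
    (hd : OneLoopDrift s A b) (hC : ContOnBox R) :
    ∃ γ₁ : ℝ, 0 < γ₁ ∧ γ₁ ≤ γ₀ ∧ RunConstRemainder β b s γ₁ ∧ RunwiseFloor β (2 * A) γ₁ ∧ SurvCont β γ₁ :=
  runRows_of_linOnRuns_drift_cont R (linOnRuns_of_linOnBox R hL) hγ₀ hs hd hC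

end RunCurrency

section RunCurrency13

/-- **S-LIN IN RUN CURRENCY AT THE RECORD — THE RE-TYPED SUPPLIER OBLIGATION about a delivered `𝓑 : BoxRecordRepr13` (P-FE):** along every in-window (0.20)-run of the datum of record, every
term obeys `|I X k (g_0,…,g_k)| ≤ A X · g_k` (Sketch2's original `LinOnRuns`, §4).  F-E-SAFE (the last entry of a run prefix IS the running coupling).  The stub a line would register
after D-REPR lands; size L (the per-polymer marked-factor bound of [II] (1.38)–(1.40) p. 10, memo `DESK-CF1-two-bound-idea5g9.md` at |X| = 1). [cite: Balaban1987RG1, (2.13) p.268; Balaban1988RG2Cluster, p.8 and (1.38)–(1.40) p.10] -/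
def LinOnRuns13 (𝓑 : BoxRecordRepr13) : Prop :=
  ∀ (F : T4Family) (θ : Node00.Stage13HParams F 2) (hP : θ.Provisos₁₃SepCoPH F 2)
    (hU : θ.ZhUnity F 2 ∧ θ.SlotsNondegenerate₁₃ F 2) (hθ : θ.Admissible F 2)
    (hB : B16.EndStatementBPrinted (Node00.datumOfRecord₁₃SepCoPH F 2 θ hP).C) (hwin : Window13 F θ hP),
    LinOnRuns (𝓑.repr F θ hP hU hθ hB hwin).toRun

/-- The last-entry letter implies the run letter (so every edition-4 road survives as a corollary). [folklore] -/
theorem linOnRuns13_of_linOnBox13 (𝓑 : BoxRecordRepr13) (hL : LinOnBox13 𝓑) : LinOnRuns13 𝓑 :=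
  fun F θ hP hU hθ hB hwin => linOnRuns_of_linOnBox _ (hL F θ hP hU hθ hB hwin)

/-- **★ THE RUN EDITION PAYS K1⁸'s ROWS AT EVERY TUPLE (proved, conditional on the three obligations about a delivered `𝓑`):** `LinOnRuns13 𝓑` (S-LIN in run currency, THIS CARD), `DriftAtN13 𝓑`
((D1)'s sign at N), `ContOnBox13 𝓑` ((a0)) ⟹ `RunRows13 F θ` with `b := 𝓑.N`, `r := s`, `M := 2A` on a shrunk level `γ₁ ≤ 𝓑.γ₀ ≤ θ.γ`. [folklore] -/
theorem runRows13_of_linOnRuns_drift_cont (𝓑 : BoxRecordRepr13) (hL : LinOnRuns13 𝓑) (hD : DriftAtN13 𝓑) (hC : ContOnBox13 𝓑) :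
    ∀ (F : T4Family) (θ : Node00.Stage13HParams F 2) (hP : θ.Provisos₁₃SepCoPH F 2), (θ.ZhUnity F 2 ∧ θ.SlotsNondegenerate₁₃ F 2) → θ.Admissible F 2 →
      B16.EndStatementBPrinted (Node00.datumOfRecord₁₃SepCoPH F 2 θ hP).C → Window13 F θ hP → RunRows13 F θ := by
  intro F θ hP hU hθ hB hwin
  obtain ⟨s, A, hs, hd⟩ := hD F θ hP hU hθ hB hwin
  obtain ⟨γ₁, hγ₁, -, hrem, hfl, hsc⟩ :=
    runRows_of_linOnRuns_drift_cont (𝓑.repr F θ hP hU hθ hB hwin) (hL F θ hP hU hθ hB hwin) (𝓑.γ₀_pos F θ hP) hs hd (hC F θ hP hU hθ hB hwin)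
  rw [Node00.βfun_datumOfRecord₁₃SepCoPH] at hrem hfl hsc
  exact ⟨𝓑.N F θ hP, s, γ₁, 2 * A, hγ₁, hrem, hfl, hsc⟩

/-- **★⁸ (EDITION 5's CHAIN, P-FE PAID — proved, no sorry): K1⁷ (hypothesis) + `LinOnRuns13 ∧ DriftAtN13 ∧ ContOnBox13` ⟹ K1⁸ `StabilityBRunRowsAtRecordR13SepCoPH` BY NAME.**  K1⁷
`StabilityBAtRecordR13SepCoPH` (stmt-QuantumFields-20542, aside) hands the witness tuple with (B) and the window; `runRows13_of_linOnRuns_drift_cont` hands the rows there.  CONDITIONAL: K1⁷ OPEN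
content, `𝓑` inhabited NOWHERE, the three obligations are obligations; nothing of Bałaban's asserted; K1⁸ NOT closed; Clay NOT proved. [folklore] -/
theorem k1R8_of_k1R7_linOnRuns_drift_cont (𝓑 : BoxRecordRepr13) (hL : LinOnRuns13 𝓑) (hD : DriftAtN13 𝓑) (hC : ContOnBox13 𝓑)
    (hK1 : Summit.QuantumFields.YangMills.Theses.BalabanUVNodes.StabilityBAtRecordR13SepCoPH) :
    Summit.QuantumFields.YangMills.Theses.BalabanUVNodes.StabilityBRunRowsAtRecordR13SepCoPH := by
  intro F hex
  obtain ⟨θ, h, hU, hθ, hB, hwin⟩ := hK1 F hex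
  obtain ⟨b', r, γ₁, M, hγ₁, hrem, hfl, hsc⟩ := runRows13_of_linOnRuns_drift_cont 𝓑 hL hD hC F θ h hU hθ hB hwin
  exact ⟨θ, h, hU, hθ, hB, hwin, b', r, γ₁, M, hγ₁, hrem, hfl, hsc⟩

/-- ★⁷ (edition 4.1) re-derived as the corollary `★⁸ ∘ linOnRuns13_of_linOnBox13` — the last-entry letter is now only an IMPLICATION feeding the run letter, never a target. [folklore] -/
theorem k1R8_of_k1R7_linOnBox_drift_cont' (𝓑 : BoxRecordRepr13) (hL : LinOnBox13 𝓑) (hD : DriftAtN13 𝓑) (hC : ContOnBox13 𝓑)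
    (hK1 : Summit.QuantumFields.YangMills.Theses.BalabanUVNodes.StabilityBAtRecordR13SepCoPH) :
    Summit.QuantumFields.YangMills.Theses.BalabanUVNodes.StabilityBRunRowsAtRecordR13SepCoPH :=
  k1R8_of_k1R7_linOnRuns_drift_cont 𝓑 (linOnRuns13_of_linOnBox13 𝓑 hL) hD hC hK1

/-- **★ an4's WEAK CURRENCY AT EVERY TUPLE from the run edition** (the hypothesis `h` of the landed `…K2RunRowsContOfCorner.rowsContAllK_of_ownDrift_runConstRemainderK`): `b := 𝓑.N`, `r := s`, (C)
from `ContOnBox13`.  CONDITIONAL on the three obligations. [folklore] -/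
theorem weakCurrencyK_of_linOnRuns_drift_cont (𝓑 : BoxRecordRepr13) (hL : LinOnRuns13 𝓑) (hD : DriftAtN13 𝓑) (hC : ContOnBox13 𝓑) :
    ∀ (F : T4Family) (θ : Node00.Stage13HParams F 2) (hP : θ.Provisos₁₃SepCoPH F 2),
      (θ.ZhUnity F 2 ∧ θ.SlotsNondegenerate₁₃ F 2) → θ.Admissible F 2 →
      B16.EndStatementBPrinted (Node00.datumOfRecord₁₃SepCoPH F 2 θ hP).C →
      (∃ γ₁ : ℝ, 0 < γ₁ ∧ ∀ γ : ℝ, 0 < γ → γ ≤ γ₁ →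
        ∃ P : B12.RunParams, 1 ≤ P.K ∧ ((Node00.datumOfRecord₁₃SepCoPH F 2 θ hP).C P).flow.InInterval γ P.K) →
      ∃ (b : ℕ → ℝ) (s A γ₀ r : ℝ), OneLoopDrift s A b ∧ 0 < γ₀ ∧ r ≤ s ∧
        RunConstRemainder (Node00.datumOfRecord₁₃SepCoPH F 2 θ hP).βfun b r γ₀ ∧
        SurvCont (Node00.datumOfRecord₁₃SepCoPH F 2 θ hP).βfun γ₀ := by
  intro F θ hP hU hθ hB hwin
  obtain ⟨s, A, hs, hd⟩ := hD F θ hP hU hθ hB hwin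
  obtain ⟨γ₁, hγ₁, -, hrem, -, hsc⟩ :=
    runRows_of_linOnRuns_drift_cont (𝓑.repr F θ hP hU hθ hB hwin) (hL F θ hP hU hθ hB hwin) (𝓑.γ₀_pos F θ hP) hs hd (hC F θ hP hU hθ hB hwin)
  exact ⟨𝓑.N F θ hP, s, A, γ₁, s, hd, hγ₁, le_rfl, hrem, hsc⟩

/-- **★⁸ᵀ THROUGH an4's LANDED BRIDGE** (`rowsContAllK_of_ownDrift_runConstRemainderK`, p616839): K1⁸ BY NAME. Same conditional status as ★⁸. [folklore] -/
theorem k1R8_of_k1R7_linOnRuns_viaTreeBridge (𝓑 : BoxRecordRepr13) (hL : LinOnRuns13 𝓑) (hD : DriftAtN13 𝓑) (hC : ContOnBox13 𝓑)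
    (hK1 : Summit.QuantumFields.YangMills.Theses.BalabanUVNodes.StabilityBAtRecordR13SepCoPH) :
    Summit.QuantumFields.YangMills.Theses.BalabanUVNodes.StabilityBRunRowsAtRecordR13SepCoPH := by
  intro F hex
  obtain ⟨θ, h, hU, hθ, hB, hwin⟩ := hK1 F hex
  exact ⟨θ, h, hU, hθ, hB, hwin,
    Summit.QuantumFields.YangMills.Theorems.BalabanUVNodesK2RunRowsContOfCorner.rowsContAllK_of_ownDrift_runConstRemainderK
      (weakCurrencyK_of_linOnRuns_drift_cont 𝓑 hL hD hC) F θ h hU hθ hB hwin⟩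

/-- **DEF-1 DEDUP (INTENT-9 LANDED, p616926): `RunRows13 F θ` ≡ DEF-1's `RunRowsCont13 F θ`** — this sketch's §10 rows conjunct and the tree name for K1⁸'s last conjunct have the same body
(`RunwiseFloor` unfolds to the inlined floor), `Iff.rfl`. [folklore] -/
theorem runRows13_iff_runRowsCont13 (F : T4Family) (θ : Node00.Stage13HParams F 2) :
    RunRows13 F θ ↔ Summit.QuantumFields.YangMills.Theorems.BalabanUVNodesK1R8RowsDefs.RunRowsCont13 F θ :=
  Iff.rfl

/-- **★ THE RUN EDITION SUPPLIES DEF-1's ∀θ PROGRAMME `RowsContAll` (proved, conditional):** so the road lands wherever the tree routes that programme (K2⁷ aside decl, K1⁸ with K1⁷).  The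
programme's `Window (datum)` (K1V6Defs) and this sketch's `Window13 F θ hP` (K2V6Defs) have the same body. [folklore] -/
theorem rowsContAll_of_linOnRuns_drift_cont (𝓑 : BoxRecordRepr13) (hL : LinOnRuns13 𝓑) (hD : DriftAtN13 𝓑) (hC : ContOnBox13 𝓑) :
    Summit.QuantumFields.YangMills.Theorems.BalabanUVNodesK1R8RowsDefs.RowsContAll :=
  fun F θ hP hU hθ hB hwin => (runRows13_iff_runRowsCont13 F θ).1 (runRows13_of_linOnRuns_drift_cont 𝓑 hL hD hC F θ hP hU hθ hB hwin)

/-- **★⁸ᴰ K1⁸ BY NAME THROUGH DEF-1's BRIDGE** `stabilityBRunRowsAtRecordR13SepCoPH_of_k17_rowsContAll` (third by-name landing of the same road). CONDITIONAL; K1⁸ NOT closed. [folklore] -/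
theorem k1R8_of_k1R7_linOnRuns_viaDef1 (𝓑 : BoxRecordRepr13) (hL : LinOnRuns13 𝓑) (hD : DriftAtN13 𝓑) (hC : ContOnBox13 𝓑)
    (hK1 : Summit.QuantumFields.YangMills.Theses.BalabanUVNodes.StabilityBAtRecordR13SepCoPH) :
    Summit.QuantumFields.YangMills.Theses.BalabanUVNodes.StabilityBRunRowsAtRecordR13SepCoPH :=
  Summit.QuantumFields.YangMills.Theorems.BalabanUVNodesK1R8RowsDefs.stabilityBRunRowsAtRecordR13SepCoPH_of_k17_rowsContAll hK1
    (rowsContAll_of_linOnRuns_drift_cont 𝓑 hL hD hC)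

/-- **★⁸ᴱ THE ASIDE DECL K2⁷ `EndpointGivenBR13SepCoPH` (stmt-QuantumFields-20543, this workfile's key) BY NAME from the run edition WITHOUT any anchor or corner pair** — through DEF-1's
`endpointGivenBR13SepCoPH_of_rowsContAll` (rows ⟹ END is the tree's, K2⁸).  CONDITIONAL on the three obligations; K2⁷ NOT closed. [cite: Balaban1987RG1, Thm 2 p.259 (first sentence), Thm 3 p.264 and (2.13) p.268] -/
theorem EndpointGivenBR13SepCoPH_of_linOnRuns_drift_cont (𝓑 : BoxRecordRepr13) (hL : LinOnRuns13 𝓑) (hD : DriftAtN13 𝓑) (hC : ContOnBox13 𝓑) :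
    Summit.QuantumFields.YangMills.Theses.BalabanUVNodes.EndpointGivenBR13SepCoPH :=
  Summit.QuantumFields.YangMills.Theorems.BalabanUVNodesK1R8RowsDefs.endpointGivenBR13SepCoPH_of_rowsContAll (rowsContAll_of_linOnRuns_drift_cont 𝓑 hL hD hC)

end RunCurrency13

section SizeCurrency

variable {β : HBeta} {b : ℕ → ℝ} {γ₀ : ℝ}

/-- **S-LIN IN BOX-SIZE CURRENCY `SizeLinOnBox R`** (anchor-side obligation shape about a given representation; ADDENDUM-2 (iii)): `|I X k p| ≤ A X · t` for every `p ∈ HistBox γ₀ k` and EVERY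
common bound `t` of its entries (equivalently `≤ A X · max_i p_i`) — the SIZE of the history, not its last entry; `A X` k- and history-free, NO decay, NO summability.  F-E-SAFE and contentful
(modulo H_FE′: `|Ĩ X k(p_0)| ≤ A X · p_0`, print's (2.13) along the AF run since `g_k ≤ g_0`). [cite: Balaban1987RG1, (2.13) p.268] -/
def SizeLinOnBox (R : BoxActivityRepr β b γ₀) : Prop :=
  ∃ A : LocDomainZ4 → ℝ, (∀ X, 0 ≤ A X) ∧
    ∀ (k : ℕ) (p : Fin (k + 1) → ℝ), p ∈ HistBox γ₀ k → ∀ t : ℝ, (∀ i, p i ≤ t) → ∀ X, |R.I X k p| ≤ A X * t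

/-- The last-entry letter implies the size letter (`p (Fin.last k) ≤ t`). [folklore] -/
theorem sizeLinOnBox_of_linOnBox (R : BoxActivityRepr β b γ₀) (h : LinOnBox R) : SizeLinOnBox R := by
  obtain ⟨A, hA, hlin⟩ := h
  exact ⟨A, hA, fun k p hp t ht X => (hlin k p hp X).trans (mul_le_mul_of_nonneg_left (ht _) (hA X))⟩

/-- **`BoxSizeModulus β b γ₀` — the modulus letter in box-SIZE currency:** `|β k p − b k| ≤ ω t` for every box point with entries `≤ t`, `ω → 0` at `0⁺` (= CRIT-1's replacement «`ScaleAnchor`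
with a k-uniform rate»). HYPOTHESIS SHAPE. [cite: Balaban1987RG1, (2.13)–(2.14) p.268] -/
def BoxSizeModulus (β : HBeta) (b : ℕ → ℝ) (γ₀ : ℝ) : Prop :=
  ∃ ω : ℝ → ℝ, Tendsto ω (𝓝[>] 0) (𝓝 0) ∧
    ∀ (k : ℕ) (p : Fin (k + 1) → ℝ), p ∈ HistBox γ₀ k → ∀ t : ℝ, (∀ i, p i ≤ t) → |β k p - b k| ≤ ω t

/-- **SIZE-LIN ⟹ BOX-SIZE MODULUS (proved, Tannery; the engine's third use)**, `ω := omegaMin A M`. [folklore] -/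
theorem boxSizeModulus_of_sizeLinOnBox (R : BoxActivityRepr β b γ₀) (h : SizeLinOnBox R) : BoxSizeModulus β b γ₀ := by
  obtain ⟨A, hA, hlin⟩ := h
  refine ⟨omegaMin A R.M, tendsto_omegaMin hA R.M_nonneg R.M_summable, ?_⟩
  intro k p hp t ht
  rw [← (R.hasSum_box k p hp).tsum_eq]
  exact abs_tsum_le_omegaMin R.M_summable (fun X => R.frozen_box k p hp X) (fun X => hlin k p hp t ht X)

/-- **BOX-SIZE MODULUS ⟹ THE CORNER LIMIT (proved):** `ScaleAnchor β b` — for `δ > 0` the box of side `min γ₀ (u∕2)` where `ω < δ` on `]0, u[`, with `t :=` the side. [folklore] -/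
theorem scaleAnchor_of_boxSizeModulus (h : BoxSizeModulus β b γ₀) (hγ₀ : 0 < γ₀) : ScaleAnchor β b := by
  obtain ⟨ω, hω, hbox⟩ := h
  intro k δ hδ
  have hev : ∀ᶠ g in 𝓝[>] (0 : ℝ), ω g < δ := (tendsto_order.1 hω).2 δ hδ
  obtain ⟨u, hu, hsub⟩ := mem_nhdsGT_iff_exists_Ioo_subset.1 hev
  have hu0 : (0 : ℝ) < u := hu
  refine ⟨min γ₀ (u / 2), lt_min hγ₀ (half_pos hu0), fun p hp => ?_⟩
  have hp₀ : p ∈ HistBox γ₀ k := fun i => ⟨(hp i).1, (hp i).2.trans (min_le_left _ _)⟩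
  have hmem : min γ₀ (u / 2) ∈ Set.Ioo 0 u :=
    ⟨lt_min hγ₀ (half_pos hu0), lt_of_le_of_lt (min_le_right _ _) (half_lt_self hu0)⟩
  exact (hbox k p hp₀ (min γ₀ (u / 2)) (fun i => (hp i).2)).trans (hsub hmem).le

/-- ★ SIZE-LIN ⟹ `ScaleAnchor β b` for the representation's own `b` (the existence conjunct of 2ᶜᴰ in F-E-safe currency). [folklore] -/
theorem scaleAnchor_of_sizeLinOnBox (R : BoxActivityRepr β b γ₀) (h : SizeLinOnBox R) (hγ₀ : 0 < γ₀) : ScaleAnchor β b :=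
  scaleAnchor_of_boxSizeModulus (boxSizeModulus_of_sizeLinOnBox R h) hγ₀

/-- **FADED termwise linear bound `FadedLinOnBox R Λ`** (= CRIT-2's `Crit2FadedCurrency.FadedBoxRemainder`, termwise): `|I X k p| ≤ Σ_i Λ X k i · p_i` with `Λ ≥ 0` — every coupling of the
history may carry part of the vanishing, weighted by age. HYPOTHESIS SHAPE about a representation. [cite: Balaban1987RG1, (2.13) p.268 and §5 p.298] -/
def FadedLinOnBox (R : BoxActivityRepr β b γ₀) (Λ : LocDomainZ4 → ℕ → ℕ → ℝ) : Prop :=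
  (∀ X k i, 0 ≤ Λ X k i) ∧ ∀ (k : ℕ) (p : Fin (k + 1) → ℝ), p ∈ HistBox γ₀ k → ∀ X, |R.I X k p| ≤ ∑ i : Fin (k + 1), Λ X k i * p i

/-- **FADED with bounded per-polymer mass ⟹ SIZE-LIN (proved)**: `Σ_i Λ X k i ≤ Ā X` for all k ⟹ `SizeLinOnBox R` with `A := Ā` (geometric age-weights `Λ X k i = a X · ρ^{k−i}` have mass
`≤ a X ∕ (1 − ρ)`). [folklore] -/
theorem sizeLinOnBox_of_fadedLin (R : BoxActivityRepr β b γ₀) {Λ : LocDomainZ4 → ℕ → ℕ → ℝ} (h : FadedLinOnBox R Λ)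
    {Abar : LocDomainZ4 → ℝ} (hmass : ∀ X k, ∑ i : Fin (k + 1), Λ X k i ≤ Abar X) : SizeLinOnBox R := by
  refine ⟨Abar, fun X => ?_, fun k p hp t ht X => ?_⟩
  · have h0 : (0 : ℝ) ≤ ∑ i : Fin (0 + 1), Λ X 0 i := Finset.sum_nonneg fun i _ => h.1 X 0 i
    exact h0.trans (hmass X 0)
  have ht0 : 0 ≤ t := (hp 0).1.le.trans (ht 0)
  calc |R.I X k p| ≤ ∑ i : Fin (k + 1), Λ X k i * p i := h.2 k p hp X
    _ ≤ ∑ i : Fin (k + 1), Λ X k i * t := Finset.sum_le_sum fun i _ => mul_le_mul_of_nonneg_left (ht i) (h.1 X k i)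
    _ = (∑ i : Fin (k + 1), Λ X k i) * t := by rw [Finset.sum_mul]
    _ ≤ Abar X * t := mul_le_mul_of_nonneg_right (hmass X k) ht0

end SizeCurrency

section SizeCurrency13

/-- S-LIN in box-SIZE currency at the record (anchor-side obligation about a delivered `𝓑`; F-E-safe). [cite: Balaban1987RG1, (2.13) p.268] -/
def SizeLinOnBox13 (𝓑 : BoxRecordRepr13) : Prop :=
  ∀ (F : T4Family) (θ : Node00.Stage13HParams F 2) (hP : θ.Provisos₁₃SepCoPH F 2)
    (hU : θ.ZhUnity F 2 ∧ θ.SlotsNondegenerate₁₃ F 2) (hθ : θ.Admissible F 2)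
    (hB : B16.EndStatementBPrinted (Node00.datumOfRecord₁₃SepCoPH F 2 θ hP).C) (hwin : Window13 F θ hP),
    SizeLinOnBox (𝓑.repr F θ hP hU hθ hB hwin)

theorem sizeLinOnBox13_of_linOnBox13 (𝓑 : BoxRecordRepr13) (hL : LinOnBox13 𝓑) : SizeLinOnBox13 𝓑 :=
  fun F θ hP hU hθ hB hwin => sizeLinOnBox_of_linOnBox _ (hL F θ hP hU hθ hB hwin)

/-- **★ 2ᶜᴰ `CornerDriftPos13` (= the REGISTERED v7c stub `stub_cornerDriftPos13`'s text) from SIZE-LIN + the drift sign (proved):** existence of the corner limit from the lever in F-E-safe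
currency, the sign from (D1). CONDITIONAL on the two obligations; nothing registered is closed by this (𝓑 inhabited nowhere). [folklore] -/
theorem cornerDriftPos13_of_sizeLin_drift (𝓑 : BoxRecordRepr13) (hS : SizeLinOnBox13 𝓑) (hD : DriftAtN13 𝓑) : CornerDriftPos13 := by
  intro F θ hP hU hθ hB hwin
  obtain ⟨s, A, hs, hd⟩ := hD F θ hP hU hθ hB hwin
  exact ⟨𝓑.N F θ hP, s, A, scaleAnchor_of_sizeLinOnBox (𝓑.repr F θ hP hU hθ hB hwin) (hS F θ hP hU hθ hB hwin) (𝓑.γ₀_pos F θ hP), hs, hd⟩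

/-- **★ 1ᶜᴹ′ `RunModulusAtCorner13` from SIZE-LIN (identifies the anchored `b` with `𝓑.N`, `ScaleAnchor.eq`) + RUN-LIN (the modulus, Tannery on runs) + (a0) (proved).** [folklore] -/
theorem runModulusAtCorner13_of_sizeLin_linOnRuns_cont (𝓑 : BoxRecordRepr13) (hS : SizeLinOnBox13 𝓑) (hL : LinOnRuns13 𝓑) (hC : ContOnBox13 𝓑) :
    RunModulusAtCorner13 := by
  intro F θ hP hU hθ hB hwin b hanch
  have hbN : b = 𝓑.N F θ hP :=
    hanch.eq (scaleAnchor_of_sizeLinOnBox (𝓑.repr F θ hP hU hθ hB hwin) (hS F θ hP hU hθ hB hwin) (𝓑.γ₀_pos F θ hP))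
  subst hbN
  exact ⟨𝓑.γ₀ F θ hP, 𝓑.γ₀_pos F θ hP, 𝓑.γ₀_le F θ hP,
    runModulus_of_linOnRuns (𝓑.repr F θ hP hU hθ hB hwin).toRun (hL F θ hP hU hθ hB hwin),
    survCont_of_contOnBox (𝓑.repr F θ hP hU hθ hB hwin) (hC F θ hP hU hθ hB hwin) (𝓑.γ₀_pos F θ hP)⟩

/-- **★⁹ THE ASIDE DECL K2⁷ BY THE CORNER ROAD IN F-E-SAFE CURRENCIES (proved, no sorry):** `SizeLinOnBox13` (anchor) ∧ `LinOnRuns13` (modulus) ∧ `DriftAtN13` ((D1)'s sign) ∧ `ContOnBox13`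
((C)) ⟹ `EndpointGivenBR13SepCoPH` through the REGISTERED pair's road ★★ of §2.  CONDITIONAL; `𝓑` inhabited nowhere; K2⁷ NOT closed; Clay NOT proved. [cite: Balaban1987RG1, Thm 2 p.259 (first sentence) and (2.13) p.268; Balaban1988RG2Cluster, Lemma 3 (2.38) p.20] -/
theorem EndpointGivenBR13SepCoPH_of_sizeLin_linOnRuns_drift_cont (𝓑 : BoxRecordRepr13) (hS : SizeLinOnBox13 𝓑) (hL : LinOnRuns13 𝓑) (hD : DriftAtN13 𝓑)
    (hC : ContOnBox13 𝓑) : Summit.QuantumFields.YangMills.Theses.BalabanUVNodes.EndpointGivenBR13SepCoPH :=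
  EndpointGivenBR13SepCoPH_of_cornerDrift_runModulusAtCorner (cornerDriftPos13_of_sizeLin_drift 𝓑 hS hD)
    (runModulusAtCorner13_of_sizeLin_linOnRuns_cont 𝓑 hS hL hC)

end SizeCurrency13

/-! ### §11·N BN-N «MARGINAL TRANSPORT ≠ GEOMETRIC FADING» — the kernel part (generic β; a toy factor, not Bałaban's β) -/

section MarginalTransport

variable {β : HBeta} {γ₀ : ℝ}

/-- **FIRST-ENTRY-ONLY shape** — what H_FE′ would make of the tree's free-history β (ADDENDUM-2 §1: blind to every entry j ≥ 1): on each box, `β k p` depends on `p 0` alone.  Never asserted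
of a record. [folklore] -/
def FirstEntryOnly (β : HBeta) (γ₀ : ℝ) : Prop :=
  ∀ (k : ℕ) (p q : Fin (k + 1) → ℝ), p ∈ HistBox γ₀ k → q ∈ HistBox γ₀ k → p 0 = q 0 → β k p = β k q

/-- **★ FIRST-ENTRY-ONLY + U3's FADING PAIR ⟹ GEOMETRIC RIGIDITY IN THE INITIAL COUPLING (proved):** `|β k p − β k q| ≤ C ρ^k |p 0 − q 0|` for all box points.  Proof: slide q's entries
j ≥ 1 onto p's (blindness), then only the i = 0 modulus `Λ k 0 ≤ C ρ^k` survives in `HistLipschitz`. [folklore] -/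
theorem geomRigid_of_firstEntryOnly_fading (hB : FirstEntryOnly β γ₀) {Λ : ℕ → ℕ → ℝ} {C ρ : ℝ}
    (hH : HistLipschitz Λ γ₀ β) (hF : FadingMemory C ρ Λ) :
    ∀ (k : ℕ) (p q : Fin (k + 1) → ℝ), p ∈ HistBox γ₀ k → q ∈ HistBox γ₀ k → |β k p - β k q| ≤ C * ρ ^ k * |p 0 - q 0| := by
  intro k p q hp hq
  set q' : Fin (k + 1) → ℝ := Function.update p 0 (q 0) with hq'
  have hq'mem : q' ∈ HistBox γ₀ k := by
    intro i
    by_cases hi : i = 0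
    · subst hi; simp [hq', (hq 0).1, (hq 0).2]
    · simp [hq', Function.update_of_ne hi, (hp i).1, (hp i).2]
  have hqq' : β k q = β k q' := hB k q q' hq hq'mem (by simp [hq'])
  rw [hqq']
  have hpB : p ∈ Box γ₀ k := by rw [← histBox_eq_box]; exact hp
  have hqB : q' ∈ Box γ₀ k := by rw [← histBox_eq_box]; exact hq'mem
  refine (hH k p q' hpB hqB).trans ?_
  have hterm : ∀ i ∈ (Finset.univ : Finset (Fin (k + 1))), i ≠ 0 → Λ k i * |p i - q' i| = 0 := by
    intro i _ hi
    simp [hq', Function.update_of_ne hi]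
  rw [Finset.sum_eq_single (0 : Fin (k + 1)) hterm (by simp)]
  have h0 : q' 0 = q 0 := by simp [hq']
  rw [h0]
  have hΛ0 : Λ k ((0 : Fin (k + 1)) : ℕ) ≤ C * ρ ^ k := by
    have h := (hF k 0 (Nat.zero_le k)).2
    simpa using h
  exact mul_le_mul_of_nonneg_right hΛ0 (abs_nonneg _)

/-- **★ … hence the OSCILLATION of `β k` in the initial coupling over the whole box dies geometrically:** `|β k p − β k q| ≤ C ρ^k · γ₀`. For the tree's object modulo H_FE′ (print's β_{k+1}
transported along the self-generated run) this oscillation is ≍ the size of print's remainder β¹ at `g_k(γ₀) ≍ (γ₀⁻² + b₀k)^{−1∕2}` — POLYNOMIAL in k — so the fading pair at the CURRENT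
record is presumptively false (BN-N). [folklore] -/
theorem oscillation_le_of_firstEntryOnly_fading (hB : FirstEntryOnly β γ₀) {Λ : ℕ → ℕ → ℝ} {C ρ : ℝ} (hC : 0 ≤ C) (hρ : 0 ≤ ρ)
    (hH : HistLipschitz Λ γ₀ β) (hF : FadingMemory C ρ Λ) :
    ∀ (k : ℕ) (p q : Fin (k + 1) → ℝ), p ∈ HistBox γ₀ k → q ∈ HistBox γ₀ k → |β k p - β k q| ≤ C * ρ ^ k * γ₀ := by
  intro k p q hp hq
  have hpq : |p 0 - q 0| ≤ γ₀ := by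
    rw [abs_sub_le_iff]
    constructor <;> linarith [(hp 0).1, (hp 0).2, (hq 0).1, (hq 0).2]
  exact (geomRigid_of_firstEntryOnly_fading hB hH hF k p q hp hq).trans
    (mul_le_mul_of_nonneg_left hpq (mul_nonneg hC (pow_nonneg hρ k)))

/-- **★ THE ONE-LOOP TRANSPORT FACTOR HAS NO GEOMETRIC BOUND ON THE BOX (proved; toy factor, not Bałaban's β).**  For the explicit AF run `1∕g_k² = 1∕g_0² + c·k` (c ≥ 0) one has
`(g_k∕g_0)² = 1∕(1 + c·k·g_0²)` and `dg_k∕dg_0 = (g_k∕g_0)³` — the sensitivity of the running coupling to the INITIAL coupling, i.e. the factor by which any entry-0 history modulus of a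
run-transported quantity is weighted.  This factor admits NO bound `≤ C ρ^k`, `0 ≤ ρ < 1`, uniformly in `g_0 ∈ ]0, γ₀]`: at `g_0 ≤ 1∕(ck+1)` it exceeds ½ while `Cρ^k → 0`.  The marginal
direction does not fade. [folklore] -/
theorem marginalTransport_not_geomFading {c γ₀ : ℝ} (hc : 0 ≤ c) (hγ₀ : 0 < γ₀) :
    ¬ ∃ C ρ : ℝ, 0 ≤ ρ ∧ ρ < 1 ∧ ∀ (k : ℕ) (g₀ : ℝ), 0 < g₀ → g₀ ≤ γ₀ → 1 / (1 + c * k * g₀ ^ 2) ≤ C * ρ ^ k := by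
  rintro ⟨C, ρ, hρ0, hρ1, h⟩
  have ht : Tendsto (fun k : ℕ => C * ρ ^ k) atTop (𝓝 (C * 0)) :=
    (tendsto_pow_atTop_nhds_zero_of_lt_one hρ0 hρ1).const_mul C
  rw [mul_zero] at ht
  obtain ⟨k, hk⟩ : ∃ k : ℕ, C * ρ ^ k < 1 / 2 :=
    (ht.eventually (gt_mem_nhds (by norm_num : (0 : ℝ) < 1 / 2))).exists
  have hk0 : (0 : ℝ) ≤ k := k.cast_nonneg
  have hck : 0 ≤ c * k := mul_nonneg hc hk0
  have hpos : 0 < c * k + 1 := by linarith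
  set g₀ : ℝ := min γ₀ (1 / (c * k + 1)) with hg₀
  have hg₀pos : 0 < g₀ := lt_min hγ₀ (one_div_pos.2 hpos)
  have hg₀le : g₀ ≤ γ₀ := min_le_left _ _
  have hg₀le' : g₀ ≤ 1 / (c * k + 1) := min_le_right _ _
  have hle1 : 1 / (c * k + 1) ≤ 1 := by
    rw [div_le_one hpos]; linarith
  have hg1 : g₀ ≤ 1 := hg₀le'.trans hle1
  have hsq : g₀ ^ 2 ≤ 1 / (c * k + 1) := by
    have h2 : g₀ ^ 2 ≤ g₀ := by nlinarith
    exact h2.trans hg₀le'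
  have hckg : c * k * g₀ ^ 2 < 1 := by
    have h1 : c * k * g₀ ^ 2 ≤ c * k * (1 / (c * k + 1)) := mul_le_mul_of_nonneg_left hsq hck
    have h2 : c * k * (1 / (c * k + 1)) < 1 := by
      rw [mul_one_div, div_lt_one hpos]; linarith
    linarith
  have hdenpos : 0 < 1 + c * k * g₀ ^ 2 := by nlinarith [sq_nonneg g₀]
  have hbig : 1 / 2 < 1 / (1 + c * k * g₀ ^ 2) := by
    rw [one_div_lt_one_div (by norm_num : (0 : ℝ) < 2) hdenpos]
    linarith
  linarith [h k g₀ hg₀pos hg₀le]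

/-- … while for each FIXED `g_0 > 0` (c > 0) the factor does tend to 0 — polynomially, at the rate set by `g_0²`: the memory of the initial coupling along an AF trajectory is long but
not infinite (bookkeeping: `1∕(1 + c k g_0²) ≤ 1∕(c g_0²) · 1∕k` for `k ≥ 1`). [folklore] -/
theorem marginalTransport_le_inv {c g₀ : ℝ} (hc : 0 < c) (hg : 0 < g₀) {k : ℕ} (hk : 1 ≤ k) :
    1 / (1 + c * k * g₀ ^ 2) ≤ 1 / (c * g₀ ^ 2) * (1 / k) := by
  have hk' : (0 : ℝ) < k := by exact_mod_cast hk
  have hcg : 0 < c * g₀ ^ 2 := by positivity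
  have hden : 0 < 1 + c * k * g₀ ^ 2 := by
    have := mul_nonneg (mul_nonneg hc.le hk'.le) (sq_nonneg g₀); linarith
  rw [one_div_mul_one_div_rev, one_div_le_one_div hden (mul_pos hk' hcg)]
  have : (k : ℝ) * (c * g₀ ^ 2) = c * k * g₀ ^ 2 := by ring
  linarith

end MarginalTransport


/-! ## §12 EDITION 6 (g13) — **BN-O «THE DECIDING CRUX READS β ONLY ALONG ITS OWN RUNS»**: the supplier object RUN-TYPED (print's own induction, no free histories), (C) paid ALONG RUNS,
★¹⁰ the run-only road to K1⁸ BY NAME; h5′ PASS (desk memo); S-1 paid; R-BM's kernel shadow.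

**h5′** (the card's cheapest open desk; CRIT-2 ROUND 5 l.18 «endorsed next»): PASSES — memo `DESK-H5P-two-bound-idea5g13.md` (crux write 13866c0cce49): the interpolation parameter of
[II] (2.1) p. 12 is ONE `t(Y)` PER POLYMER, print's own complexification is per polymer ((2.14) p. 15; p. 16 L17 «after multiplication by |τ(Y)|»; one factor per Y in (2.26)∕(2.28)
pp. 17–18), a |D| = 2 term is `∫dt₁dt₂∫dμ χ V_k(Y₁)V_k(Y₂)e^{t₁V₁+t₂V₂}` with BOTH marked factors downstairs, O(g_k) each; inter-polymer coupling lives in the Gaussian∕χ∕σ-operators only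
((2.19)–(2.20), p. 13 L4–12, (2.22)).  `LinOnRuns`'s SHAPE (per polymer, k-free `A X`, no |X|-threshold) is confirmed at the first multi-polymer block.

**BN-O** (this seat's obstruction-first output of g13).  ASSUME the BOX-uniform letters die at the current record — i.e. the CF-BOX kill shape of ED.5 materialises (some old-generation
family whose g_0-dependence over FREE small-field histories is not uniformly continuous), or simply that def-T's free-history extension of the record β (gauge-fixing prefactor at a
free `p_j`, ADDENDUM-2 §1) is as irregular off the runs as it likes.  WHAT SURVIVES: everything the deciding crux K1⁸ `StabilityBRunRowsAtRecordR13SepCoPH` (stmt-QuantumFields-26907)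
ever reads.  Its rows conjunct quantifies β_θ ONLY along (0.20)-runs: row (i) and row (iv) under `FlowStep.RGEqH n β_θ gs → Step.InInterval γ₀ n gs`, row (C) along
`FlowStep.clampPrefix β_θ γ₀ k x` at SURVIVORS `x` — and a survivor's clamped prefix IS an in-window (0.20)-run (tree `…K2NamedJetsRunRemAt.run_of_survivor`; `prefixOf (ĝ∘Y) k =
clampPrefix β γ₀ k x` by `rfl`).  So NO value of β_θ at a free (non-self-generated) history is consumed by the deciding crux, and the supplier object D-REPR can be typed where PRINT
constructs it: [I]'s expansion of β_{k+1} exists along print's OWN inductive run ((0.18)–(0.25) pp. 255–257 are hypotheses maintained step by step for the effective actions the run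
generates; (1.3)–(1.4) p. 260), never for a free coupling history.  EDITION 6 therefore RE-TYPES THE DEBT (P1): from the BOX object `BoxRecordRepr13` (ED.3–5: `hasSum_box`∕`frozen_box`
for EVERY `p ∈ HistBox γ₀ k` — a representation of an object print never expands off-run, and the source of every F-E∕H_FE′ exposure of this card) to the RUN object `RunRecordRepr13`
(`repr … : ActivityRepr D.βfun N γ₀` = Sketch2's ORIGINAL run interface §4: `hasSum_run`∕`frozen_run` along in-window runs only), with the three obligations in run currency:
`LinOnRuns13R` (S-LIN, THIS CARD — unchanged text `LinOnRuns`), `DriftAtN13R` ((D1)'s sign at N), and the NEW run-typed history payment `ContAlongRuns13R` := every activity, read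
along the clamped self-generated run as a function of the bare coupling, is continuous on the survivor sets (`ContAlongRuns`).  ★ `survCont_of_contAlongRuns` ((C) by the M-test along
runs — frozen majorants via `run_of_survivor`), ★ `runRows_of_runOnly` (rows (i)+(iv)+(C) on a shrunk level, §10's proof with the run engine), ★¹⁰ `k1R8_of_k1R7_runOnly (𝓡 :
RunRecordRepr13) : LinOnRuns13R 𝓡 → DriftAtN13R 𝓡 → ContAlongRuns13R 𝓡 → K1⁷ → K1⁸` BY NAME, ★¹⁰ᵀ through an4's landed bridge, ★¹⁰ᴰ through DEF-1's bridge, ★¹⁰ᴱ the aside K2⁷ decl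
— and ★ `RunRecordRepr13.ofBox` + `contAlongRuns_of_contOnBox` show ED.5's ★⁸ = ★¹⁰ ∘ `ofBox` (the box edition survives as the STRONGER supplier; nothing of ED.5 is withdrawn).
WHAT THE RE-TYPING BUYS (honest): (P1) shrinks from «represent def-T's free-history β on all small boxes, termwise, with box-uniform continuity» to «represent print's β_{k+1} along
print's own small-field runs, termwise, with continuity in the bare coupling along the clamped run» — the latter is [I] Thm 3 p. 264 + §5 p. 298 («the limit exists») read per polymer
ALONG THE RUN, where (0.22)–(0.25) hold by print's induction; the F-E model dependence (H_FE′) drops out of the deciding road entirely (along a run the history is self-generated in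
BOTH worlds).  WHAT IT DOES NOT BUY: the box∕corner∕anchor side (2ᶜᴰ, `SizeLinOnBox13`, ★⁹) still needs box values near the corner — it stays in ED.5's currencies and stays OPTIONAL
after rev 27; `ContAlongRuns13R` is weaker than `ContOnBox13` but is still a located assumption (continuity of each polymer activity in g_0 THROUGH the run map g_0 ↦ (g_0,…,g_k), i.e.
joint continuity of print's step-k activities in the couplings of the run — [I] p. 298 asserts existence of the dependence, continuity per polymer is this card's reading, UNPRINTED
as a modulus); `𝓡` is inhabited NOWHERE.

**S-1** (CRIT-2 ROUND 5 (4), optional sharpening of BN-N's toy — PAID): the honest first-entry modulus of `β^{pr}∘g_k^{run}` carries the prefactor `dβ^{pr}∕dg ≍ g_k`, so the weight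
is `g_0·(transport)² ≍ g_0∕(1 + c k g_0²)²`; ★ `firstEntryLip_le_inv_sqrt`: `g∕(1 + a g²)² ≤ 1∕(2√a)` (a > 0; AM–GM) — so `sup_{g_0} ≍ (ck)^{−1∕2}`, POLYNOMIAL decay; ★
`firstEntryLip_not_geom`: still NO bound `≤ C ρ^k`, ρ < 1, uniformly on `]0, γ₀]` (witness `g_0 := min γ₀ 1 ∕ (k+1)`, value `≥ (min γ₀ 1)∕((k+1)(1+c)²)`, against `(k+1)ρ^k → 0`).
BN-N's conclusion is unchanged and its kernel shadow now matches the mechanism.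

**R-BM's kernel shadow** (CRIT-2's located repair for the rows roads, «prefer the MASS-BAND road»; FYI, generic β): under `FirstEntryOnly` ANY `HistLipschitz Λ` re-types to the
first-entry moduli `Λ⁰ k i := if i = 0 then Λ k 0 else 0` (★ `histLipschitz_firstEntry_of_firstEntryOnly`), whose mass is `Σ_{i≤k}|Λ⁰ k i| = |Λ k 0|` (★ `mass_firstEntry`) — so mod
H_FE′ U3ᴷ-lite's bounded-mass conjunct is exactly «the first-entry modulus is bounded in k» (by S-1 it even decays like k^{−1∕2}), while the geometric letters die (BN-N).  At the term
level the card's (a1) offer gets the matching F-E-robust form `MassLipOnBox R L M` ((a1) + bounded summed-moduli mass) ⟹ ★ `u3lite_of_massLipOnBox : HistLipschitz (sumModuli L) γ₀ β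
∧ ∀ k, Σ_{i≤k}|sumModuli L k i| ≤ M`, and BY NAME through PORT-1's LANDED road p622247 (`…K2CornerRoadRowsMassBand.constRemainder_of_histLipschitz_massBound_scaleAnchor`, CRIT-2
S.2035): ★ `constRemainder_of_massLipOnBox_scaleAnchor`, ★ `constRemainder_of_sizeLin_massLipOnBox` (anchor from the size lever) — DEF-1's `ConstRemainder` at every height from two
term-level statements about one box object (corner side; optional after rev 27).  HONEST: BN-O∕S-1∕R-BM are elementary real analysis about generic objects + a reading of the crux text; nothing of Bałaban's is asserted;
K1⁸ NOT closed; `𝓡`∕`𝓑` inhabited nowhere; R4 = the conditional finite-𝕋⁴ rung only; the YM mass gap (Clay) is NOT proved. -/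

section RunOnly

open Summit.QuantumFields.YangMills.Theorems.BalabanUVNodesK2NamedJetsRunRemAt (Survivors run_of_survivor)

variable {β : HBeta} {b : ℕ → ℝ} {γ₀ : ℝ}

/-- **(a0ᴿ) `ContAlongRuns R` — TERMWISE CONTINUITY ALONG THE CLAMPED SELF-GENERATED RUN (obligation about a given RUN representation; the run-typed history payment of ED.6):**
for every polymer `X` and scale `k`, the trace `x ↦ I X k (clampPrefix β γ₀ k x)` is continuous on the survivor set of level `γ₀` at scale `k`.  Intended inhabitant: print's
localized step-k activity as a function of the bare coupling through the run it generates ([I] Thm 3 p. 264: smooth in the last variable; §5 p. 298: the dependence on the earlier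
couplings exists — continuity along the run, per polymer, is THIS CARD's reading, unprinted as a modulus).  Weaker than `ContOnBox` (`contAlongRuns_of_contOnBox`). [cite: Balaban1987RG1, Thm 3 p.264 and §5 p.298] -/
def ContAlongRuns (R : ActivityRepr β b γ₀) : Prop :=
  ∀ (X : LocDomainZ4) (k : ℕ), ContinuousOn (fun x : ℝ => R.I X k (clampPrefix β γ₀ k x)) (Survivors β γ₀ k)

/-- Along a survivor's clamped run the representation reads `β_k = b_k + Σ'_X I X k` (the clamped prefix IS an in-window (0.20)-run, `run_of_survivor`). [folklore] -/
theorem ActivityRepr.eq_tsum_survivor (R : ActivityRepr β b γ₀) (hγ₀ : 0 < γ₀) {k : ℕ} {x : ℝ} (hx : x ∈ Survivors β γ₀ k) :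
    β k (clampPrefix β γ₀ k x) = b k + ∑' X, R.I X k (clampPrefix β γ₀ k x) := by
  obtain ⟨hrg, hI⟩ := run_of_survivor (β := β) hγ₀ hx
  have h := (R.hasSum_run k _ hrg hI k le_rfl).tsum_eq
  have e : prefixOf (fun i => gClamp γ₀ (Y β γ₀ i x)) k = clampPrefix β γ₀ k x := rfl
  rw [e] at h
  rw [h]; ring

/-- Along a survivor's clamped run every term is under its frozen majorant. [folklore] -/
theorem ActivityRepr.frozen_survivor (R : ActivityRepr β b γ₀) (hγ₀ : 0 < γ₀) {k : ℕ} {x : ℝ} (hx : x ∈ Survivors β γ₀ k) (X : LocDomainZ4) :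
    |R.I X k (clampPrefix β γ₀ k x)| ≤ R.M X := by
  obtain ⟨hrg, hI⟩ := run_of_survivor (β := β) hγ₀ hx
  have h := R.frozen_run k _ hrg hI k le_rfl X
  have e : prefixOf (fun i => gClamp γ₀ (Y β γ₀ i x)) k = clampPrefix β γ₀ k x := rfl
  rw [e] at h
  exact h

/-- **★ (a0ᴿ) ⟹ ROW (C) `SurvCont β γ₀` (proved; Weierstrass M-test ALONG RUNS over the frozen summable majorants, `continuousOn_tsum`)** — the survivor-continuity letter K1⁸'s row (C)
inlines, now a theorem of the RUN representation; no box value of β is touched. [folklore] -/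
theorem survCont_of_contAlongRuns (R : ActivityRepr β b γ₀) (h : ContAlongRuns R) (hγ₀ : 0 < γ₀) : SurvCont β γ₀ := by
  intro k
  have hS : ContinuousOn (fun x : ℝ => ∑' X, R.I X k (clampPrefix β γ₀ k x)) (Survivors β γ₀ k) :=
    continuousOn_tsum (fun X => h X k) R.M_summable fun X x hx => by
      rw [Real.norm_eq_abs]; exact R.frozen_survivor hγ₀ hx X
  have hT : ContinuousOn (fun x : ℝ => b k + ∑' X, R.I X k (clampPrefix β γ₀ k x)) (Survivors β γ₀ k) := continuousOn_const.add hS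
  exact hT.congr fun x hx => R.eq_tsum_survivor hγ₀ hx

/-- **THE BOX PAYMENT IMPLIES THE RUN PAYMENT (proved)**: `ContOnBox R → ContAlongRuns R.toRun` — continuity on the boxes gives `BetaContH`, hence the clamped run `x ↦ clampPrefix β γ₀ k x` is
continuous on `]0, ∞[` (`FlowStep.continuousOn_Y`, `continuous_gClamp`) with values in the box, and the composite is continuous.  So ED.5's obligations imply ED.6's. [folklore] -/
theorem contAlongRuns_of_contOnBox (R : BoxActivityRepr β b γ₀) (h : ContOnBox R) (hγ₀ : 0 < γ₀) : ContAlongRuns R.toRun := by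
  intro X k
  have hcont : BetaContH γ₀ β := betaContH_of_contOnBox R h
  have hpre : ContinuousOn (fun x : ℝ => clampPrefix β γ₀ k x) (Set.Ioi 0) := by
    rw [continuousOn_pi]
    intro j
    exact (continuous_gClamp hγ₀).comp_continuousOn (continuousOn_Y hγ₀ hcont j)
  have hsub : Survivors β γ₀ k ⊆ Set.Ioi 0 := fun x hx => hx.1
  have hmaps : Set.MapsTo (fun x : ℝ => clampPrefix β γ₀ k x) (Survivors β γ₀ k) (HistBox γ₀ k) := fun x _ => by
    rw [histBox_eq_box]; exact clampPrefix_mem_box hγ₀ k x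
  exact (h X k).comp (hpre.mono hsub) hmaps

/-- **★ ROWS (i)+(iv)+(C), generic, FROM THE RUN OBJECT ALONE (proved):** `LinOnRuns R` (S-LIN along runs) ⟹ run modulus (Tannery, §4) ⟹ row (i) with cap `s` on a SHRUNK level (§1);
drift at the same `b` ⟹ row (iv) with `M := 2A` (§10); `ContAlongRuns R` ⟹ row (C), cut to the shrunk level by N17's `survCont_anti`.  No box, no anchor, no κ.  CONDITIONAL on the
displayed hypotheses. [folklore] -/
theorem runRows_of_runOnly (R : ActivityRepr β b γ₀) (hL : LinOnRuns R) (hγ₀ : 0 < γ₀) {s A : ℝ} (hs : 0 < s) (hd : OneLoopDrift s A b) (hC : ContAlongRuns R) :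
    ∃ γ₁ : ℝ, 0 < γ₁ ∧ γ₁ ≤ γ₀ ∧ RunConstRemainder β b s γ₁ ∧ RunwiseFloor β (2 * A) γ₁ ∧ SurvCont β γ₁ := by
  obtain ⟨γ₁, hγ₁, hle, hrem⟩ := runConstRemainder_of_runModulus (runModulus_of_linOnRuns R hL) hγ₀ hs
  exact ⟨γ₁, hγ₁, hle, hrem, runwiseFloor_of_drift_runConstRemainder hd hrem, survCont_anti hγ₁ hle (survCont_of_contAlongRuns R hC hγ₀)⟩

end RunOnly

section RunOnly13

/-- **`RunRecordRepr13` — D-REPR's type, RUN edition (ED.6; THE RE-TYPED DEBT (P1); NOT constructed here).**  Per tuple under the crux prefix: the history-free part `N F θ hP : ℕ → ℝ`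
(print's one-loop normalisation numbers, [I] (1.20)–(1.22) p. 264, [II] p. 21 L21–27), a window `γ₀ > 0`, and a RUN representation `ActivityRepr D.βfun N γ₀` (§4: `HasSum` + frozen
summable majorants along in-window (0.20)-runs ONLY — print's own induction; no free histories, no `γ₀ ≤ θ.γ` needed by the rows road).  Intended inhabitant: `I X k (g_0,…,g_k)` the
X-term of print's localized β¹ through `secondMoment ∘ polLimit` along the run, `M X` the `RemainderChain` constants. [cite: Balaban1987RG1, (1.22) p.264 and (2.13) p.268; Balaban1988RG2Cluster, (2.13) p.15 and Lemma 3 (2.38) p.20] -/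
structure RunRecordRepr13 where
  /-- the history-free part: print's one-loop numbers transported to the record -/
  N : (F : T4Family) → (θ : Node00.Stage13HParams F 2) → θ.Provisos₁₃SepCoPH F 2 → ℕ → ℝ
  /-- the window of the representation -/
  γ₀ : (F : T4Family) → (θ : Node00.Stage13HParams F 2) → θ.Provisos₁₃SepCoPH F 2 → ℝ
  γ₀_pos : ∀ F θ hP, 0 < γ₀ F θ hP
  repr : ∀ (F : T4Family) (θ : Node00.Stage13HParams F 2) (hP : θ.Provisos₁₃SepCoPH F 2),
    (θ.ZhUnity F 2 ∧ θ.SlotsNondegenerate₁₃ F 2) → θ.Admissible F 2 →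
    B16.EndStatementBPrinted (Node00.datumOfRecord₁₃SepCoPH F 2 θ hP).C → Window13 F θ hP →
    ActivityRepr (Node00.datumOfRecord₁₃SepCoPH F 2 θ hP).βfun (N F θ hP) (γ₀ F θ hP)

/-- The box edition restricts to the run edition (forget the off-run histories and `γ₀ ≤ θ.γ`). [folklore] -/
def RunRecordRepr13.ofBox (𝓑 : BoxRecordRepr13) : RunRecordRepr13 where
  N := 𝓑.N
  γ₀ := 𝓑.γ₀
  γ₀_pos := 𝓑.γ₀_pos
  repr := fun F θ hP hU hθ hB hwin => (𝓑.repr F θ hP hU hθ hB hwin).toRun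

/-- **S-LIN IN RUN CURRENCY about a delivered RUN object (THIS CARD's supplier obligation, ED.6 = ED.5's `LinOnRuns13` minus the box):** the stub a line registers after D-REPR lands, size L
([II] (1.38)–(1.40) p. 10 per polymer with the marked factor kept downstairs; memos `DESK-CF1-two-bound-idea5g9.md` (|X| = 1), `DESK-H5P-two-bound-idea5g13.md` (|D| = 2)). [cite: Balaban1987RG1, (2.13) p.268; Balaban1988RG2Cluster, p.8 and (1.38)–(1.40) p.10] -/
def LinOnRuns13R (𝓡 : RunRecordRepr13) : Prop :=
  ∀ (F : T4Family) (θ : Node00.Stage13HParams F 2) (hP : θ.Provisos₁₃SepCoPH F 2)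
    (hU : θ.ZhUnity F 2 ∧ θ.SlotsNondegenerate₁₃ F 2) (hθ : θ.Admissible F 2)
    (hB : B16.EndStatementBPrinted (Node00.datumOfRecord₁₃SepCoPH F 2 θ hP).C) (hwin : Window13 F θ hP),
    LinOnRuns (𝓡.repr F θ hP hU hθ hB hwin)

/-- **(D1)'s DRIFT SIGN at the run object's own numbers (obligation; NOT this card's object).** [cite: Balaban1987RG1, Thm 2 p.259 and (1.22) p.264] -/
def DriftAtN13R (𝓡 : RunRecordRepr13) : Prop :=
  ∀ (F : T4Family) (θ : Node00.Stage13HParams F 2) (hP : θ.Provisos₁₃SepCoPH F 2), (θ.ZhUnity F 2 ∧ θ.SlotsNondegenerate₁₃ F 2) → θ.Admissible F 2 →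
    B16.EndStatementBPrinted (Node00.datumOfRecord₁₃SepCoPH F 2 θ hP).C → Window13 F θ hP →
    ∃ s A : ℝ, 0 < s ∧ OneLoopDrift s A (𝓡.N F θ hP)

/-- **(a0ᴿ) at the record — THE RUN-TYPED HISTORY PAYMENT (obligation; replaces `ContOnBox13` on the deciding road):** termwise continuity along the clamped self-generated runs, per tuple. [cite: Balaban1987RG1, Thm 3 p.264 and §5 p.298] -/
def ContAlongRuns13R (𝓡 : RunRecordRepr13) : Prop :=
  ∀ (F : T4Family) (θ : Node00.Stage13HParams F 2) (hP : θ.Provisos₁₃SepCoPH F 2)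
    (hU : θ.ZhUnity F 2 ∧ θ.SlotsNondegenerate₁₃ F 2) (hθ : θ.Admissible F 2)
    (hB : B16.EndStatementBPrinted (Node00.datumOfRecord₁₃SepCoPH F 2 θ hP).C) (hwin : Window13 F θ hP),
    ContAlongRuns (𝓡.repr F θ hP hU hθ hB hwin)

/-- ED.5's run letter about a box object IS ED.6's letter about its restriction (`Iff.rfl` up to `toRun`). [folklore] -/
theorem linOnRuns13R_ofBox_iff (𝓑 : BoxRecordRepr13) : LinOnRuns13R (RunRecordRepr13.ofBox 𝓑) ↔ LinOnRuns13 𝓑 := Iff.rfl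

theorem driftAtN13R_ofBox_iff (𝓑 : BoxRecordRepr13) : DriftAtN13R (RunRecordRepr13.ofBox 𝓑) ↔ DriftAtN13 𝓑 := Iff.rfl

/-- The box payment (a0) implies the run payment (a0ᴿ) at the record. [folklore] -/
theorem contAlongRuns13R_of_contOnBox13 (𝓑 : BoxRecordRepr13) (hC : ContOnBox13 𝓑) : ContAlongRuns13R (RunRecordRepr13.ofBox 𝓑) :=
  fun F θ hP hU hθ hB hwin => contAlongRuns_of_contOnBox _ (hC F θ hP hU hθ hB hwin) (𝓑.γ₀_pos F θ hP)

/-- **★ THE RUN OBJECT PAYS K1⁸'s ROWS AT EVERY TUPLE (proved, conditional on the three run-currency obligations about a delivered `𝓡`)**: `b := 𝓡.N`, `r := s`, `M := 2A`, shrunk level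
`γ₁ ≤ 𝓡.γ₀`; the datum's β IS `betaOfRecord₁₃ θ` (`Node00.βfun_datumOfRecord₁₃SepCoPH`, `rfl`). [folklore] -/
theorem runRows13_of_runOnly (𝓡 : RunRecordRepr13) (hL : LinOnRuns13R 𝓡) (hD : DriftAtN13R 𝓡) (hC : ContAlongRuns13R 𝓡) :
    ∀ (F : T4Family) (θ : Node00.Stage13HParams F 2) (hP : θ.Provisos₁₃SepCoPH F 2), (θ.ZhUnity F 2 ∧ θ.SlotsNondegenerate₁₃ F 2) → θ.Admissible F 2 →
      B16.EndStatementBPrinted (Node00.datumOfRecord₁₃SepCoPH F 2 θ hP).C → Window13 F θ hP → RunRows13 F θ := by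
  intro F θ hP hU hθ hB hwin
  obtain ⟨s, A, hs, hd⟩ := hD F θ hP hU hθ hB hwin
  obtain ⟨γ₁, hγ₁, -, hrem, hfl, hsc⟩ :=
    runRows_of_runOnly (𝓡.repr F θ hP hU hθ hB hwin) (hL F θ hP hU hθ hB hwin) (𝓡.γ₀_pos F θ hP) hs hd (hC F θ hP hU hθ hB hwin)
  rw [Node00.βfun_datumOfRecord₁₃SepCoPH] at hrem hfl hsc
  exact ⟨𝓡.N F θ hP, s, γ₁, 2 * A, hγ₁, hrem, hfl, hsc⟩

/-- **★¹⁰ (EDITION 6's CHAIN — proved, no sorry): K1⁷ (hypothesis) + `LinOnRuns13R ∧ DriftAtN13R ∧ ContAlongRuns13R` about a RUN object ⟹ K1⁸ `StabilityBRunRowsAtRecordR13SepCoPH` BY NAME.**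
No box value of β_θ, no anchor, no κ, no `θ.cβ`, no smallness letter.  CONDITIONAL: K1⁷ `StabilityBAtRecordR13SepCoPH` (stmt-QuantumFields-20542, aside) OPEN content; `𝓡` inhabited
NOWHERE (D-REPR, definer-first, THE debt — now run-typed); the three obligations are obligations; nothing of Bałaban's asserted; K1⁸ NOT closed; Clay NOT proved. [folklore] -/
theorem k1R8_of_k1R7_runOnly (𝓡 : RunRecordRepr13) (hL : LinOnRuns13R 𝓡) (hD : DriftAtN13R 𝓡) (hC : ContAlongRuns13R 𝓡)
    (hK1 : Summit.QuantumFields.YangMills.Theses.BalabanUVNodes.StabilityBAtRecordR13SepCoPH) :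
    Summit.QuantumFields.YangMills.Theses.BalabanUVNodes.StabilityBRunRowsAtRecordR13SepCoPH := by
  intro F hex
  obtain ⟨θ, h, hU, hθ, hB, hwin⟩ := hK1 F hex
  obtain ⟨b', r, γ₁, M, hγ₁, hrem, hfl, hsc⟩ := runRows13_of_runOnly 𝓡 hL hD hC F θ h hU hθ hB hwin
  exact ⟨θ, h, hU, hθ, hB, hwin, b', r, γ₁, M, hγ₁, hrem, hfl, hsc⟩

/-- ED.5's ★⁸ re-derived as `★¹⁰ ∘ ofBox` (the box edition is the stronger supplier; nothing of ED.5 withdrawn). [folklore] -/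
theorem k1R8_of_k1R7_linOnRuns_drift_cont_viaRunOnly (𝓑 : BoxRecordRepr13) (hL : LinOnRuns13 𝓑) (hD : DriftAtN13 𝓑) (hC : ContOnBox13 𝓑)
    (hK1 : Summit.QuantumFields.YangMills.Theses.BalabanUVNodes.StabilityBAtRecordR13SepCoPH) :
    Summit.QuantumFields.YangMills.Theses.BalabanUVNodes.StabilityBRunRowsAtRecordR13SepCoPH :=
  k1R8_of_k1R7_runOnly (RunRecordRepr13.ofBox 𝓑) ((linOnRuns13R_ofBox_iff 𝓑).2 hL) ((driftAtN13R_ofBox_iff 𝓑).2 hD)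
    (contAlongRuns13R_of_contOnBox13 𝓑 hC) hK1

/-- **★ an4's WEAK CURRENCY AT EVERY TUPLE from the run object** (hypothesis `h` of the landed `…K2RunRowsContOfCorner.rowsContAllK_of_ownDrift_runConstRemainderK`). CONDITIONAL. [folklore] -/
theorem weakCurrencyK_of_runOnly (𝓡 : RunRecordRepr13) (hL : LinOnRuns13R 𝓡) (hD : DriftAtN13R 𝓡) (hC : ContAlongRuns13R 𝓡) :
    ∀ (F : T4Family) (θ : Node00.Stage13HParams F 2) (hP : θ.Provisos₁₃SepCoPH F 2),
      (θ.ZhUnity F 2 ∧ θ.SlotsNondegenerate₁₃ F 2) → θ.Admissible F 2 →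
      B16.EndStatementBPrinted (Node00.datumOfRecord₁₃SepCoPH F 2 θ hP).C →
      (∃ γ₁ : ℝ, 0 < γ₁ ∧ ∀ γ : ℝ, 0 < γ → γ ≤ γ₁ →
        ∃ P : B12.RunParams, 1 ≤ P.K ∧ ((Node00.datumOfRecord₁₃SepCoPH F 2 θ hP).C P).flow.InInterval γ P.K) →
      ∃ (b : ℕ → ℝ) (s A γ₀ r : ℝ), OneLoopDrift s A b ∧ 0 < γ₀ ∧ r ≤ s ∧
        RunConstRemainder (Node00.datumOfRecord₁₃SepCoPH F 2 θ hP).βfun b r γ₀ ∧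
        SurvCont (Node00.datumOfRecord₁₃SepCoPH F 2 θ hP).βfun γ₀ := by
  intro F θ hP hU hθ hB hwin
  obtain ⟨s, A, hs, hd⟩ := hD F θ hP hU hθ hB hwin
  obtain ⟨γ₁, hγ₁, -, hrem, -, hsc⟩ :=
    runRows_of_runOnly (𝓡.repr F θ hP hU hθ hB hwin) (hL F θ hP hU hθ hB hwin) (𝓡.γ₀_pos F θ hP) hs hd (hC F θ hP hU hθ hB hwin)
  exact ⟨𝓡.N F θ hP, s, A, γ₁, s, hd, hγ₁, le_rfl, hrem, hsc⟩

/-- **★¹⁰ᵀ THROUGH an4's LANDED BRIDGE**: K1⁸ BY NAME. Same conditional status as ★¹⁰. [folklore] -/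
theorem k1R8_of_k1R7_runOnly_viaTreeBridge (𝓡 : RunRecordRepr13) (hL : LinOnRuns13R 𝓡) (hD : DriftAtN13R 𝓡) (hC : ContAlongRuns13R 𝓡)
    (hK1 : Summit.QuantumFields.YangMills.Theses.BalabanUVNodes.StabilityBAtRecordR13SepCoPH) :
    Summit.QuantumFields.YangMills.Theses.BalabanUVNodes.StabilityBRunRowsAtRecordR13SepCoPH := by
  intro F hex
  obtain ⟨θ, h, hU, hθ, hB, hwin⟩ := hK1 F hex
  exact ⟨θ, h, hU, hθ, hB, hwin,
    Summit.QuantumFields.YangMills.Theorems.BalabanUVNodesK2RunRowsContOfCorner.rowsContAllK_of_ownDrift_runConstRemainderK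
      (weakCurrencyK_of_runOnly 𝓡 hL hD hC) F θ h hU hθ hB hwin⟩

/-- **★ THE RUN OBJECT SUPPLIES DEF-1's ∀θ PROGRAMME `RowsContAll` (proved, conditional).** [folklore] -/
theorem rowsContAll_of_runOnly (𝓡 : RunRecordRepr13) (hL : LinOnRuns13R 𝓡) (hD : DriftAtN13R 𝓡) (hC : ContAlongRuns13R 𝓡) :
    Summit.QuantumFields.YangMills.Theorems.BalabanUVNodesK1R8RowsDefs.RowsContAll :=
  fun F θ hP hU hθ hB hwin => (runRows13_iff_runRowsCont13 F θ).1 (runRows13_of_runOnly 𝓡 hL hD hC F θ hP hU hθ hB hwin)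

/-- **★¹⁰ᴰ K1⁸ BY NAME THROUGH DEF-1's BRIDGE** `stabilityBRunRowsAtRecordR13SepCoPH_of_k17_rowsContAll`. CONDITIONAL; K1⁸ NOT closed. [folklore] -/
theorem k1R8_of_k1R7_runOnly_viaDef1 (𝓡 : RunRecordRepr13) (hL : LinOnRuns13R 𝓡) (hD : DriftAtN13R 𝓡) (hC : ContAlongRuns13R 𝓡)
    (hK1 : Summit.QuantumFields.YangMills.Theses.BalabanUVNodes.StabilityBAtRecordR13SepCoPH) :
    Summit.QuantumFields.YangMills.Theses.BalabanUVNodes.StabilityBRunRowsAtRecordR13SepCoPH :=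
  Summit.QuantumFields.YangMills.Theorems.BalabanUVNodesK1R8RowsDefs.stabilityBRunRowsAtRecordR13SepCoPH_of_k17_rowsContAll hK1
    (rowsContAll_of_runOnly 𝓡 hL hD hC)

/-- **★¹⁰ᴱ THE ASIDE DECL K2⁷ `EndpointGivenBR13SepCoPH` (stmt-QuantumFields-20543, this workfile's key) BY NAME from the run object**, through DEF-1's `endpointGivenBR13SepCoPH_of_rowsContAll`.
CONDITIONAL; K2⁷ NOT closed. [cite: Balaban1987RG1, Thm 2 p.259 (first sentence), Thm 3 p.264 and (2.13) p.268] -/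
theorem EndpointGivenBR13SepCoPH_of_runOnly (𝓡 : RunRecordRepr13) (hL : LinOnRuns13R 𝓡) (hD : DriftAtN13R 𝓡) (hC : ContAlongRuns13R 𝓡) :
    Summit.QuantumFields.YangMills.Theses.BalabanUVNodes.EndpointGivenBR13SepCoPH :=
  Summit.QuantumFields.YangMills.Theorems.BalabanUVNodesK1R8RowsDefs.endpointGivenBR13SepCoPH_of_rowsContAll (rowsContAll_of_runOnly 𝓡 hL hD hC)

end RunOnly13

section S1

/-- **★ S-1 (CRIT-2 ROUND 5 (4), paid): the honest first-entry Lipschitz weight of a run-transported O(g_k) remainder, `g∕(1 + a g²)²` (a = c·k), is at most `1∕(2√a)`** — AM–GM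
`1 + a g² ≥ 2√a·g` and `(1 + a g²)² ≥ 1 + a g²`; so `sup_{g} ≍ (ck)^{−1∕2}`: POLYNOMIAL decay in k (toy one-loop factor, not Bałaban's β). [folklore] -/
theorem firstEntryLip_le_inv_sqrt {a g : ℝ} (ha : 0 < a) (hg : 0 < g) : g / (1 + a * g ^ 2) ^ 2 ≤ 1 / (2 * Real.sqrt a) := by
  have hsa : 0 < Real.sqrt a := Real.sqrt_pos.2 ha
  have hsq : Real.sqrt a ^ 2 = a := Real.sq_sqrt ha.le
  have h1 : 2 * Real.sqrt a * g ≤ 1 + a * g ^ 2 := by nlinarith [sq_nonneg (1 - Real.sqrt a * g)]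
  have h0 : 1 ≤ 1 + a * g ^ 2 := by nlinarith [sq_nonneg g]
  have h2 : 1 + a * g ^ 2 ≤ (1 + a * g ^ 2) ^ 2 := by nlinarith
  have hden : 0 < (1 + a * g ^ 2) ^ 2 := by positivity
  rw [div_le_div_iff₀ hden (by positivity)]
  nlinarith

/-- **★ S-1 (second half): … and still NO GEOMETRIC BOUND uniformly on `]0, γ₀]`** — `¬ ∃ C, ρ < 1, ∀ k g₀, g₀∕(1 + c k g₀²)² ≤ C ρ^k`: at `g₀ := (min γ₀ 1)∕(k+1)` the weight is
`≥ (min γ₀ 1)∕((k+1)(1+c)²)` while `(k+1)·Cρ^k → 0`.  BN-N's conclusion with the O(g_k) prefactor included (CRIT-2: «POLYNOMIAL, still not O(ρ^k) ⇒ conclusion UNCHANGED»). [folklore] -/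
theorem firstEntryLip_not_geom {c γ₀ : ℝ} (hc : 0 ≤ c) (hγ₀ : 0 < γ₀) :
    ¬ ∃ C ρ : ℝ, 0 ≤ ρ ∧ ρ < 1 ∧ ∀ (k : ℕ) (g₀ : ℝ), 0 < g₀ → g₀ ≤ γ₀ → g₀ / (1 + c * k * g₀ ^ 2) ^ 2 ≤ C * ρ ^ k := by
  rintro ⟨C, ρ, hρ0, hρ1, h⟩
  set γ₁ : ℝ := min γ₀ 1 with hγ₁def
  have hγ₁ : 0 < γ₁ := lt_min hγ₀ one_pos
  have hγ₁γ : γ₁ ≤ γ₀ := min_le_left _ _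
  have hγ₁1 : γ₁ ≤ 1 := min_le_right _ _
  have ht : Tendsto (fun k : ℕ => ((k : ℝ) + 1) * (C * ρ ^ k)) atTop (𝓝 0) := by
    have h1 : Tendsto (fun k : ℕ => (k : ℝ) * ρ ^ k) atTop (𝓝 0) := tendsto_self_mul_const_pow_of_lt_one hρ0 hρ1
    have h2 : Tendsto (fun k : ℕ => ρ ^ k) atTop (𝓝 0) := tendsto_pow_atTop_nhds_zero_of_lt_one hρ0 hρ1
    have h3 : Tendsto (fun k : ℕ => C * ((k : ℝ) * ρ ^ k + ρ ^ k)) atTop (𝓝 (C * (0 + 0))) := (h1.add h2).const_mul C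
    rw [add_zero, mul_zero] at h3
    refine h3.congr fun k => ?_
    ring
  have hpos : 0 < γ₁ / (1 + c) ^ 2 := by positivity
  have hlb : ∀ k : ℕ, γ₁ / (1 + c) ^ 2 ≤ ((k : ℝ) + 1) * (C * ρ ^ k) := by
    intro k
    have hk : (0 : ℝ) < (k : ℝ) + 1 := by positivity
    set g₀ : ℝ := γ₁ / ((k : ℝ) + 1) with hg₀def
    have hg₀ : 0 < g₀ := div_pos hγ₁ hk
    have hg₀γ₁ : g₀ ≤ γ₁ := div_le_self hγ₁.le (by linarith)
    have hg₀le : g₀ ≤ γ₀ := hg₀γ₁.trans hγ₁γ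
    have hg₀1 : g₀ ≤ 1 := hg₀γ₁.trans hγ₁1
    have hkg : ((k : ℝ) + 1) * g₀ = γ₁ := by rw [hg₀def]; field_simp
    have hkg' : (k : ℝ) * g₀ ≤ 1 := by nlinarith
    have hckg : c * k * g₀ ^ 2 ≤ c := by
      have : (k : ℝ) * g₀ ^ 2 ≤ 1 := by nlinarith
      nlinarith
    have hb0 : 0 ≤ 1 + c * k * g₀ ^ 2 := by positivity
    have hsq : (1 + c * k * g₀ ^ 2) ^ 2 ≤ (1 + c) ^ 2 := pow_le_pow_left₀ hb0 (by linarith) 2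
    have hsqpos : 0 < (1 + c * k * g₀ ^ 2) ^ 2 := by positivity
    have hstep : g₀ / (1 + c) ^ 2 ≤ g₀ / (1 + c * k * g₀ ^ 2) ^ 2 := div_le_div_of_nonneg_left hg₀.le hsqpos hsq
    have hmain : g₀ / (1 + c) ^ 2 ≤ C * ρ ^ k := hstep.trans (h k g₀ hg₀ hg₀le)
    have hc2 : 0 < (1 + c) ^ 2 := by positivity
    calc γ₁ / (1 + c) ^ 2 = ((k : ℝ) + 1) * (g₀ / (1 + c) ^ 2) := by rw [← hkg]; ring
      _ ≤ ((k : ℝ) + 1) * (C * ρ ^ k) := mul_le_mul_of_nonneg_left hmain hk.le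
  obtain ⟨k, hk⟩ := (ht.eventually (gt_mem_nhds hpos)).exists
  exact absurd (hlb k) (not_le.2 hk)

end S1

section MassBand

variable {β : HBeta} {γ₀ : ℝ}

/-- The FIRST-ENTRY re-typing of a moduli table: keep `Λ k 0`, zero elsewhere. [folklore] -/
def firstEntryModuli (Λ : ℕ → ℕ → ℝ) (k i : ℕ) : ℝ := if i = 0 then Λ k 0 else 0

/-- **★ R-BM's kernel shadow (generic β): under `FirstEntryOnly`, ANY `HistLipschitz Λ` re-types to the first-entry moduli** — slide q's entries j ≥ 1 onto p's by blindness; only the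
i = 0 term survives.  So mod H_FE′ the history letter of every rows road is a statement about ONE modulus per scale. [folklore] -/
theorem histLipschitz_firstEntry_of_firstEntryOnly (hB : FirstEntryOnly β γ₀) {Λ : ℕ → ℕ → ℝ} (hH : HistLipschitz Λ γ₀ β) :
    HistLipschitz (firstEntryModuli Λ) γ₀ β := by
  intro k p q hp hq
  have hp' : p ∈ HistBox γ₀ k := by rw [histBox_eq_box]; exact hp
  have hq' : q ∈ HistBox γ₀ k := by rw [histBox_eq_box]; exact hq
  set q' : Fin (k + 1) → ℝ := Function.update p 0 (q 0) with hq'def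
  have hq'mem : q' ∈ HistBox γ₀ k := by
    intro i
    by_cases hi : i = 0
    · subst hi; simp [hq'def, (hq' 0).1, (hq' 0).2]
    · simp [hq'def, Function.update_of_ne hi, (hp' i).1, (hp' i).2]
  have hqq' : β k q = β k q' := hB k q q' hq' hq'mem (by simp [hq'def])
  rw [hqq']
  have hqB : q' ∈ Box γ₀ k := by rw [← histBox_eq_box]; exact hq'mem
  refine (hH k p q' hp hqB).trans ?_
  have hterm : ∀ i ∈ (Finset.univ : Finset (Fin (k + 1))), i ≠ 0 → Λ k i * |p i - q' i| = 0 := by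
    intro i _ hi
    simp [hq'def, Function.update_of_ne hi]
  rw [Finset.sum_eq_single (0 : Fin (k + 1)) hterm (by simp)]
  have hterm' : ∀ i ∈ (Finset.univ : Finset (Fin (k + 1))), i ≠ 0 → firstEntryModuli Λ k i * |p i - q i| = 0 := by
    intro i _ hi
    have : (i : ℕ) ≠ 0 := fun h => hi (Fin.ext h)
    simp [firstEntryModuli, this]
  rw [Finset.sum_eq_single (0 : Fin (k + 1)) hterm' (by simp)]
  have h0 : q' 0 = q 0 := by simp [hq'def]
  rw [h0]
  simp [firstEntryModuli]

/-- **★ … and the MASS of the first-entry moduli is the first-entry modulus**: `Σ_{i≤k} |Λ⁰ k i| = |Λ k 0|` — U3ᴷ-lite's bounded-mass conjunct mod H_FE′ reads «`Λ k 0` bounded in k». [folklore] -/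
theorem mass_firstEntry (Λ : ℕ → ℕ → ℝ) (k : ℕ) : ∑ i : Fin (k + 1), |firstEntryModuli Λ k i| = |Λ k 0| := by
  have hterm : ∀ i ∈ (Finset.univ : Finset (Fin (k + 1))), i ≠ 0 → |firstEntryModuli Λ k i| = 0 := by
    intro i _ hi
    have : (i : ℕ) ≠ 0 := fun h => hi (Fin.ext h)
    simp [firstEntryModuli, this]
  rw [Finset.sum_eq_single (0 : Fin (k + 1)) hterm (by simp)]
  simp [firstEntryModuli]

/-- **U3ᴷ-lite mod H_FE′ (proved shadow)**: `FirstEntryOnly` + `HistLipschitz Λ` with `|Λ k 0| ≤ M` for all k ⟹ the MASS-BAND pair R-BM asks the rows roads to carry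
(`HistLipschitz Λ⁰ ∧ ∀ k, Σ_{i≤k}|Λ⁰ k i| ≤ M`). [folklore] -/
theorem u3lite_of_firstEntryOnly (hB : FirstEntryOnly β γ₀) {Λ : ℕ → ℕ → ℝ} (hH : HistLipschitz Λ γ₀ β) {M : ℝ} (hM : ∀ k, |Λ k 0| ≤ M) :
    HistLipschitz (firstEntryModuli Λ) γ₀ β ∧ ∀ k, ∑ i : Fin (k + 1), |firstEntryModuli Λ k i| ≤ M :=
  ⟨histLipschitz_firstEntry_of_firstEntryOnly hB hH, fun k => (mass_firstEntry Λ k).le.trans (hM k)⟩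

variable {b : ℕ → ℝ}

/-- **(a1ᴹ) `MassLipOnBox R L M` — the card's term-level history offer in R-BM's F-E-ROBUST form (obligation about a given box representation):** termwise history moduli (a1) whose
SUMMED moduli have k-BOUNDED MASS `Σ_{i≤k} Σ'_X L X k i ≤ M` (instead of ED.4's geometric `FadingOnBox`, withdrawn at the current record by BN-N). [cite: Balaban1987RG1, §5 p.298] -/
structure MassLipOnBox (R : BoxActivityRepr β b γ₀) (L : LocDomainZ4 → ℕ → ℕ → ℝ) (M : ℝ) : Prop where
  lip : LipOnBox R L
  mass : ∀ k, ∑ i : Fin (k + 1), sumModuli L k i ≤ M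

/-- **★ (a1ᴹ) ⟹ U3ᴷ-lite's pair** `HistLipschitz (sumModuli L) γ₀ β ∧ ∀ k, Σ_{i≤k} |sumModuli L k i| ≤ M` (proved, bookkeeping over `histLipschitz_of_lipOnBox`). [folklore] -/
theorem u3lite_of_massLipOnBox (R : BoxActivityRepr β b γ₀) {L : LocDomainZ4 → ℕ → ℕ → ℝ} {M : ℝ} (h : MassLipOnBox R L M) :
    HistLipschitz (sumModuli L) γ₀ β ∧ ∀ k, ∑ i : Fin (k + 1), |sumModuli L k i| ≤ M := by
  refine ⟨histLipschitz_of_lipOnBox R h.lip, fun k => ?_⟩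
  have heq : ∑ i : Fin (k + 1), |sumModuli L k i| = ∑ i : Fin (k + 1), sumModuli L k i :=
    Finset.sum_congr rfl fun i _ => abs_of_nonneg (sumModuli_nonneg h.lip.nonneg k i)
  rw [heq]
  exact h.mass k

end MassBand

section MassBandByName

variable {β : HBeta} {b : ℕ → ℝ} {γ₀ : ℝ}

/-- **★ (a1ᴹ) + a per-scale anchor ⟹ DEF-1's `ConstRemainder β b s γs` at EVERY height `s > 0` on a shrunk level `γs ≤ γ₀` — BY NAME through PORT-1's LANDED R-BM road p622247
`…K2CornerRoadRowsMassBand.constRemainder_of_histLipschitz_massBound_scaleAnchor`** (no rate, no telescoping, no convergence of `b`; CRIT-2 S.2035 «history payment → U3ᴷ-lite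
shape»): the card's term-level mass-band offer `MassLipOnBox` meets the tree's mass-band lever exactly (`u3lite_of_massLipOnBox` supplies its two letters).  CONDITIONAL —
obligations about an undelivered BOX object (corner ∕ anchor side; F-E-robust in meaning per R-BM, inhabited nowhere). [folklore] -/
theorem constRemainder_of_massLipOnBox_scaleAnchor (R : BoxActivityRepr β b γ₀) {L : LocDomainZ4 → ℕ → ℕ → ℝ} {M : ℝ} (h : MassLipOnBox R L M) (hγ₀ : 0 < γ₀)
    (hb : ScaleAnchor β b) {s : ℝ} (hs : 0 < s) :
    ∃ γs : ℝ, 0 < γs ∧ γs ≤ γ₀ ∧ Summit.QuantumFields.YangMills.Theorems.BalabanUVNodesK2NamedJetsRemAt.ConstRemainder β b s γs := by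
  obtain ⟨hH, hM⟩ := u3lite_of_massLipOnBox R h
  exact Summit.QuantumFields.YangMills.Theorems.BalabanUVNodesK2CornerRoadRowsMassBand.constRemainder_of_histLipschitz_massBound_scaleAnchor hγ₀ hH hM hb hs

/-- **★ … with the anchor PROVED from the box-SIZE lever (ed.5 `SizeLinOnBox` ⟹ `BoxSizeModulus` ⟹ `ScaleAnchor`)**: `SizeLinOnBox R ∧ MassLipOnBox R L M` ⟹ `ConstRemainder` at every
height — the whole corner→constant-remainder road of R-BM fed from TWO term-level statements about ONE box object, no anchor hypothesis.  CONDITIONAL; `R` inhabited nowhere. [folklore] -/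
theorem constRemainder_of_sizeLin_massLipOnBox (R : BoxActivityRepr β b γ₀) (hS : SizeLinOnBox R) {L : LocDomainZ4 → ℕ → ℕ → ℝ} {M : ℝ} (h : MassLipOnBox R L M)
    (hγ₀ : 0 < γ₀) {s : ℝ} (hs : 0 < s) :
    ∃ γs : ℝ, 0 < γs ∧ γs ≤ γ₀ ∧ Summit.QuantumFields.YangMills.Theorems.BalabanUVNodesK2NamedJetsRemAt.ConstRemainder β b s γs :=
  constRemainder_of_massLipOnBox_scaleAnchor R h hγ₀ (scaleAnchor_of_boxSizeModulus (boxSizeModulus_of_sizeLinOnBox R hS) hγ₀) hs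

end MassBandByName


/-! ## §13 REV-28 RE-KEY (route `BalabanUVNodes` rev 28 → 29 (5c92291ad69b, file 958ad1aa2c9d), plan g85 2026-08-28T09:54–09:57Z, director-ym №210 (δ) NULL-SET SURGERY; CRIT-2 g3's
re-key advice (a)(b) S.10:13:49Z is exactly this section): the deciding crux is now **K1⁹ `StabilityBRunRowsAtRecordR13SepCoPHV`** (stmt-QuantumFields-27364 · crux · rank 3; K3⁸ = 27366, K2⁹ = 27365 support) = K1⁸ with a VERSION SLOT `v : Node00.Revision₁₃ F 2 θ h` in the witness tuple — (B) AS PRINTED and the window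
read at the re-chosen datum `Node00.datumOfRecord₁₃SepCoPHV F 2 θ h v`, rows (i)(iv)(C) about `betaOfRecord₁₃ θ` UNCHANGED (θ-level, slot-free); K1⁸ 26907 is `aside`;
`closes (h0 : K0⁷) (h1 : K1⁹) (h2 : K2⁹) (h3 : K3⁸)`.  DEF-1's `Node00/Record13SepCoPHV` (p620607) supplies the door `datumOfRecord₁₃SepCoPHV_refl` (`rfl`), `βfun_…V` (`rfl`),
`flow_…V` (`rfl`: the window is version-free) and `thm1Printed_…V_iff` (`Iff.rfl`: [16] Thm 1's clause is version-free; only Cor. 3 (2.50) reads the re-chosen densities).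

THE RE-KEY IS ONE LINE FOR THIS CARD (E-CRIT2-3 «the (B)-antecedent moves to the slot with the crux; conclusions rfl-invariant»): the run object and its three obligations are θ-LEVEL
(they read `betaOfRecord₁₃ θ` along runs and print's numbers `N`), so
★¹¹ `k1R9_of_k1R7_runOnly (𝓡 : RunRecordRepr13) : LinOnRuns13R 𝓡 → DriftAtN13R 𝓡 → ContAlongRuns13R 𝓡 → K1⁷ → K1⁹` BY NAME — at K1⁷'s witness take the TRIVIAL revision
`v := Revision₁₃.refl` (the door is `rfl`); and for witness roads that deliver (B) only at a NON-trivial version (N13's a.e. edition + surgery), the slot-keyed run object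
`RunRecordRepr13V` (ONE more binder `v`, (B) at the slot datum; `Window13` unchanged since the flow is version-free) with ★¹¹ⱽ `k1R9_of_witnessV_runOnlyV : LinOnRuns13RV 𝓡 →
DriftAtN13RV 𝓡 → ContAlongRuns13RV 𝓡 → WitnessV13 → K1⁹`, where `WitnessV13` is K1⁹'s own witness half (declared here as a SHAPE because rev 28 files no K1⁷ⱽ item;
`witnessV13_of_k1R7 : K1⁷ → WitnessV13` by the door).  `RunRecordRepr13.toV` shows the rev-27 object IS a slot-keyed one when its constructor uses (B) only through [16] Thm 1's
version-free clause (`RunRecordRepr13T`, the Thm-1-keyed demand — whether D-REPR's expansion needs Cor. 3 (2.50) at all is the definer's call; the β expansion of [I]∕[II] reads the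
small-field actions (0.22)–(0.25), i.e. Theorem-1 territory).  HONEST: bookkeeping over rev 28's text; K1⁹ NOT closed; `𝓡` inhabited nowhere; nothing of Bałaban's asserted;
R4 = the conditional finite-𝕋⁴ rung only; the YM mass gap is NOT proved. -/

section Rev28

/-- The non-vacuity WINDOW read at the re-chosen datum (K1⁹'s fourth conjunct, verbatim shape). [cite: Balaban1987RG1, (0.17)–(0.20) pp.255–256 (bookkeeping)] -/
def Window13V (F : T4Family) (θ : Node00.Stage13HParams F 2) (hP : θ.Provisos₁₃SepCoPH F 2) (v : Node00.Revision₁₃ F 2 θ hP) : Prop :=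
  ∃ γ₁ : ℝ, 0 < γ₁ ∧ ∀ γ : ℝ, 0 < γ → γ ≤ γ₁ → ∃ P : B12.RunParams, 1 ≤ P.K ∧ ((Node00.datumOfRecord₁₃SepCoPHV F 2 θ hP v).C P).flow.InInterval γ P.K

/-- **THE WINDOW IS VERSION-FREE** (`Iff.rfl` over DEF-1's `flow_datumOfRecord₁₃SepCoPHV`). [folklore] -/
theorem window13V_iff (F : T4Family) (θ : Node00.Stage13HParams F 2) (hP : θ.Provisos₁₃SepCoPH F 2) (v : Node00.Revision₁₃ F 2 θ hP) :
    Window13V F θ hP v ↔ Window13 F θ hP := Iff.rfl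

/-- **K1⁹'s WITNESS HALF (SHAPE; rev 28 files no K1⁷ⱽ item — the slot lives inside K1⁹)**: K1⁷'s conclusion with the version slot — (B) AS PRINTED at the re-chosen datum, the window
at it.  A hypothesis text for ★¹¹ⱽ, never a fact. [cite: Balaban1989LargeFieldII, Thm 1 + Cor. 3 (2.50) pp.355–364; Balaban1988Convergent, (2.18) p.257] -/
def WitnessV13 : Prop :=
  ∀ F : T4Family, (∃ θ : Node00.Stage13HParams F 2, θ.Provisos₁₃SepCoPH F 2 ∧ (θ.ZhUnity F 2 ∧ θ.SlotsNondegenerate₁₃ F 2) ∧ θ.Admissible F 2) →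
    ∃ (θ : Node00.Stage13HParams F 2) (h : θ.Provisos₁₃SepCoPH F 2) (v : Node00.Revision₁₃ F 2 θ h),
      (θ.ZhUnity F 2 ∧ θ.SlotsNondegenerate₁₃ F 2) ∧ θ.Admissible F 2 ∧
        B16.EndStatementBPrinted (Node00.datumOfRecord₁₃SepCoPHV F 2 θ h v).C ∧ Window13V F θ h v

/-- **K1⁷ ⟹ the slot witness, at the TRIVIAL revision** (the door `datumOfRecord₁₃SepCoPHV_refl` is `rfl`). [folklore] -/
theorem witnessV13_of_k1R7 (hK1 : Summit.QuantumFields.YangMills.Theses.BalabanUVNodes.StabilityBAtRecordR13SepCoPH) : WitnessV13 := by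
  intro F hex
  obtain ⟨θ, h, hU, hθ, hB, hwin⟩ := hK1 F hex
  exact ⟨θ, h, Node00.Revision₁₃.refl F 2 θ h, hU, hθ, hB, hwin⟩

/-- **A witness road's (δⱽ) SLOT DISPLAY ⟹ `WitnessV13`** (reshuffle; the window is version-free): «at an admissible unity tuple with the window, ∃ v, (B) AS PRINTED at the re-chosen
datum» — the inner `∃ v, …` is LITERALLY the conclusion shape of N13's landed junction `Theorems/BalabanUVNodesK1R9VersionSlotOfAEAtRecord`
(`exists_revision₁₃_endStatementBPrinted_of_ae(Display)`: Theorem 1's clause at the record + (2.50) pointwise@0 ∧ a.e.@≥1 on the window ⟹ `∃ v, (B)ⱽ`), not imported here. [folklore] -/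
theorem witnessV13_of_slotDisplay
    (hJ : ∀ F : T4Family, (∃ θ : Node00.Stage13HParams F 2, θ.Provisos₁₃SepCoPH F 2 ∧ (θ.ZhUnity F 2 ∧ θ.SlotsNondegenerate₁₃ F 2) ∧ θ.Admissible F 2) →
      ∃ (θ : Node00.Stage13HParams F 2) (h : θ.Provisos₁₃SepCoPH F 2), (θ.ZhUnity F 2 ∧ θ.SlotsNondegenerate₁₃ F 2) ∧ θ.Admissible F 2 ∧ Window13 F θ h ∧
        ∃ v : Node00.Revision₁₃ F 2 θ h, B16.EndStatementBPrinted (Node00.datumOfRecord₁₃SepCoPHV F 2 θ h v).C) :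
    WitnessV13 := by
  intro F hex
  obtain ⟨θ, h, hU, hθ, hwin, v, hB⟩ := hJ F hex
  exact ⟨θ, h, v, hU, hθ, hB, (window13V_iff F θ h v).2 hwin⟩

/-- **★¹¹ (REV-28 RE-KEY OF ★¹⁰ — proved, no sorry): K1⁷ + `LinOnRuns13R ∧ DriftAtN13R ∧ ContAlongRuns13R` about the RUN object ⟹ the NEW DECIDING K1⁹
`StabilityBRunRowsAtRecordR13SepCoPHV` BY NAME**, at the trivial revision of K1⁷'s witness.  Same conditional status as ★¹⁰ (K1⁷ aside-open; `𝓡` inhabited nowhere; obligations are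
obligations; K1⁹ NOT closed; Clay NOT proved). [folklore] -/
theorem k1R9_of_k1R7_runOnly (𝓡 : RunRecordRepr13) (hL : LinOnRuns13R 𝓡) (hD : DriftAtN13R 𝓡) (hC : ContAlongRuns13R 𝓡)
    (hK1 : Summit.QuantumFields.YangMills.Theses.BalabanUVNodes.StabilityBAtRecordR13SepCoPH) :
    Summit.QuantumFields.YangMills.Theses.BalabanUVNodes.StabilityBRunRowsAtRecordR13SepCoPHV := by
  intro F hex
  obtain ⟨θ, h, hU, hθ, hB, hwin⟩ := hK1 F hex
  obtain ⟨b', r, γ₁, M, hγ₁, hrem, hfl, hsc⟩ := runRows13_of_runOnly 𝓡 hL hD hC F θ h hU hθ hB hwin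
  exact ⟨θ, h, Node00.Revision₁₃.refl F 2 θ h, hU, hθ, hB, hwin, b', r, γ₁, M, hγ₁, hrem, hfl, hsc⟩

/-- ED.5's box edition re-keyed too: ★⁸ ⟹ K1⁹ (`ofBox`). [folklore] -/
theorem k1R9_of_k1R7_linOnRuns_drift_cont (𝓑 : BoxRecordRepr13) (hL : LinOnRuns13 𝓑) (hD : DriftAtN13 𝓑) (hC : ContOnBox13 𝓑)
    (hK1 : Summit.QuantumFields.YangMills.Theses.BalabanUVNodes.StabilityBAtRecordR13SepCoPH) :
    Summit.QuantumFields.YangMills.Theses.BalabanUVNodes.StabilityBRunRowsAtRecordR13SepCoPHV :=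
  k1R9_of_k1R7_runOnly (RunRecordRepr13.ofBox 𝓑) ((linOnRuns13R_ofBox_iff 𝓑).2 hL) ((driftAtN13R_ofBox_iff 𝓑).2 hD)
    (contAlongRuns13R_of_contOnBox13 𝓑 hC) hK1

/-- **`RunRecordRepr13V` — D-REPR's run type KEYED TO THE SLOT (one more binder `v`; (B) AS PRINTED at the re-chosen datum; the window unchanged, version-free).**  For witness roads
that deliver (B) only at a NON-trivial version.  The representation is of `betaOfRecord₁₃ θ` (θ-level, slot-free: `βfun_datumOfRecord₁₃SepCoPHV` is `rfl`).  NOT constructed here.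
[cite: Balaban1987RG1, (1.22) p.264 and (2.13) p.268; Balaban1988RG2Cluster, Lemma 3 (2.38) p.20] -/
structure RunRecordRepr13V where
  /-- the history-free part: print's one-loop numbers transported to the record (slot-free) -/
  N : (F : T4Family) → (θ : Node00.Stage13HParams F 2) → θ.Provisos₁₃SepCoPH F 2 → ℕ → ℝ
  /-- the window of the representation (slot-free) -/
  γ₀ : (F : T4Family) → (θ : Node00.Stage13HParams F 2) → θ.Provisos₁₃SepCoPH F 2 → ℝ
  γ₀_pos : ∀ F θ hP, 0 < γ₀ F θ hP
  repr : ∀ (F : T4Family) (θ : Node00.Stage13HParams F 2) (hP : θ.Provisos₁₃SepCoPH F 2) (v : Node00.Revision₁₃ F 2 θ hP),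
    (θ.ZhUnity F 2 ∧ θ.SlotsNondegenerate₁₃ F 2) → θ.Admissible F 2 →
    B16.EndStatementBPrinted (Node00.datumOfRecord₁₃SepCoPHV F 2 θ hP v).C → Window13 F θ hP →
    ActivityRepr (Node00.betaOfRecord₁₃ F 2 θ.toStage13Params) (N F θ hP) (γ₀ F θ hP)

/-- S-LIN along runs about the slot-keyed object (THIS CARD's obligation; text = `LinOnRuns`). [cite: Balaban1987RG1, (2.13) p.268; Balaban1988RG2Cluster, (1.38)–(1.40) p.10] -/
def LinOnRuns13RV (𝓡 : RunRecordRepr13V) : Prop :=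
  ∀ (F : T4Family) (θ : Node00.Stage13HParams F 2) (hP : θ.Provisos₁₃SepCoPH F 2) (v : Node00.Revision₁₃ F 2 θ hP)
    (hU : θ.ZhUnity F 2 ∧ θ.SlotsNondegenerate₁₃ F 2) (hθ : θ.Admissible F 2)
    (hB : B16.EndStatementBPrinted (Node00.datumOfRecord₁₃SepCoPHV F 2 θ hP v).C) (hwin : Window13 F θ hP),
    LinOnRuns (𝓡.repr F θ hP v hU hθ hB hwin)

/-- (D1)'s drift sign at the slot-keyed object's numbers (obligation). [cite: Balaban1987RG1, Thm 2 p.259 and (1.22) p.264] -/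
def DriftAtN13RV (𝓡 : RunRecordRepr13V) : Prop :=
  ∀ (F : T4Family) (θ : Node00.Stage13HParams F 2) (hP : θ.Provisos₁₃SepCoPH F 2) (v : Node00.Revision₁₃ F 2 θ hP),
    (θ.ZhUnity F 2 ∧ θ.SlotsNondegenerate₁₃ F 2) → θ.Admissible F 2 →
    B16.EndStatementBPrinted (Node00.datumOfRecord₁₃SepCoPHV F 2 θ hP v).C → Window13 F θ hP →
    ∃ s A : ℝ, 0 < s ∧ OneLoopDrift s A (𝓡.N F θ hP)

/-- (a0ᴿ) along runs about the slot-keyed object (obligation). [cite: Balaban1987RG1, Thm 3 p.264 and §5 p.298] -/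
def ContAlongRuns13RV (𝓡 : RunRecordRepr13V) : Prop :=
  ∀ (F : T4Family) (θ : Node00.Stage13HParams F 2) (hP : θ.Provisos₁₃SepCoPH F 2) (v : Node00.Revision₁₃ F 2 θ hP)
    (hU : θ.ZhUnity F 2 ∧ θ.SlotsNondegenerate₁₃ F 2) (hθ : θ.Admissible F 2)
    (hB : B16.EndStatementBPrinted (Node00.datumOfRecord₁₃SepCoPHV F 2 θ hP v).C) (hwin : Window13 F θ hP),
    ContAlongRuns (𝓡.repr F θ hP v hU hθ hB hwin)

/-- **★¹¹ⱽ (slot-generic road — proved, no sorry): the slot-keyed run object + its three obligations + K1⁹'s witness half ⟹ K1⁹ BY NAME**, at WHATEVER version the witness road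
delivers.  CONDITIONAL as ★¹¹. [folklore] -/
theorem k1R9_of_witnessV_runOnlyV (𝓡 : RunRecordRepr13V) (hL : LinOnRuns13RV 𝓡) (hD : DriftAtN13RV 𝓡) (hC : ContAlongRuns13RV 𝓡) (hW : WitnessV13) :
    Summit.QuantumFields.YangMills.Theses.BalabanUVNodes.StabilityBRunRowsAtRecordR13SepCoPHV := by
  intro F hex
  obtain ⟨θ, h, v, hU, hθ, hB, hwin⟩ := hW F hex
  have hwin' : Window13 F θ h := (window13V_iff F θ h v).1 hwin
  obtain ⟨s, A, hs, hd⟩ := hD F θ h v hU hθ hB hwin'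
  obtain ⟨γ₁, hγ₁, -, hrem, hfl, hsc⟩ :=
    runRows_of_runOnly (𝓡.repr F θ h v hU hθ hB hwin') (hL F θ h v hU hθ hB hwin') (𝓡.γ₀_pos F θ h) hs hd (hC F θ h v hU hθ hB hwin')
  exact ⟨θ, h, v, hU, hθ, hB, hwin, 𝓡.N F θ h, s, γ₁, 2 * A, hγ₁, hrem, hfl, hsc⟩

/-- **`RunRecordRepr13T` — the THEOREM-1-KEYED demand (the principled slot-free type):** the constructor may use (B) only through [16] Theorem 1's clause `B16.Thm1Printed`, which is
VERSION-FREE (`thm1Printed_datumOfRecord₁₃SepCoPHV_iff`, `Iff.rfl`) — the §2 form of the small-field densities along runs, i.e. what the β expansion of [I]∕[II] reads ((0.22)–(0.25));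
Cor. 3 (2.50), the only slot-sensitive conjunct, is not offered to it.  Whether D-REPR can be built from Thm 1 alone is the DEFINER's call; if yes, ONE object serves every version
(`toV`) and the rev-27 keying (`toR`).  NOT constructed here. [cite: Balaban1989LargeFieldII, Thm 1 p.355; Balaban1987RG1, (0.22)–(0.25) pp.256–257 and (2.13) p.268] -/
structure RunRecordRepr13T where
  /-- the history-free part (slot-free) -/
  N : (F : T4Family) → (θ : Node00.Stage13HParams F 2) → θ.Provisos₁₃SepCoPH F 2 → ℕ → ℝ
  /-- the window of the representation (slot-free) -/
  γ₀ : (F : T4Family) → (θ : Node00.Stage13HParams F 2) → θ.Provisos₁₃SepCoPH F 2 → ℝ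
  γ₀_pos : ∀ F θ hP, 0 < γ₀ F θ hP
  repr : ∀ (F : T4Family) (θ : Node00.Stage13HParams F 2) (hP : θ.Provisos₁₃SepCoPH F 2),
    (θ.ZhUnity F 2 ∧ θ.SlotsNondegenerate₁₃ F 2) → θ.Admissible F 2 →
    B16.Thm1Printed (Node00.datumOfRecord₁₃SepCoPH F 2 θ hP).C → Window13 F θ hP →
    ActivityRepr (Node00.betaOfRecord₁₃ F 2 θ.toStage13Params) (N F θ hP) (γ₀ F θ hP)

/-- A Thm-1-keyed object serves EVERY version (Theorem 1's clause is version-free: `Iff.rfl`). [folklore] -/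
def RunRecordRepr13T.toV (𝓣 : RunRecordRepr13T) : RunRecordRepr13V where
  N := 𝓣.N
  γ₀ := 𝓣.γ₀
  γ₀_pos := 𝓣.γ₀_pos
  repr := fun F θ hP v hU hθ hB hwin => 𝓣.repr F θ hP hU hθ ((Node00.thm1Printed_datumOfRecord₁₃SepCoPHV_iff F 2 θ hP v).1 hB.1) hwin

/-- … and the rev-27 keying (forget Cor. 3; `βfun_datumOfRecord₁₃SepCoPH` is `rfl`). [folklore] -/
def RunRecordRepr13T.toR (𝓣 : RunRecordRepr13T) : RunRecordRepr13 where
  N := 𝓣.N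
  γ₀ := 𝓣.γ₀
  γ₀_pos := 𝓣.γ₀_pos
  repr := fun F θ hP hU hθ hB hwin => 𝓣.repr F θ hP hU hθ hB.1 hwin

/-- The Thm-1-keyed obligations (texts = `LinOnRuns` ∕ (D1) drift ∕ `ContAlongRuns` about `𝓣.repr`, antecedent Theorem 1's clause only). [cite: Balaban1987RG1, (2.13) p.268, Thm 2 p.259, Thm 3 p.264] -/
def LinOnRuns13T (𝓣 : RunRecordRepr13T) : Prop :=
  ∀ (F : T4Family) (θ : Node00.Stage13HParams F 2) (hP : θ.Provisos₁₃SepCoPH F 2) (hU : θ.ZhUnity F 2 ∧ θ.SlotsNondegenerate₁₃ F 2) (hθ : θ.Admissible F 2)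
    (hT : B16.Thm1Printed (Node00.datumOfRecord₁₃SepCoPH F 2 θ hP).C) (hwin : Window13 F θ hP), LinOnRuns (𝓣.repr F θ hP hU hθ hT hwin)

/-- (D1)'s drift sign at the Thm-1-keyed object's numbers. [cite: Balaban1987RG1, Thm 2 p.259 and (1.22) p.264] -/
def DriftAtN13T (𝓣 : RunRecordRepr13T) : Prop :=
  ∀ (F : T4Family) (θ : Node00.Stage13HParams F 2) (hP : θ.Provisos₁₃SepCoPH F 2), (θ.ZhUnity F 2 ∧ θ.SlotsNondegenerate₁₃ F 2) → θ.Admissible F 2 →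
    B16.Thm1Printed (Node00.datumOfRecord₁₃SepCoPH F 2 θ hP).C → Window13 F θ hP → ∃ s A : ℝ, 0 < s ∧ OneLoopDrift s A (𝓣.N F θ hP)

/-- (a0ᴿ) along runs about the Thm-1-keyed object. [cite: Balaban1987RG1, Thm 3 p.264 and §5 p.298] -/
def ContAlongRuns13T (𝓣 : RunRecordRepr13T) : Prop :=
  ∀ (F : T4Family) (θ : Node00.Stage13HParams F 2) (hP : θ.Provisos₁₃SepCoPH F 2) (hU : θ.ZhUnity F 2 ∧ θ.SlotsNondegenerate₁₃ F 2) (hθ : θ.Admissible F 2)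
    (hT : B16.Thm1Printed (Node00.datumOfRecord₁₃SepCoPH F 2 θ hP).C) (hwin : Window13 F θ hP), ContAlongRuns (𝓣.repr F θ hP hU hθ hT hwin)

/-- The Thm-1-keyed obligations transport to the slot-keyed ones of `toV` (Theorem 1's clause read off (B)'s first conjunct at any version). [folklore] -/
theorem linOnRuns13RV_toV_of (𝓣 : RunRecordRepr13T) (h : LinOnRuns13T 𝓣) : LinOnRuns13RV 𝓣.toV :=
  fun F θ hP v hU hθ hB hwin => h F θ hP hU hθ ((Node00.thm1Printed_datumOfRecord₁₃SepCoPHV_iff F 2 θ hP v).1 hB.1) hwin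

theorem contAlongRuns13RV_toV_of (𝓣 : RunRecordRepr13T) (h : ContAlongRuns13T 𝓣) : ContAlongRuns13RV 𝓣.toV :=
  fun F θ hP v hU hθ hB hwin => h F θ hP hU hθ ((Node00.thm1Printed_datumOfRecord₁₃SepCoPHV_iff F 2 θ hP v).1 hB.1) hwin

/-- **★¹¹ᵀ (THE THEOREM-1-KEYED ROAD — proved, no sorry): the Thm-1-keyed run object + its three obligations + K1⁹'s witness half (at ANY version — e.g. N13's a.e. junction
`K1R9VersionSlotOfAEAtRecord.exists_revision₁₃_endStatementBPrinted_of_ae`, whose own input is `Thm1Printed` at the record) ⟹ K1⁹ BY NAME.**  The composition a LINE on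
stmt-QuantumFields-27364 would `exact` once D-REPR is delivered as `activityReprOfRecord₁₃ : RunRecordRepr13T`.  CONDITIONAL (object inhabited nowhere; obligations are obligations;
K1⁹ NOT closed; Clay NOT proved). [folklore] -/
theorem k1R9_of_witnessV_runOnlyT (𝓣 : RunRecordRepr13T) (hL : LinOnRuns13T 𝓣) (hD : DriftAtN13T 𝓣) (hC : ContAlongRuns13T 𝓣) (hW : WitnessV13) :
    Summit.QuantumFields.YangMills.Theses.BalabanUVNodes.StabilityBRunRowsAtRecordR13SepCoPHV :=
  k1R9_of_witnessV_runOnlyV 𝓣.toV (linOnRuns13RV_toV_of 𝓣 hL)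
    (fun F θ hP v hU hθ hB hwin => hD F θ hP hU hθ ((Node00.thm1Printed_datumOfRecord₁₃SepCoPHV_iff F 2 θ hP v).1 hB.1) hwin)
    (contAlongRuns13RV_toV_of 𝓣 hC) hW

/-- … and through K1⁷ (trivial revision) ∕ on the aside K1⁸ (`toR`), for completeness. [folklore] -/
theorem k1R9_of_k1R7_runOnlyT (𝓣 : RunRecordRepr13T) (hL : LinOnRuns13T 𝓣) (hD : DriftAtN13T 𝓣) (hC : ContAlongRuns13T 𝓣)
    (hK1 : Summit.QuantumFields.YangMills.Theses.BalabanUVNodes.StabilityBAtRecordR13SepCoPH) :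
    Summit.QuantumFields.YangMills.Theses.BalabanUVNodes.StabilityBRunRowsAtRecordR13SepCoPHV :=
  k1R9_of_witnessV_runOnlyT 𝓣 hL hD hC (witnessV13_of_k1R7 hK1)

theorem k1R8_of_k1R7_runOnlyT (𝓣 : RunRecordRepr13T) (hL : LinOnRuns13T 𝓣) (hD : DriftAtN13T 𝓣) (hC : ContAlongRuns13T 𝓣)
    (hK1 : Summit.QuantumFields.YangMills.Theses.BalabanUVNodes.StabilityBAtRecordR13SepCoPH) :
    Summit.QuantumFields.YangMills.Theses.BalabanUVNodes.StabilityBRunRowsAtRecordR13SepCoPH :=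
  k1R8_of_k1R7_runOnly 𝓣.toR (fun F θ hP hU hθ hB hwin => hL F θ hP hU hθ hB.1 hwin) (fun F θ hP hU hθ hB hwin => hD F θ hP hU hθ hB.1 hwin)
    (fun F θ hP hU hθ hB hwin => hC F θ hP hU hθ hB.1 hwin) hK1

end Rev28


end Summit.QuantumFields.YangMills.Cruxes.EndpointGivenBR13SepCoPH.Idea5g13

end
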